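import Summits.Ventures.HSemireg.Pad4TowerXresFamilies
import Summits.Ventures.HSemireg.Pad4TowerLineLetters
import Summits.Ventures.HSemireg.Pad4TowerSeedB1Odd
import Summits.Ventures.HSemireg.Pad4TowerLineDesignCert12

/-!
# H2 door PAD-4 · lens «control» (g9) — UNIT PHASE RIGIDITY and the PHASE-TYPE THRESHOLD LAW on the LINE

`plan-lens-HodgeAV-control` g9 (director-hodge req-36, LENSES-v3 «control»; crux of record H2 = `stmt-HodgeConjecture-18881`
`BlochSeedDiscOne`; critic of record idea-crit-6). Companion memo `LINE-PHASE-RIGIDITY-g9.md` (same crux directory). Second crux file of the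
lineage: `LineInertia.lean` v6 (g4–g8, 196 kB, at the size cap) is NOT importable from here, so Part A is a verbatim copy of its §1–§4 toolkit.

HONEST FRAMING. Nothing in this file proves or approaches HC ∕ HC_CM ∕ HC_AV ∕ H2 = 18881 ∕ №4 ∕ 26512; HC_CM is not used; no route, no item,
no proposal. The objects are the census's typed first-order designs (`Pad4Tower*`: `MConfig`, RULE D = `RuleDMu4Closed`, `X+` = `XPlusClosed`,
`G₁` = `MConfig.G1Closed`, odd core = `MConfig.HasOddFC`) restricted to the LINE (`lineLetter h c k = (h−c)·I + c·ℓ_{i^k}`), i.e. the W-LINE rows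
of the bc5-plan census. Kernel theorems are marked PROVED; SAT∕UNSAT digits of my own closed-form census are MACHINE (not kernel, not a rung).

## The control question (req-36 «control» key) and this cycle's answer

req-36: «find the controlling quantity whose value certifies “no odd FC” at height h, conjecture its law in h from ◇₆ ∕ ◇₈ ∕ ◇₁₀, type the
h-uniform statement». Census of record (bc5-plan birth-v4 rows W16∕W17∕W22∕W30∕W31; ◇₈ r3 j305149, ◇₁₀ G₁ j308425; W-LINE: LINE-8 and LINE-10
«odd FC present» UNSAT ×2 (j326579 ∕ j326707), LINE-12 SAT = the tree certificate `Pad4TowerLineDesignCert12` (j326935, design `1beef026ebdf95b9`)).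

ANSWER (this file). On the LINE the controlling quantity is the PHASE TYPE of a fully charged cell — the multiset of the four phase tags
`k_f ∈ ℤ∕4` of its letters up to the global shift `Δ` — and the mechanism that prices it is UNIT PHASE RIGIDITY:

* PROVED, h-UNIFORM, NO SYMMETRY (`unit_sibling_exclusion`, `unit_phase_rigid`, §B1): in any RULE-D-closed `X+`-closed effective LINE-`h`
  support, a present `P`-cell with an apex letter on some factor and a UNIT letter `(1,k)` on `σ` has NO present sibling `P(σ ↦ (1,k″))`,
  `k″ ≠ k`. (RULE D (RD-P) puts the unit hub `P(σ ↦ hI)` on the `N` level; a unit letter has no shallower letter of its phase and a unit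
  sibling no companion, so the apex-demand clause `X+` fires — `xplus_fires` at `c = e = 1`.) `X+` is the ONLY axiom of the typed statics in
  which two phases meet, and at charge 1 it is rigid.
* PROVED, h-UNIFORM, under `G₁ = ⟨Δ⟩ × S₄` (`unit_twin_law`, `unit_pair_antipodal`, §B2): no present `P`-cell `P(hI, hI, (1,k), (1,k+1))`
  (any two factors) — its `G₁`-twin `swap ∘ Δ` is the forbidden sibling; hence two unit letters next to two apex letters are EQUAL or ANTIPODAL
  in phase — the first THRESHOLD-FREE exclusion law of the lineage (machine: `P[A|A|1₀|1₁]` UNSAT at every h ≤ 16, `P[A|A|1₀|1₂]` SAT from 4).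
* TYPED (§C3): `OddFCFreeLine h` (OL_h: no odd fully charged cell in any `G₁`-static effective LINE-h support), `PureFCLine h` (PP_h: every FC cell
  phase-pure), `AntipodalFCLine h` (AP_h: every FC cell has its charged phases in one class `{k₀, k₀+2}`), with the PROVED chain
  `PP_h → AP_h → OL_h` (`oddFCFreeLine_of_antipodal`: an antipodal FC cell has all four parity bits `kbit` equal, pattern `0000`∕`1111`, not `OddPat`),
  the PROVED SAT side `not_oddFCFreeLine_twelve : ¬ OddFCFreeLine 12` (from the tree's kernel certificate `LineDesignCert12.cfg`, via the census
  glue `lsupport_of_diamond_ceiling`: `InDiamond` + `OnCeiling` ⇒ effective LINE letters), and the typed laws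
  `OddLineThresholdLaw := (∀ h ≤ 10, OddFCFreeLine h) ∧ ¬ OddFCFreeLine 12` and `PhaseTypeLaw := PureFCLine 8 ∧ AntipodalFCLine 10`
  (`oddFCFree_of_phaseTypeLaw : PhaseTypeLaw → OddFCFreeLine 8 ∧ OddFCFreeLine 10`). `OddLineThresholdLaw` is PROVED OUTRIGHT in Part J
  (`oddLineThresholdLaw_holds`; v1.7) and `PhaseTypeLaw` in Part K (`phaseTypeLaw_holds`; v1.8, with the h-uniform
  `pureFCLine_of_lt_ten`, `antipodalFCLine_of_lt_twelve`) — no finite check of either typed law stays MACHINE.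
* PROVED REDUCTION — THEOREM FIRST, COMPUTATION SECOND (Part D): the presence predicates of any `G₁`-static effective LINE-`h` support form an
  ABSTRACT LINE MODEL (`LineModel h`: the four closed forms as clauses on abstract cells `(c_f, k_f)_f`, the bound `2c ≤ h`, apex-tag and
  `G₁` invariance — `lineModel_of_config`; monotone in `h`, `LineModel.mono`), and `oddLineThresholdLaw_of_abstract : AbstractOddFree 10 →
  OddLineThresholdLaw`, `phaseTypeLaw_of_abstract : AbstractPureFC 8 → AbstractAntipodalFC 10 → PhaseTypeLaw`, where the abstract absence
  statements are EXACTLY the UNSAT statements of the `G₁`-orbit instances my encoder feeds to the solver (variables = abstract cells modulo the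
  model's `perm`∕`shift`∕`apex` invariances, clauses = the fields `rdP`∕`rdN2`∕`rdN1`∕`xplus` under the bound).  These finite checks were first
  certified MACHINE (cadical 2.1.2 `--check --checkproof=3`, LRAT: `L10-G1.cnf` d379a3705eae639b ∕ `L10-G1.lrat` 147afdc5e73dec27, `L8-G1`,
  `L8-G1-mixfc`, `L10-G1-nap`; memo §6) and are now DISCHARGED IN THE KERNEL h-uniformly: `abstractOddFree_of_lt_twelve` (Part J),
  `abstractPureFC_of_lt_ten`, `abstractAntipodalFC_of_lt_twelve` (Part K).  Also PROVED: `not_abstractOddFree_of_twelve_le`, the nesting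
  `AbstractPureFC h → AbstractAntipodalFC h → AbstractOddFree h`, antitonicity in `h`, failure of all three at every `h ≥ 12`.
* Part E — **the CEILING GAP LAW** (h-UNIFORM, PROVED from RD-P∕RD-N alone, abstract model ⇒ every LINE design): a fully charged
  `P`-cell has every charge `c` with `2(c+2) ≤ h`, a fully charged `N`-cell `2(c+3) ≤ h` (`LineModel.fcP_gap`∕`fcN_gap`,
  `fc_ceiling_gap_P`∕`_N`); hence no FC `P`-cell below `h = 6`, no FC `N`-cell below `8`, `OddFCFreeLine h` for every `h < 6`
  outright, presence descends `N → P` with tags kept (`fcN_absent_of_fcP_absent`, the proved half of `t_N = t_P + 2`), and the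
  finite check reduces to its bottom nucleus (`abstractOddFree_of_nucleus`).  MACHINE (`DEPTH-G1-h8-18.txt` c6067236872d0c33, `TGRID-G1-h16-P.txt`):
  gaps by phase type `g_P(T) = 3 ∕ 4 ∕ 6` (`000x` ∕ pair types ∕ `0123`), `g_N = g_P + 1`, and FLOORS `f_P(T)` (odd FC needs `n ≥ 6` on `P`, `7` on `N`):
  presence iff `n ≥ max(m + g_L(T), f_L(T))` for the tallest letter `m` — the finer control quantity; kernel for `g`, Parts F–G; floors machine.
* Part F — **the SHARP ceiling gap law, PROVED h-uniformly: `g_P = 3`, `g_N = 4`** (kernel = machine for the phase-blind part).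
  New lever `LineModel.n_ceiling_absent`: NO `N`-cell carries a ceiling letter (`2(c+1) > h`) — alone it would be served (RD-N1)
  by `P`-siblings of two different tags on one slot, which share the hub and have no companions, so `X+` fires.  Then
  `p_ceiling_absent`, `n2_gap_two`, `p3_gap_two`, `n3_gap_three`, **`fcP_gap_three`** (FC `P`: `2(c+3) ≤ h`), **`fcN_gap_four`**
  (FC `N`: `2(c+4) ≤ h`); design forms `fc_ceiling_gap_P_three` ∕ `fc_ceiling_gap_N_four`; **`no_fc_below_eight`** (no FC cell on any LINE design with `h < 8`),
  `no_fcN_below_ten`, **`oddFCFreeLine_of_lt_eight`**, and `abstractOddFree_of_sharpNucleus` (at `h = 10` only odd cells with all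
  charges `≤ 2` on `P` ∕ `= 1` on `N` remain — the 44 orbits of `UPLOCAL-L10-G1.txt`).
* Part G — **the first PHASE-SENSITIVE ceiling law, PROVED h-uniformly: the pair-type gap `g_P(T) ≥ 4`, `g_N(T) ≥ 5`.**
  `LineModel.tag_unique` (all `P`-completions of a RIGID frame at one slot carry the same tag: bare hub + no companions ⇒ `X+`), `p3_tags` ∕
  `n3_tags` (three charged slots with a top letter ⇒ the two lower tags are EQUAL), **`fcP_three_tags`** (FC `P`: next to a letter with
  `2(c+4) > h` the other three tags coincide), `fcN_three_tags` (`2(c+5) > h`); design forms **`fc_pair_gap_P`** (`2(c+4) ≤ h` as soon as two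
  of the other letters have different tags) ∕ **`fc_pair_gap_N`** (`2(c+5) ≤ h`) = the machine's `g(T) = 4 ∕ 5` for the pair types.
* Part H — **TOP PAIR PARITY (PROVED h-uniformly; uses the shift `Δ`)**: two letters of EQUAL charge at the top admissible level of their
  census (`2(c+2) > h` on `P`, `2(c+3) > h` on `N`; other slots apex) have equal or antipodal tags (`p_top_pair_parity`,
  `n_top_pair_parity`, design form `top_pair_parity_P`); helper laws `congrP`∕`congrN` (presence ignores apex tags), `shiftP_by`.
* Part I — **NO ODD FC BELOW TEN, PROVED h-uniformly (`oddFCFreeLine_of_lt_ten : h < 10 → OddFCFreeLine h`)** — the `(OL₈)`, `(OL₉)`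
  rows of the census, formerly MACHINE (`L8-G1` LRAT), are KERNEL: below twelve a fully charged `N`-cell has four equal tags
  (`fcN_tags_const`, **`no_oddN_below_twelve`**, design form `no_odd_fcN_below_twelve`); below ten a fully charged `P`-cell is a unit
  cell whose RD-P requests land on 3-unit `N`-cells, and `n3_tags` makes every three of its tags equal (`no_oddP_below_ten`).  Below
  twelve an odd FC `P`-cell is a UNIT cell or «one charge-2 letter + three equally tagged units» (`oddP_shape_below_twelve`), so the
  single remaining machine fact is the absence of this UNIT NUCLEUS at `h = 10` (`AbstractOddUnitNucleusFree 10`;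
  `abstractOddFree_of_unitNucleus`, **`oddLineThresholdLaw_of_unitNucleus : AbstractOddUnitNucleusFree 10 → OddLineThresholdLaw`**).
  MACHINE → KERNEL: with the PROVED laws of Parts E–I added as clauses every odd unit-nucleus orbit at ten dies by UNIT PROPAGATION
  (`kern10.py`, `upchain.py`: forced chains of 10–28 literals, `UPCHAIN-h10*.txt`); Parts J–L read those chains as h-uniform theorems.
* Part J — **THE UNIT NUCLEUS BELOW TWELVE, PROVED h-uniformly ⇒ `OddLineThresholdLaw` IS A THEOREM (`oddLineThresholdLaw_holds`,
  sorry-free, axioms standard) and `oddFCFreeLine_of_lt_twelve : h < 12 → OddFCFreeLine h`.**  Abstract levers: `unit_hub`,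
  `unit_sibling` (Part B in the abstract model), `two_sibling`, `raise3`∕`raise2` (RD-N2 landings pinned by `p3_gap_two`∕`p3_tags`∕
  `p_ceiling_absent`), `shiftN_by`; the three refutations `n_three_units_antipodal` ⇒ **`unitP_antipodal_absent`** (types `0012∕0023`:
  both antipodal units raise to charge 2 and the two raised cells are unit siblings after a swap and a shift by 2),
  `top3_sibling4`∕`top3_N3`∕`top3_package` + `w_of` + `z_absent` ⇒ **`two_units3_absent`** (the `(2;1,1,1)` cells) and
  **`units4_odd_absent`** (type `000t`, `t` odd — the only place `2t ≠ 0` enters: the unit sibling `k − t ≠ k + t` of the charge-3 raise);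
  the tag-word case split `odd_unit_tags` (`decide`); `abstractOddUnitNucleusFree_of_lt_twelve`, `abstractOddFree_of_lt_twelve`.
  Nothing MACHINE is left under the odd threshold law.
* Part K — **THE PHASE-TYPE LAW IS A THEOREM: `phaseTypeLaw_holds : PhaseTypeLaw` (= `PureFCLine 8 ∧ AntipodalFCLine 10`; sorry-free,
  axioms standard), h-uniformly `pureFCLine_of_lt_ten : h < 10 → PureFCLine h` and `antipodalFCLine_of_lt_twelve : h < 12 → AntipodalFCLine h`**
  (sharp: `not_antipodalFCLine_twelve` PROVED; type `0022` present at ten is MACHINE).  New lever **`units_0011_absent`** (types `0011`∕`0033`: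
  the two hubs `U[a ≔ apex]`, `U[c ≔ apex]` raise to charge 2 (`raise3`) and the raised cells are unit siblings after the slot swap `a ↔ c`,
  `b ↔ d` and a shift by 1 — a UP chain of 12 literals at ten, `UPCHAIN-h10.txt`); a fully charged `P`-cell with a charge-2 letter has four
  equal tags below twelve (`fcP_tags_const_of_two`); the case split `nonanti_unit_tags` (`decide`); `abstractPureFC_of_lt_ten`,
  `abstractAntipodalFC_of_lt_twelve`.
* Part L (v1.9) — **THE FC SHAPE LAW BELOW TWELVE (PROVED, h-uniform): `fcShapeLine_of_lt_twelve`** — for `h < 12` every FC `N`-cell is pure and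
  every FC `P`-cell is pure or the unit cell `P[1_k,1_k,1_{k+2},1_{k+2}]` (lever `units_0002_absent`, a 22-literal UP chain; `fcP_shape_below_twelve`).
  The machine keeps only: the floors `f_P(T)`, `g(0123) = 6`, the SAT rows short of a tree certificate (that `0022` cell at 10; all types at 18)
  and the sub-FC presence probes (`TOPPROBE`∕`ALLPROBE`∕`KERN10`).

## The law in h (MACHINE; my closed-form census, hub-local, no kit — full detail in the memo §2, §6)

Encoder `oddline.py` 48b43999a976df83 ∕ `thresholds.py` 333503164ec6d661 (session folder `odd/`, mirror HOME `ctl/phase/`): variables = `G₁`-orbits of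
LINE-h cells `(c_f,k_f)`, `2c_f ≤ h`, both levels; clauses = EXACTLY the four kernel closed forms of Part A — (RD-P) `p_up_server`, (RD-N, c ≥ 2)
`n_down_server`, (RD-N, c = 1) `n_hub_alternative`, (X+) `xplus_fires` — = the fields of `LineModel` (Part D), so UNSAT(instance) ⇒ the finite check
(`validate.py`: 0 violated clauses on `Cert12` and `FC8G1`). Odd core: L8-G1 UNSAT (2 450 vars, 52 conflicts), L10-G1 UNSAT (5 352, 59), L12-G1 SAT
(odd cell `P[1₀|1₀|1₀|1₁]`) = the census's W-LINE triple; at 8 `S₄` alone suffices, at 10 the rotation `Δ` is load-bearing.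
PHASE-TYPE THRESHOLD TABLE (`THRESHOLDS-G1-h4-16.txt` 9eee82198d4573cd, `-h18.txt`; least even h with a cell of the type present, up to `Δ`):
  type   0000  0022  0002  0001∕0003  0011  0123  0012∕0013∕0023        (P level; the N level is P + 2 on every row; complete at 18)
  P        8    10    12      12       14    14        16
READING: PURE ⇒ 8, a second phase CLASS ⇒ 10, two ADJACENT phases or an ODD type ⇒ ≥ 12 (odd parity weight forces adjacency) — since v1.7 ∕ v1.8 ∕ v1.9
the rows «< 12» are KERNEL (Parts J, K, L); each further phase complication costs +2 (machine); no closed formula in T is claimed.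
CHEAPEST FALSIFIER (cell-level run of the census encoder `xres2s`∕b59 on the W-LINE alphabet, `JOB_ORBIT=g1`): (a) «an FC cell of phase type 0022
present» at LINE-10 — predicted SAT (the one live machine prediction); every other FC shape below twelve is UNSAT as a THEOREM here (Parts J–L), so a
SAT answer there would impeach the encoder pairing, not the kernel.

Audit: `lean check` rc 0, 0 sorry, 0 warnings; axioms of `unit_twin_law`, `not_oddFCFreeLine_twelve`, `oddLineThresholdLaw_holds`,
`phaseTypeLaw_holds`, `fcShapeLine_of_lt_twelve` = {propext, Classical.choice, Quot.sound}.
-/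

set_option linter.dupNamespace false

namespace Summit.HodgeConjecture.HodgeConjecture.Cruxes.BlochSeedDiscOne.LinePhaseRigidity

open Finset Summit.Ventures.HSemireg.Pad4Tower Summit.Ventures.HSemireg.LinePhaseTorus

/-! # Part A — the LINE toolkit (verbatim local copy of `LineInertia.lean` v6 §1–§4, commit 06a81ba2af55; Cruxes modules are not importable) -/

/-! ## §1 Effective LINE letters and LINE supports -/

/-- `x` is an EFFECTIVE LINE-`h` LETTER: `x = lineLetter h c k = ((h − c)·I + c·ℓ_{i^k})` with `2c ≤ h` (effective from `O`). -/
abbrev IsLL (h : ℤ) (x : BPoint) : Prop := ∃ c : ℕ, ∃ k : Fin 4, 2 * (c : ℤ) ≤ h ∧ x = lineLetter h c k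

/-- an EFFECTIVE LINE-`h` SUPPORT: every letter of every cell, on both levels, is an effective LINE-`h` letter. -/
abbrev LSupport (h : ℤ) (C : MConfig) : Prop :=
  (∀ Z ∈ C.lower, ∀ f, IsLL h (Z f)) ∧ (∀ P ∈ C.upper, ∀ f, IsLL h (P f))

/-- the charge-`0` letter is the apex `hI`, whatever the phase tag. -/
theorem lineLetter_zero (h : ℤ) (k : Fin 4) : lineLetter h 0 k = (h, 0, 0) := by
  simp [lineLetter]

/-- a LINE letter is an apex point iff its charge is `0`. -/
theorem isApex_lineLetter_iff (h : ℤ) (c : ℕ) (k : Fin 4) : isApex (lineLetter h c k) ↔ c = 0 := by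
  fin_cases k <;> simp [lineLetter, isApex]

/-- a LINE letter of phase `k` is adapted to its own direction `k` and to the antipode `k + 2`. -/
theorem adapted_lineLetter (h : ℤ) (c : ℕ) (k : Fin 4) :
    Adapted (lineLetter h c k) k ∧ Adapted (lineLetter h c k) (k + 2) := by
  fin_cases k <;> simp [lineLetter, Adapted]

/-- its own coordinate is `h`, its antipodal coordinate is `h − 2c`. -/
theorem coord_lineLetter (h : ℤ) (c : ℕ) (k : Fin 4) :
    coord (lineLetter h c k) k = h ∧ coord (lineLetter h c k) (k + 2) = h - 2 * c := by
  fin_cases k <;> simp [lineLetter, coord] <;> ring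

/-- the `α`-part of a LINE letter. -/
theorem lineLetter_fst (h : ℤ) (c : ℕ) (k : Fin 4) : (lineLetter h c k).1 = h - c := by
  simp [lineLetter]

/-- from the tree's hypotheses: a LINE cell (`LinePhaseTorus.LineCell`) with letters effective from `O` has effective LINE letters. -/
theorem isLL_of_lineCell {h : ℤ} {Z : MCell} (hZ : LineCell h Z) (heff : ∀ f, Effective (Z f)) (f : Fin 4) : IsLL h (Z f) := by
  obtain ⟨c, k, e⟩ := hZ f
  refine ⟨c, k, ?_, e⟩
  have h1 := heff f
  rw [e] at h1
  rcases h1 with ⟨h0, h2⟩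
  have hc0 : (0 : ℤ) ≤ c := by exact_mod_cast Nat.zero_le c
  fin_cases k <;> simp [lineLetter] at h0 h2 <;> nlinarith

/-! ## §2 The ray classification on the LINE (letter algebra) -/

/-- THE RAY CLASSIFICATION: if the LINE letter `(c′, k′)` lies `d ≥ 1` null steps above the LINE letter `(c, k)` in direction `r`, then
`r` is the antipode `k + 2` of the lower letter's phase, the charge drops by exactly `d`, and the phase is kept unless the apex is reached.
(So: up from a charged LINE letter only along its own ray towards `hI`; down from `hI` in all four directions; down from a charged
letter only along its own ray.) [64 cases, `omega`] -/
theorem up_classify {h : ℤ} {c c' : ℕ} {k k' r : Fin 4} {d : ℤ} (hd : 1 ≤ d)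
    (e : lineLetter h c' k' = ray (lineLetter h c k) r d) : r = k + 2 ∧ (c : ℤ) = c' + d ∧ (c' = 0 ∨ k' = k) := by
  fin_cases k <;> fin_cases k' <;> fin_cases r <;> simp [lineLetter, ray, Prod.ext_iff] at e ⊢ <;> omega

/-- transport through the `X+` dual (`dualPt 0`: letters negated): `−y = (−x) + d·n_r` iff `x = y + d·n_r`. -/
theorem of_dual_ray {x y : BPoint} {r : Fin 4} {d : ℤ} (e : dualPt 0 y = ray (dualPt 0 x) r d) : x = ray y r d := by
  obtain ⟨a, b, c⟩ := x
  obtain ⟨a', b', c'⟩ := y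
  fin_cases r <;> simp [dualPt, ray, Prod.ext_iff] at e ⊢ <;> omega

/-- the negated LINE letter `(c, k)` is `c` null steps above the negated apex in direction `k + 2`. -/
theorem dual_lineLetter (h : ℤ) (c : ℕ) (k : Fin 4) :
    dualPt 0 (lineLetter h c k) = ray (dualPt 0 (h, 0, 0)) (k + 2) c := by
  fin_cases k <;> simp [dualPt, lineLetter, ray, Prod.ext_iff] <;> ring

/-- in `Fin 4`: `k + 2 ≠ k`. -/
theorem add_two_ne (k : Fin 4) : k + 2 ≠ k := by
  fin_cases k <;> decide

/-- in `Fin 4`: `k + 1 ≠ k`. -/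
theorem add_one_ne (k : Fin 4) : k + 1 ≠ k := by
  fin_cases k <;> decide

/-! ## §3 RULE D on the LINE: the three closed forms -/

/-- **(RD-P) a RULE-D `P`-cell is served above along each charged letter's own ray**: if `P g` is the charged LINE letter `(c, k)`,
some present `N`-cell is `P(g ↦ (c′, k))` with `c′ < c` (`c′ = 0` = the apex). -/
theorem p_up_server {h : ℤ} {C : MConfig} (hlow : ∀ N ∈ C.lower, ∀ f, IsLL h (N f)) {P : MCell} (hPL : ∀ f, IsLL h (P f))
    (hD : RuleDMu4P C P) {g : Fin 4} {c : ℕ} {k : Fin 4} (hg : P g = lineLetter h c k) (hc : 1 ≤ c) :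
    ∃ N ∈ C.lower, ∃ c' : ℕ, c' < c ∧ N = Function.update P g (lineLetter h c' k) := by
  have hjg : g ≠ g + 1 := (add_one_ne g).symm
  obtain ⟨cj, kj, -, hj⟩ := hPL (g + 1)
  have had1 : Adapted (P g) (k + 2) := by rw [hg]; exact (adapted_lineLetter h c k).2
  have had2 : Adapted (P (g + 1)) kj := by rw [hj]; exact (adapted_lineLetter h cj kj).1
  have hne : coord (P g) (k + 2) ≠ coord (P (g + 1)) kj := by
    rw [hg, hj, (coord_lineLetter h c k).2, (coord_lineLetter h cj kj).1]
    have : (1 : ℤ) ≤ c := by exact_mod_cast hc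
    omega
  rcases hD g (g + 1) hjg (k + 2) kj had1 had2 hne with h1 | h2 | h3
  · obtain ⟨r, -, N, hN, hagree, hlt, hray⟩ := h1
    obtain ⟨c', k', -, hNg⟩ := hlow N hN g
    rw [hNg, hg] at hray hlt
    rw [lineLetter_fst, lineLetter_fst] at hlt
    have hd : (1 : ℤ) ≤ (lineLetter h c' k').1 - (lineLetter h c k).1 := by
      rw [lineLetter_fst, lineLetter_fst]; omega
    obtain ⟨-, -, hk⟩ := up_classify hd hray
    refine ⟨N, hN, c', by omega, ?_⟩
    funext f
    by_cases hf : f = g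
    · subst hf
      rw [Function.update_self, hNg]
      rcases hk with h0 | hk
      · subst h0; rw [lineLetter_zero, lineLetter_zero]
      · rw [hk]
    · rw [Function.update_of_ne hf]; exact (hagree f hf).symm
  · obtain ⟨r, hr, N, hN, -, hlt, hray⟩ := h2
    obtain ⟨c', k', -, hNj⟩ := hlow N hN (g + 1)
    rw [hNj, hj] at hray hlt
    have hd : (1 : ℤ) ≤ (lineLetter h c' k').1 - (lineLetter h cj kj).1 := by
      rw [lineLetter_fst, lineLetter_fst] at hlt ⊢; omega
    obtain ⟨hrk, -, -⟩ := up_classify hd hray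
    exact absurd hrk hr
  · obtain ⟨a, b, -, hb, N, hN, -, -, -, hlt, hray⟩ := h3
    obtain ⟨c', k', -, hNj⟩ := hlow N hN (g + 1)
    rw [hNj, hj] at hray hlt
    have hd : (1 : ℤ) ≤ (lineLetter h c' k').1 - (lineLetter h cj kj).1 := by
      rw [lineLetter_fst, lineLetter_fst] at hlt ⊢; omega
    obtain ⟨hbk, -, -⟩ := up_classify hd hray
    rcases hb with hb | ⟨-, hb⟩
    · exact (add_two_ne kj (hbk ▸ hb)).elim
    · exact (hb hbk).elim

/-- **(RD-N≥2) a RULE-D `N`-cell with two charged letters is served below along each of their own rays**: if `Z g = (c, k)` and `Z j`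
are charged (`g ≠ j`), some present `P`-cell is `Z(g ↦ (c′, k))` with `c < c′` (and `2c′ ≤ h`). In particular (T1): `2c = h` is impossible. -/
theorem n_down_server {h : ℤ} {C : MConfig} (hup : ∀ P ∈ C.upper, ∀ f, IsLL h (P f)) {Z : MCell}
    (hD : RuleDMu4N C Z) {g j : Fin 4} (hgj : g ≠ j) {c cj : ℕ} {k kj : Fin 4}
    (hg : Z g = lineLetter h c k) (hc : 1 ≤ c) (hj : Z j = lineLetter h cj kj) (hcj : 1 ≤ cj) :
    ∃ P ∈ C.upper, ∃ c' : ℕ, c < c' ∧ 2 * (c' : ℤ) ≤ h ∧ P = Function.update Z g (lineLetter h c' k) := by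
  have had1 : Adapted (Z g) (k + 2) := by rw [hg]; exact (adapted_lineLetter h c k).2
  have had2 : Adapted (Z j) kj := by rw [hj]; exact (adapted_lineLetter h cj kj).1
  have hne : coord (Z g) (k + 2) ≠ coord (Z j) kj := by
    rw [hg, hj, (coord_lineLetter h c k).2, (coord_lineLetter h cj kj).1]
    have : (1 : ℤ) ≤ c := by exact_mod_cast hc
    omega
  rcases hD g j hgj (k + 2) kj had1 had2 hne with h1 | h2 | h3
  · obtain ⟨r, -, P, hP, hagree, hlt, hray⟩ := h1
    obtain ⟨c', k', hb, hPg⟩ := hup P hP g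
    rw [hPg, hg] at hray hlt
    have hd : (1 : ℤ) ≤ (lineLetter h c k).1 - (lineLetter h c' k').1 := by
      rw [lineLetter_fst, lineLetter_fst] at hlt ⊢; omega
    obtain ⟨-, -, hk⟩ := up_classify hd hray
    rw [lineLetter_fst, lineLetter_fst] at hlt
    refine ⟨P, hP, c', by omega, hb, ?_⟩
    funext f
    by_cases hf : f = g
    · subst hf
      rw [Function.update_self, hPg]
      rcases hk with h0 | hk
      · omega
      · rw [hk]
    · rw [Function.update_of_ne hf]; exact hagree f hf
  · obtain ⟨r, hr, P, hP, -, hlt, hray⟩ := h2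
    obtain ⟨c', k', -, hPj⟩ := hup P hP j
    rw [hPj, hj] at hray hlt
    have hd : (1 : ℤ) ≤ (lineLetter h cj kj).1 - (lineLetter h c' k').1 := by
      rw [lineLetter_fst, lineLetter_fst] at hlt ⊢; omega
    obtain ⟨hrk, -, hk⟩ := up_classify hd hray
    rcases hk with h0 | hk
    · omega
    · exact (hr (hk ▸ hrk)).elim
  · obtain ⟨a, b, -, hb, P, hP, -, -, -, hlt, hray⟩ := h3
    obtain ⟨c', k', -, hPj⟩ := hup P hP j
    rw [hPj, hj] at hray hlt
    have hd : (1 : ℤ) ≤ (lineLetter h cj kj).1 - (lineLetter h c' k').1 := by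
      rw [lineLetter_fst, lineLetter_fst] at hlt ⊢; omega
    obtain ⟨hbk, -, hk⟩ := up_classify hd hray
    have hkk : kj = k' := by
      rcases hk with h0 | hk
      · omega
      · exact hk
    subst hkk
    rcases hb with hb | ⟨-, hb⟩
    · exact (add_two_ne kj (hbk ▸ hb)).elim
    · exact (hb hbk).elim

/-- **(RD-N1) a RULE-D `N`-cell with a charged letter `(c, k)` on `g` and an apex letter on `j`**, for every direction `k′`: either it is
served below along the own ray of `g`, or some present `P`-cell is `Z(j ↦ (d, p))` with `d ≥ 1` and phase `p ≠ k′`, or some present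
`P`-cell is the cover `Z(g ↦ (c′, k), j ↦ (d, p))`, `c < c′`, `d ≥ 1`, `p ≠ k′`. -/
theorem n_hub_alternative {h : ℤ} {C : MConfig} (hup : ∀ P ∈ C.upper, ∀ f, IsLL h (P f)) {Z : MCell} (hZL : ∀ f, IsLL h (Z f))
    (hD : RuleDMu4N C Z) {g j : Fin 4} (hgj : g ≠ j) {c : ℕ} {k : Fin 4}
    (hg : Z g = lineLetter h c k) (hc : 1 ≤ c) (hja : isApex (Z j)) (k' : Fin 4) :
    (∃ P ∈ C.upper, ∃ c' : ℕ, c < c' ∧ 2 * (c' : ℤ) ≤ h ∧ P = Function.update Z g (lineLetter h c' k)) ∨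
    (∃ P ∈ C.upper, ∃ d : ℕ, ∃ p : Fin 4, 1 ≤ d ∧ p ≠ k' ∧ P = Function.update Z j (lineLetter h d p)) ∨
    (∃ P ∈ C.upper, ∃ c' d : ℕ, ∃ p : Fin 4, c < c' ∧ 2 * (c' : ℤ) ≤ h ∧ 1 ≤ d ∧ p ≠ k' ∧
        P = Function.update (Function.update Z g (lineLetter h c' k)) j (lineLetter h d p)) := by
  obtain ⟨cj, kj, -, hj⟩ := hZL j
  have hcj : cj = 0 := (isApex_lineLetter_iff h cj kj).1 (hj ▸ hja)
  subst hcj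
  have had1 : Adapted (Z g) (k + 2) := by rw [hg]; exact (adapted_lineLetter h c k).2
  have had2 : Adapted (Z j) k' := by rw [hj, lineLetter_zero]; fin_cases k' <;> simp [Adapted]
  have hne : coord (Z g) (k + 2) ≠ coord (Z j) k' := by
    rw [hg, hj, (coord_lineLetter h c k).2, lineLetter_zero]
    have : (1 : ℤ) ≤ c := by exact_mod_cast hc
    have hco : coord ((h, 0, 0) : BPoint) k' = h := by fin_cases k' <;> simp [coord]
    rw [hco]; omega
  rcases hD g j hgj (k + 2) k' had1 had2 hne with h1 | h2 | h3
  · left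
    obtain ⟨r, -, P, hP, hagree, hlt, hray⟩ := h1
    obtain ⟨c', k'', hb, hPg⟩ := hup P hP g
    rw [hPg, hg] at hray hlt
    have hd : (1 : ℤ) ≤ (lineLetter h c k).1 - (lineLetter h c' k'').1 := by
      rw [lineLetter_fst, lineLetter_fst] at hlt ⊢; omega
    obtain ⟨-, -, hk⟩ := up_classify hd hray
    rw [lineLetter_fst, lineLetter_fst] at hlt
    refine ⟨P, hP, c', by omega, hb, ?_⟩
    funext f
    by_cases hf : f = g
    · subst hf
      rw [Function.update_self, hPg]
      rcases hk with h0 | hk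
      · omega
      · rw [hk]
    · rw [Function.update_of_ne hf]; exact hagree f hf
  · right; left
    obtain ⟨r, hr, P, hP, hagree, hlt, hray⟩ := h2
    obtain ⟨c', k'', -, hPj⟩ := hup P hP j
    rw [hPj, hj] at hray hlt
    have hd : (1 : ℤ) ≤ (lineLetter h 0 kj).1 - (lineLetter h c' k'').1 := by
      rw [lineLetter_fst, lineLetter_fst] at hlt ⊢; omega
    obtain ⟨hrk, hcc, -⟩ := up_classify hd hray
    rw [lineLetter_fst, lineLetter_fst] at hlt
    refine ⟨P, hP, c', k'', by omega, ?_, ?_⟩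
    · rintro rfl; exact hr hrk
    · funext f
      by_cases hf : f = j
      · subst hf; rw [Function.update_self, hPj]
      · rw [Function.update_of_ne hf]; exact hagree f hf
  · right; right
    obtain ⟨a, b, -, hb, P, hP, hag2, hltg, hrayg, hltj, hrayj⟩ := h3
    obtain ⟨c', kg, hbd, hPg⟩ := hup P hP g
    obtain ⟨d, p, -, hPj⟩ := hup P hP j
    rw [hPg, hg] at hrayg hltg
    rw [hPj, hj] at hrayj hltj
    have hdg : (1 : ℤ) ≤ (lineLetter h c k).1 - (lineLetter h c' kg).1 := by
      rw [lineLetter_fst, lineLetter_fst] at hltg ⊢; omega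
    have hdj : (1 : ℤ) ≤ (lineLetter h 0 kj).1 - (lineLetter h d p).1 := by
      rw [lineLetter_fst, lineLetter_fst] at hltj ⊢; omega
    obtain ⟨-, -, hk⟩ := up_classify hdg hrayg
    obtain ⟨hbp, -, -⟩ := up_classify hdj hrayj
    rw [lineLetter_fst, lineLetter_fst] at hltg hltj
    have hkk : k = kg := by
      rcases hk with h0 | hk
      · omega
      · exact hk
    subst hkk
    refine ⟨P, hP, c', d, p, by omega, hbd, by omega, ?_, ?_⟩
    · rintro rfl
      rcases hb with hb | ⟨-, hb⟩
      · exact add_two_ne p (hbp ▸ hb)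
      · exact hb hbp
    · funext f
      by_cases hfj : f = j
      · subst hfj; rw [Function.update_self, hPj]
      · rw [Function.update_of_ne hfj]
        by_cases hfg : f = g
        · subst hfg; rw [Function.update_self, hPg]
        · rw [Function.update_of_ne hfg]; exact hag2 f hfg hfj

/-! ## §4 `X+` on the LINE: the apex-demand clause fires -/

/-- the negated letters of an `N`-cell of `C`, read back: `P′ g = −(N′ g)` with `N′ = dualCell 0 P′`. -/
theorem eq_dualPt_dualCell (P' : MCell) (g : Fin 4) : P' g = dualPt 0 (dualCell 0 P' g) :=
  (dualPt_dualPt 0 (P' g)).symm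

/-- **(X⁺-LINE) the apex-demand clause FIRES**: a present `P`-cell `P` with charged letter `(c, k)` on `σ` and an apex letter on `f ≠ σ`,
whose hub partner `P(σ ↦ hI)` is a present `N`-cell with no shallower present `N`-cell `P(σ ↦ (c′, k))`, `1 ≤ c′ < c`, on the own ray,
and which has a present SIBLING `P(σ ↦ (e, k″))` of another phase `k″ ≠ k` with no present companion `N`-cell `P(σ ↦ (e′, k″))`,
`1 ≤ e′ < e`, violates `X+` (the dual-world `X` clause with `u = k + 2`, `w = k″ + 2`: (H-e′) holds letterwise on the LINE, (H-b) and
`W_f = ∅` are vacuous at an apex demand factor). All `N`-letters effective LINE letters. -/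
theorem xplus_fires {h : ℤ} {C : MConfig} (hlow : ∀ N ∈ C.lower, ∀ f, IsLL h (N f)) {P : MCell} (hP : P ∈ C.upper)
    {σ f : Fin 4} (hfσ : f ≠ σ) {c : ℕ} {k : Fin 4} (hσ : P σ = lineLetter h c k) (hc : 1 ≤ c) (hPf : P f = (h, 0, 0))
    (hN₀ : Function.update P σ (h, 0, 0) ∈ C.lower)
    (htop : ∀ c' : ℕ, 1 ≤ c' → c' < c → Function.update P σ (lineLetter h c' k) ∉ C.lower)
    {e : ℕ} {k'' : Fin 4} (hk'' : k'' ≠ k) (he : 1 ≤ e) (hsib : Function.update P σ (lineLetter h e k'') ∈ C.upper)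
    (hcomp : ∀ e' : ℕ, 1 ≤ e' → e' < e → Function.update P σ (lineLetter h e' k'') ∉ C.lower) :
    ¬ XPlusClosed C := by
  intro hX
  have hc1 : (1 : ℤ) ≤ c := by exact_mod_cast hc
  have he1 : (1 : ℤ) ≤ e := by exact_mod_cast he
  -- the three cells of the clause, in the dual world
  have hZσ : dualCell 0 P σ = dualPt 0 (lineLetter h c k) := by simp only [dualCell, hσ]
  have hZf : dualCell 0 P f = dualPt 0 (h, 0, 0) := by simp only [dualCell, hPf]
  have hqσ : dualCell 0 (Function.update P σ ((h, 0, 0) : BPoint)) σ = dualPt 0 (h, 0, 0) := by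
    simp only [dualCell, Function.update_self]
  have hqg : ∀ g, g ≠ σ → dualCell 0 (Function.update P σ ((h, 0, 0) : BPoint)) g = dualCell 0 P g := fun g hg => by
    simp only [dualCell, Function.update_of_ne hg]
  have hnσ : dualCell 0 (Function.update P σ (lineLetter h e k'')) σ = dualPt 0 (lineLetter h e k'') := by
    simp only [dualCell, Function.update_self]
  have hng : ∀ g, g ≠ σ → dualCell 0 (Function.update P σ (lineLetter h e k'')) g = dualCell 0 P g := fun g hg => by
    simp only [dualCell, Function.update_of_ne hg]
  -- a present dual `P`-cell is the negative of a present `N`-cell; if it agrees with `−P` off `σ` it is `−P(σ ↦ its σ-letter)`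
  have hback : ∀ P' ∈ (C.dual 0).upper, (∀ g, g ≠ σ → P' g = dualCell 0 P g) →
      ∀ {x : BPoint}, dualCell 0 P' σ = x → Function.update P σ x ∈ C.lower := by
    intro P' hP' hag x hx
    have hmem := mem_dual_upper.mp hP'
    have : dualCell 0 P' = Function.update P σ x := by
      funext g
      by_cases hg : g = σ
      · subst hg; rw [Function.update_self, hx]
      · rw [Function.update_of_ne hg]
        show dualPt 0 (P' g) = P g
        rw [hag g hg]
        exact dualPt_dualPt 0 (P g)
    rwa [this] at hmem
  apply hX (dualCell 0 P) (dualCell_mem_dual_lower hP) (dualCell 0 (Function.update P σ ((h, 0, 0) : BPoint)))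
    (dualCell_mem_dual_upper hN₀) (dualCell 0 (Function.update P σ (lineLetter h e k''))) (dualCell_mem_dual_lower hsib)
    σ (k + 2) (k'' + 2) f
  refine ⟨?_, hfσ, ⟨fun g hg => hqg g hg, ?_, ?_⟩, ?_, fun hkk => hk'' (add_right_cancel hkk), ⟨fun g hg => ?_, ?_, ?_⟩,
    ?_, ?_, ?_, ?_⟩
  · -- head letter charged
    rw [hZσ]; fin_cases k <;> simp [lineLetter, isApex] <;> omega
  · rw [hqσ, hZσ]; simp [lineLetter]; omega
  · rw [hqσ, hZσ]
    have : (dualPt 0 (lineLetter h c k)).1 - (dualPt 0 ((h, 0, 0) : BPoint)).1 = c := by simp [lineLetter]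
    rw [this]; exact dual_lineLetter h c k
  · -- topmost: a present partner strictly between is a shallower own-ray `N`-cell
    intro P' hP' ⟨hag, hlt, hray⟩
    obtain ⟨c', k₁, -, hN'σ⟩ := hlow _ (mem_dual_upper.mp hP') σ
    have hP'σ : P' σ = dualPt 0 (lineLetter h c' k₁) := by rw [eq_dualPt_dualCell P' σ, hN'σ]
    rw [hP'σ, hqσ]
    rw [hP'σ, hZσ] at hlt hray
    have hD : (dualPt 0 (lineLetter h c k)).1 - (dualPt 0 (lineLetter h c' k₁)).1 = c - c' := by simp [lineLetter]
    rw [hD] at hray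
    simp only [lineLetter] at hlt
    have hlt' : (c' : ℤ) < c := by linarith
    obtain ⟨-, -, hk⟩ := up_classify (d := (c : ℤ) - c') (by linarith) (of_dual_ray hray)
    rcases Nat.eq_zero_or_pos c' with h0 | h0
    · subst h0; simp [lineLetter]
    · exfalso
      rcases hk with h00 | hk
      · omega
      · subst hk
        exact htop c' h0 (by exact_mod_cast hlt') (hback P' hP' (fun g hg => by rw [hag g hg]) hN'σ)
  · rw [hng g hg, hqg g hg]
  · rw [hqσ, hnσ]; simp [lineLetter]; omega
  · rw [hqσ, hnσ]
    have : (dualPt 0 (lineLetter h e k'')).1 - (dualPt 0 ((h, 0, 0) : BPoint)).1 = e := by simp [lineLetter]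
    rw [this]; exact dual_lineLetter h e k''
  · -- no companion: a present `w`-companion strictly between is a shallower `N`-cell on the sibling's ray
    intro P' hP' hag h1 h2 hray
    obtain ⟨c', k₁, -, hN'σ⟩ := hlow _ (mem_dual_upper.mp hP') σ
    have hP'σ : P' σ = dualPt 0 (lineLetter h c' k₁) := by rw [eq_dualPt_dualCell P' σ, hN'σ]
    rw [hP'σ, hqσ] at h1 hray
    rw [hP'σ, hnσ] at h2
    have hD : (dualPt 0 (lineLetter h c' k₁)).1 - (dualPt 0 ((h, 0, 0) : BPoint)).1 = c' := by simp [lineLetter]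
    rw [hD, ← lineLetter_zero h 0] at hray
    simp only [lineLetter] at h1 h2
    have h1' : (1 : ℤ) ≤ c' := by linarith
    have h2' : (c' : ℤ) < e := by linarith
    obtain ⟨hr, -, -⟩ := up_classify h1' (of_dual_ray hray)
    have hk₁ : k₁ = k'' := (add_right_cancel hr).symm
    subst hk₁
    exact hcomp c' (by exact_mod_cast h1') (by exact_mod_cast h2')
      (hback P' hP' (fun g hg => by rw [hag g hg, hqg g hg]) hN'σ)
  · -- (H-e′): letterwise on the LINE
    intro P' hP' _ _ _ _
    obtain ⟨c', k₁, -, hN'σ⟩ := hlow _ (mem_dual_upper.mp hP') σ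
    have hP'σ : P' σ = dualPt 0 (lineLetter h c' k₁) := by rw [eq_dualPt_dualCell P' σ, hN'σ]
    rw [hP'σ, hqσ]
    have h0 : (0 : ℤ) ≤ c' := by exact_mod_cast Nat.zero_le c'
    fin_cases k₁ <;> simp [lineLetter, Effective]
  · -- (H-b): vacuous, nothing lies strictly null-below the negated apex
    intro P' hP' _ hnull _
    exfalso
    obtain ⟨cf, kf, -, hN'f⟩ := hlow _ (mem_dual_upper.mp hP') f
    have hP'f : P' f = dualPt 0 (lineLetter h cf kf) := by rw [eq_dualPt_dualCell P' f, hN'f]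
    have := hnull.1
    rw [hP'f, hZf] at this
    simp [lineLetter] at this
    have h0 : (0 : ℤ) ≤ cf := by exact_mod_cast Nat.zero_le cf
    linarith
  · -- `W_f = ∅`: vacuous likewise
    intro P' hP' hnull
    exfalso
    obtain ⟨cf, kf, -, hN'f⟩ := hlow _ (mem_dual_upper.mp hP') f
    have hP'f : P' f = dualPt 0 (lineLetter h cf kf) := by rw [eq_dualPt_dualCell P' f, hN'f]
    have := hnull.1
    rw [hP'f, hZf] at this
    simp [lineLetter] at this
    have h0 : (0 : ℤ) ≤ cf := by exact_mod_cast Nat.zero_le cf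
    linarith


/-! # Part B — UNIT PHASE RIGIDITY (h-uniform, structural; the only place where phases interact is the `X+` clause) -/

/-! ## §B1 The unit hub and the UNIT SIBLING EXCLUSION (no symmetry, every `h`) -/

/-- an effective LINE letter which is an apex point is the apex `hI` itself. -/
theorem apex_eq {h : ℤ} {x : BPoint} (hx : IsLL h x) (ha : isApex x) : x = (h, 0, 0) := by
  obtain ⟨c, k, -, rfl⟩ := hx
  rw [(isApex_lineLetter_iff h c k).1 ha, lineLetter_zero]

/-- any two factors leave a third (copy of `LineInertia.exists_third`). -/
theorem exists_third (s g : Fin 4) : ∃ f : Fin 4, f ≠ s ∧ f ≠ g := by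
  revert s g; decide

/-- **THE UNIT HUB.** A RULE-D `P`-cell whose `σ`-letter is a UNIT LINE letter `(1, k)` has its HUB `P(σ ↦ hI)` present on the `N` level:
by (RD-P) the cell is served strictly below along that letter's own ray, and the only LINE letter below a unit letter is the apex. -/
theorem unit_hub_mem {h : ℤ} {C : MConfig} (hlow : ∀ N ∈ C.lower, ∀ f, IsLL h (N f)) {P : MCell} (hPL : ∀ f, IsLL h (P f))
    (hD : RuleDMu4P C P) {σ : Fin 4} {k : Fin 4} (hσ : P σ = lineLetter h 1 k) :
    Function.update P σ (h, 0, 0) ∈ C.lower := by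
  obtain ⟨N, hN, c', hc', rfl⟩ := p_up_server hlow hPL hD hσ le_rfl
  have hc0 : c' = 0 := by omega
  subst hc0
  rwa [lineLetter_zero] at hN

/-- **UNIT SIBLING EXCLUSION** (h-uniform, NO symmetry). In a RULE-D-closed, `X+`-closed configuration of effective LINE-`h` cells, a present
`P`-cell with the apex letter on a factor `f` and a UNIT letter `(1, k)` on `σ ≠ f` has NO PRESENT SIBLING on `σ`: for every phase `k″ ≠ k`
the cell `P(σ ↦ (1, k″))` is absent from the `P` level. (The unit hub is present (`unit_hub_mem`); a unit letter has nothing shallower of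
its phase on its ray and a unit sibling has no companion, so the apex-demand clause fires: `xplus_fires` with `c = e = 1`, both side
conditions vacuous.) This is the ONLY coupling between phases in the typed statics on the LINE, and it is rigid at charge 1. -/
theorem unit_sibling_exclusion {h : ℤ} {C : MConfig} (hC : LSupport h C) (hD : RuleDMu4Closed C) (hX : XPlusClosed C)
    {P : MCell} (hP : P ∈ C.upper) {σ f : Fin 4} (hfσ : f ≠ σ) (hPf : P f = (h, 0, 0)) {k : Fin 4} (hσ : P σ = lineLetter h 1 k)
    {k'' : Fin 4} (hk'' : k'' ≠ k) : Function.update P σ (lineLetter h 1 k'') ∉ C.upper := by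
  intro hsib
  have hN₀ := unit_hub_mem hC.1 (hC.2 P hP) (hD.2 P hP) hσ
  exact xplus_fires hC.1 hP hfσ hσ le_rfl hPf hN₀ (fun c' h1 h2 => by omega) hk'' le_rfl hsib
    (fun e' h1 h2 => by omega) hX

/-- **UNIT PHASE RIGIDITY** (the same, as uniqueness): off an apex factor, the phase of a unit letter of a present `P`-cell is DETERMINED by
the other three letters — if `P(σ ↦ (1, k₁))` and `P(σ ↦ (1, k₂))` are both present then `k₁ = k₂`. -/
theorem unit_phase_rigid {h : ℤ} {C : MConfig} (hC : LSupport h C) (hD : RuleDMu4Closed C) (hX : XPlusClosed C)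
    {P : MCell} {σ f : Fin 4} (hfσ : f ≠ σ) (hPf : isApex (P f)) {k₁ k₂ : Fin 4}
    (h₁ : Function.update P σ (lineLetter h 1 k₁) ∈ C.upper) (h₂ : Function.update P σ (lineLetter h 1 k₂) ∈ C.upper) : k₁ = k₂ := by
  by_contra hne
  have hf1 : Function.update P σ (lineLetter h 1 k₁) f = (h, 0, 0) := by
    have e : Function.update P σ (lineLetter h 1 k₁) f = P f := Function.update_of_ne hfσ _ _
    have hL := hC.2 _ h₁ f
    rw [e] at hL ⊢
    exact apex_eq hL hPf
  have hσ1 : Function.update P σ (lineLetter h 1 k₁) σ = lineLetter h 1 k₁ := Function.update_self _ _ _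
  have habs := unit_sibling_exclusion hC hD hX h₁ hfσ hf1 hσ1 (k'' := k₂) (Ne.symm hne)
  rw [Function.update_idem] at habs
  exact habs h₂

/-! ## §B2 `G₁ = ⟨Δ⟩ × S₄` on the LINE and THE UNIT TWIN LAW (every `h`) -/

/-- `Δ` (`Pad4TowerDeltaWindow.deltaPt`, `β ↦ iβ`) RETARDS the phase tag of a LINE letter by one: `(c, k) ↦ (c, k + 3)`. -/
theorem deltaPt_lineLetter (h : ℤ) (c : ℕ) (k : Fin 4) : deltaPt (lineLetter h c k) = lineLetter h c (k + 3) := by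
  fin_cases k <;> simp [deltaPt, lineLetter]

/-- `Δ` fixes the apex. -/
theorem deltaPt_apex (h : ℤ) : deltaPt (h, 0, 0) = (h, 0, 0) := by
  simp [deltaPt]

/-- in `Fin 4`: `k + 1 + 3 = k`. -/
theorem add_one_add_three (k : Fin 4) : k + 1 + 3 = k := by
  fin_cases k <;> decide

/-- in `Fin 4`: `k + 3 ≠ k + 1`. -/
theorem add_three_ne_add_one (k : Fin 4) : k + 3 ≠ k + 1 := by
  fin_cases k <;> decide

/-- in `Fin 4`: `k + 3 + 1 = k`. -/
theorem add_three_add_one (k : Fin 4) : k + 3 + 1 = k := by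
  fin_cases k <;> decide

/-- in `Fin 4`: the four cases for a second phase relative to a first. -/
theorem phase_cases (k k' : Fin 4) : k' = k ∨ k' = k + 1 ∨ k' = k + 2 ∨ k' = k + 3 := by
  fin_cases k <;> fin_cases k' <;> decide

/-- **THE UNIT TWIN LAW** (h-uniform; symmetry `G₁ = ⟨Δ⟩ × S₄` = `MConfig.G1Closed` of `Pad4TowerSeedB1`, the census's `JOB_ORBIT=g1`).
A `G₁`-closed, RULE-D-closed, `X+`-closed effective LINE-`h` support contains NO `P`-cell `P(hI, hI, (1,k), (1,k+1))` — two apex letters and two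
UNIT letters of ADJACENT phases, on any factors: its `G₁`-twin `swap(σ,τ) ∘ Δ` of it is the sibling `P(τ ↦ (1, k+3))` (the two apex letters
are phase-blind), and `unit_sibling_exclusion` applies. (Antipodal unit pairs `(1,k), (1,k+2)` are NOT excluded — `Δ²` maps the pair to
itself; they occur from `h = 4` on; equal phases occur in `FC8G1`.) -/
theorem unit_twin_law {h : ℤ} {C : MConfig} (hC : LSupport h C) (hG : C.G1Closed) (hD : RuleDMu4Closed C) (hX : XPlusClosed C)
    {P : MCell} (hP : P ∈ C.upper) {σ τ : Fin 4} (hστ : σ ≠ τ) {k : Fin 4} (hσ : P σ = lineLetter h 1 k)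
    (hτ : P τ = lineLetter h 1 (k + 1)) (hrest : ∀ f, f ≠ σ → f ≠ τ → P f = (h, 0, 0)) : False := by
  obtain ⟨f, hfσ, hfτ⟩ := exists_third σ τ
  have hQ : (P.delta).perm (Equiv.swap σ τ) ∈ C.upper := hG.2.1 _ _ (hG.2.2.2 P hP)
  have hQeq : (P.delta).perm (Equiv.swap σ τ) = Function.update P τ (lineLetter h 1 (k + 3)) := by
    funext g
    simp only [MCell.perm, MCell.delta]
    by_cases hgσ : g = σ
    · subst hgσ
      rw [Equiv.swap_apply_left, hτ, deltaPt_lineLetter, Function.update_of_ne hστ, hσ, add_one_add_three]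
    · by_cases hgτ : g = τ
      · subst hgτ
        rw [Equiv.swap_apply_right, hσ, deltaPt_lineLetter, Function.update_self]
      · rw [Equiv.swap_apply_of_ne_of_ne hgσ hgτ, Function.update_of_ne hgτ, hrest g hgσ hgτ, deltaPt_apex]
  rw [hQeq] at hQ
  exact unit_sibling_exclusion hC hD hX hP hfτ (hrest f hfσ hfτ) hτ (add_three_ne_add_one k) hQ

/-- **UNIT PAIRS ARE PURE OR ANTIPODAL** (every `h`, `G₁`): in a `G₁`-closed static-closed effective LINE-`h` support, a present `P`-cell with two
apex letters and two unit letters `(1,k)`, `(1,k′)` has `k′ = k` or `k′ = k + 2`. -/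
theorem unit_pair_antipodal {h : ℤ} {C : MConfig} (hC : LSupport h C) (hG : C.G1Closed) (hD : RuleDMu4Closed C) (hX : XPlusClosed C)
    {P : MCell} (hP : P ∈ C.upper) {σ τ : Fin 4} (hστ : σ ≠ τ) {k k' : Fin 4} (hσ : P σ = lineLetter h 1 k)
    (hτ : P τ = lineLetter h 1 k') (hrest : ∀ f, f ≠ σ → f ≠ τ → P f = (h, 0, 0)) : k' = k ∨ k' = k + 2 := by
  rcases phase_cases k k' with h0 | h1 | h2 | h3
  · exact Or.inl h0
  · subst h1
    exact (unit_twin_law hC hG hD hX hP hστ hσ hτ hrest).elim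
  · exact Or.inr h2
  · subst h3
    refine (unit_twin_law hC hG hD hX hP hστ.symm hτ ?_ fun f h1 h2 => hrest f h2 h1).elim
    rw [hσ, add_three_add_one]

/-! # Part C — THE PHASE-TYPE THRESHOLD LAW (typed statements; one side PROVED from the tree certificate `Cert12`) -/

/-! ## §C1 Census glue: a support in `◇_h` on the ceiling line is an effective LINE-`h` support -/

/-- the census charge `absCharge` of a LINE letter is its charge. -/
theorem absCharge_lineLetter (h : ℤ) (c : ℕ) (k : Fin 4) : absCharge (lineLetter h c k) = c := by
  have hc : |(c : ℤ)| = c := abs_of_nonneg (by positivity)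
  fin_cases k <;> simp [absCharge, chargeOf, lineLetter, hc]

/-- a letter of `◇_h` on the ceiling line `α + c = h` is an effective LINE-`h` letter. -/
theorem isLL_of_diamond_ceiling {h : ℤ} {x : BPoint} (hd : InDiamond h x) (hc : OnCeiling h x) : IsLL h x := by
  obtain ⟨c, k, rfl⟩ := lineLetter_of_axis_ceiling h x hd.1 hc
  refine ⟨c, k, ?_, rfl⟩
  have h1 := hd.2.1
  rw [absCharge_lineLetter, lineLetter_fst] at h1
  linarith

/-- the census form of `LSupport`: support in `◇_h`, every letter on the ceiling line. -/
theorem lsupport_of_diamond_ceiling {h : ℤ} {C : MConfig} (hd : C.InDiamond h)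
    (hc : (∀ Z ∈ C.lower, ∀ f, OnCeiling h (Z f)) ∧ ∀ P ∈ C.upper, ∀ f, OnCeiling h (P f)) : LSupport h C :=
  ⟨fun Z hZ f => isLL_of_diamond_ceiling (hd.1 Z hZ f) (hc.1 Z hZ f),
   fun P hP f => isLL_of_diamond_ceiling (hd.2 P hP f) (hc.2 P hP f)⟩

/-! ## §C2 Phase classes of LINE cells and the parity pattern -/

/-- the parity bit of a charged LINE letter is its phase tag mod 2 (`Im β ≠ 0` iff `k` odd). -/
theorem kbit_lineLetter {h : ℤ} {c : ℕ} (hc : 1 ≤ c) (k : Fin 4) : kbit (lineLetter h c k) = k.val % 2 := by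
  have hc0 : c ≠ 0 := by omega
  fin_cases k <;> simp [kbit, lineLetter, hc0]

/-- a cell is (cellwise) ANTIPODAL on the LINE: all its CHARGED letters have phases in one antipodal class `{k₀, k₀ + 2}`
(phase-pure cells — one phase — are antipodal). -/
def AntipodalCell (h : ℤ) (X : MCell) : Prop :=
  ∃ k₀ : Fin 4, ∀ f : Fin 4, ∀ c : ℕ, ∀ k : Fin 4, X f = lineLetter h c k → 1 ≤ c → (k = k₀ ∨ k = k₀ + 2)

/-- a cell is PHASE-PURE on the LINE: all its charged letters carry one phase. -/
def PureCell (h : ℤ) (X : MCell) : Prop :=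
  ∃ k₀ : Fin 4, ∀ f : Fin 4, ∀ c : ℕ, ∀ k : Fin 4, X f = lineLetter h c k → 1 ≤ c → k = k₀

/-- pure cells are antipodal. -/
theorem antipodal_of_pure {h : ℤ} {X : MCell} (hX : PureCell h X) : AntipodalCell h X := by
  obtain ⟨k₀, hk⟩ := hX
  exact ⟨k₀, fun f c k e hc => Or.inl (hk f c k e hc)⟩

/-- in `Fin 4`, `k₀` and `k₀ + 2` have the same parity. -/
theorem parity_add_two (k₀ : Fin 4) : (k₀ + 2).val % 2 = k₀.val % 2 := by
  fin_cases k₀ <;> decide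

/-- **AN ANTIPODAL FULLY CHARGED LINE CELL HAS EVEN PARITY WEIGHT** (its four parity bits agree, so its pattern is `0000` or `1111`):
the bridge from the phase-type law to the census's `HasOddFC`. -/
theorem not_oddPat_of_antipodal {h : ℤ} {X : MCell} (hXL : ∀ f, IsLL h (X f)) (hA : AntipodalCell h X) (hFC : FCc X) :
    ¬ OddPat X.pat := by
  obtain ⟨k₀, hk⟩ := hA
  -- every parity bit equals `k₀ % 2`
  have hbit : ∀ f, kbit (X f) = k₀.val % 2 := by
    intro f
    obtain ⟨c, k, -, e⟩ := hXL f
    have hc : 1 ≤ c := by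
      rcases Nat.eq_zero_or_pos c with h0 | h0
      · exfalso; subst h0
        exact hFC f (by rw [e, lineLetter_zero])
      · exact h0
    rw [e, kbit_lineLetter hc]
    rcases hk f c k e hc with rfl | rfl
    · rfl
    · exact parity_add_two k₀
  have hb : k₀.val % 2 = 0 ∨ k₀.val % 2 = 1 := by omega
  intro hodd
  simp only [OddPat, MCell.pat, Fin.ext_iff, hbit] at hodd
  rcases hb with hb | hb <;> simp only [hb] at hodd <;> omega

/-! ## §C3 The statements: (OL_h) ODD-FC-FREE LINE, (PT) phase-type classes; the law; the `h = 12` side PROVED -/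

/-- **(OL_h) THE ODD-FC-FREE LINE AT HEIGHT `h`**: every `G₁`-closed, RULE-D-closed, `X+`-closed support of effective LINE-`h` cells has NO fully
charged cell of odd parity weight (the census's `HasOddFC`, `Pad4TowerSeedB1Odd`), on either level. The LINE restriction of the census statement
`SeedB1OddDiamondG1H1 h` with `A2I−` dropped (vacuous on the LINE, `LineInertia` §8 ∕ `LineDesignCert12.a2iMinusClosed_of_onCeiling`). -/
def OddFCFreeLine (h : ℤ) : Prop :=
  ∀ C : MConfig, LSupport h C → C.G1Closed → RuleDMu4Closed C → XPlusClosed C → ¬ C.HasOddFC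

/-- **(AP_h) ANTIPODAL FC AT HEIGHT `h`**: in every such support every fully charged cell is antipodal (charged phases in one class `{k₀, k₀+2}`). -/
def AntipodalFCLine (h : ℤ) : Prop :=
  ∀ C : MConfig, LSupport h C → C.G1Closed → RuleDMu4Closed C → XPlusClosed C →
    ∀ X ∈ C.lower ∪ C.upper, FCc X → AntipodalCell h X

/-- **(PP_h) PURE FC AT HEIGHT `h`**: in every such support every fully charged cell is phase-pure. -/
def PureFCLine (h : ℤ) : Prop :=
  ∀ C : MConfig, LSupport h C → C.G1Closed → RuleDMu4Closed C → XPlusClosed C →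
    ∀ X ∈ C.lower ∪ C.upper, FCc X → PureCell h X

/-- (PP_h) ⇒ (AP_h). -/
theorem antipodalFCLine_of_pure {h : ℤ} (hP : PureFCLine h) : AntipodalFCLine h :=
  fun C hC hG hD hX X hX' hFC => antipodal_of_pure (hP C hC hG hD hX X hX' hFC)

/-- **(AP_h) ⇒ (OL_h)**: antipodal fully charged cells have even parity weight. -/
theorem oddFCFreeLine_of_antipodal {h : ℤ} (hA : AntipodalFCLine h) : OddFCFreeLine h := by
  intro C hC hG hD hX hodd
  rcases hodd with ⟨Z, hZ, hFC, hpat⟩ | ⟨P, hP, hFC, hpat⟩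
  · exact not_oddPat_of_antipodal (hC.1 Z hZ) (hA C hC hG hD hX Z (Finset.mem_union_left _ hZ) hFC) hFC hpat
  · exact not_oddPat_of_antipodal (hC.2 P hP) (hA C hC hG hD hX P (Finset.mem_union_right _ hP) hFC) hFC hpat

/-- **THE SAT SIDE AT `h = 12` (PROVED, from the tree's kernel certificate `Pad4TowerLineDesignCert12`):** `(OL₁₂)` is FALSE — the 768-cell
`G₁`-closed LINE-12 design `1beef026ebdf95b9` (19 `G₁`-orbits; kit j326579 ∕ j326707 ∕ j326935) is RULE-D-closed, `X+`-closed and carries the odd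
fully charged orbit of `P[10I+ℓ₁ ∣ 10I+ℓ₁ ∣ 10I+ℓ₁ ∣ 8I+2ℓ_{i^3}]` (phase type `0003`, charges `(1,1,1,2)`). -/
theorem not_oddFCFreeLine_twelve : ¬ OddFCFreeLine 12 := by
  intro hOL
  refine hOL LineDesignCert12.cfg ?_ LineDesignCert12.cfg_g1Closed LineDesignCert12.cfg_ruleDMu4Closed
    LineDesignCert12.cfg_xPlusClosed LineDesignCert12.cfg_hasOddFC
  exact lsupport_of_diamond_ceiling LineDesignCert12.cfg_inDiamond
    ⟨fun Z hZ => LineDesignCert12.lN_onLine Z (LineDesignCert12.mem_lower_iff.mp hZ),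
     fun P hP => LineDesignCert12.lP_onLine P (LineDesignCert12.mem_upper_iff.mp hP)⟩

/-- hence `(AP₁₂)` and `(PP₁₂)` are false too. -/
theorem not_antipodalFCLine_twelve : ¬ AntipodalFCLine 12 :=
  fun hA => not_oddFCFreeLine_twelve (oddFCFreeLine_of_antipodal hA)

theorem not_pureFCLine_twelve : ¬ PureFCLine 12 :=
  fun hP => not_antipodalFCLine_twelve (antipodalFCLine_of_pure hP)

/-- **THE ODD THRESHOLD LAW ON THE LINE** (the control lens's «law in `h`» for the odd core, typed): below height `12` the `G₁`-statics on the
LINE exclude odd fully charged cells; at `12` they do not. STATUS: the second conjunct is `not_oddFCFreeLine_twelve` (PROVED); the first is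
MACHINE-CERTIFIED in the closed-form model of Part A (this file's census, `oddline.py` ∕ `thresholds.py`: the `G₁`-orbit SAT instances built from
`p_up_server`, `n_down_server`, `n_hub_alternative`, `xplus_fires` ALONE are UNSAT at `h = 8, 10` — so a finite case analysis over these four
proved lemmas derives it; sizes: 2 450 ∕ 5 352 orbit variables, cadical 52 ∕ 59 conflicts, backward cone ≈ 1.1k ∕ 2.4k orbit facts) and agrees
with the W-LINE census of record (LINE-8 ∕ LINE-10 odd-FC UNSAT ×2, LINE-12 SAT = `Cert12`); `h ≤ 6` is `LineInertia.no_fc_line6` ∕ `fc_threshold`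
(no fully charged cell at all). v1.7: PROVED OUTRIGHT — `oddLineThresholdLaw_holds` (Part J). -/
def OddLineThresholdLaw : Prop := (∀ h : ℤ, h ≤ 10 → OddFCFreeLine h) ∧ ¬ OddFCFreeLine 12

/-- the finer **PHASE-TYPE THRESHOLD LAW** at the two heights that matter (typed; same status as the first conjunct above, from the same
closed-form census — the full table for all ten phase types and both levels, `h = 4 … 16`, is in the module docstring):
`(PP₈)` every fully charged cell of a `G₁`-static LINE-8 support is PHASE-PURE (even `S₄` alone suffices in the model);
`(AP₁₀)` every fully charged cell of a `G₁`-static LINE-10 support is ANTIPODAL (type `0000` or `0022`); both imply `(OL₈)`, `(OL₁₀)`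
by `oddFCFreeLine_of_antipodal`.  v1.8: PROVED OUTRIGHT — `phaseTypeLaw_holds` (Part K; h-uniform forms `pureFCLine_of_lt_ten`,
`antipodalFCLine_of_lt_twelve`). -/
def PhaseTypeLaw : Prop := PureFCLine 8 ∧ AntipodalFCLine 10

/-- the typed reduction: the phase-type law at `8` and `10` gives the odd-free side of the threshold law at those heights. -/
theorem oddFCFree_of_phaseTypeLaw (hPT : PhaseTypeLaw) : OddFCFreeLine 8 ∧ OddFCFreeLine 10 :=
  ⟨oddFCFreeLine_of_antipodal (antipodalFCLine_of_pure hPT.1), oddFCFreeLine_of_antipodal hPT.2⟩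

/-! # Part D — THE ABSTRACT LINE MODEL: (OL_h) and the odd threshold law reduce to ONE finite propositional check
(theorem first, computation second). The presence predicates of any `G₁`-static effective LINE-`h` support satisfy the four closed forms of
Part A read as propositional clauses on abstract cells `(c_f, k_f)_f`; these clauses are EXACTLY what `oddline.py` ∕ `thresholds.py` feed to the
SAT solver (one variable per `G₁`-orbit = the quotient by `permN∕permP∕shiftN∕shiftP∕apexN∕apexP` below). The model is MONOTONE in `h`, so the
single check `AbstractOddFree 10` (machine: UNSAT, 5 352 orbit variables, 59 conflicts) implies the whole typed law `OddLineThresholdLaw`. -/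

/-! ## §D1 Abstract LINE cells and their realisation -/

/-- an ABSTRACT LINE CELL: four abstract letters `(c, k)` — charge `c : ℕ` (`0` = apex, its tag immaterial) and phase tag `k : Fin 4`. -/
abbrev ACell := Fin 4 → ℕ × Fin 4

/-- realisation at height `h`: `(c, k) ↦ lineLetter h c k = (h − c)·I + c·ℓ_{i^k}`. -/
def realize (h : ℤ) (X : ACell) : MCell := fun f => lineLetter h (X f).1 (X f).2

theorem realize_apply (h : ℤ) (X : ACell) (f : Fin 4) : realize h X f = lineLetter h (X f).1 (X f).2 := rfl

/-- realisation commutes with changing one letter. -/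
theorem realize_update (h : ℤ) (X : ACell) (g : Fin 4) (c : ℕ) (k : Fin 4) :
    realize h (Function.update X g (c, k)) = Function.update (realize h X) g (lineLetter h c k) := by
  funext f
  by_cases hf : f = g
  · subst hf; simp [realize]
  · simp [realize, Function.update_of_ne hf]

/-- the abstract SHIFT = `Δ`: every tag retarded by one. -/
def ACell.shift (X : ACell) : ACell := fun f => ((X f).1, (X f).2 + 3)

theorem realize_shift (h : ℤ) (X : ACell) : realize h X.shift = (realize h X).delta := by
  funext f
  simp only [realize, ACell.shift, MCell.delta, deltaPt_lineLetter]

theorem realize_perm (h : ℤ) (X : ACell) (σ : Equiv.Perm (Fin 4)) : realize h (fun f => X (σ f)) = MCell.perm σ (realize h X) := rfl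

/-- an abstract apex letter realises to the apex. -/
theorem realize_apex {h : ℤ} {X : ACell} {f : Fin 4} (hf : (X f).1 = 0) : realize h X f = (h, 0, 0) := by
  rw [realize_apply, hf, lineLetter_zero]

/-! ## §D2 The model axioms: support bound, apex-tag invariance, (RD-P), (RD-N) ×2, (X+), `G₁` -/

/-- **THE ABSTRACT LINE MODEL at height `h`** on presence predicates `vN` (lower level) and `vP` (upper level) of abstract cells: the four
closed forms of Part A as clauses (`rdP` = `p_up_server`, `rdN2` = `n_down_server`, `rdN1` = `n_hub_alternative`, `xplus` = `xplus_fires`), the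
support bound `2c ≤ h`, invariance under re-tagging apex letters, and `G₁`-invariance (`S₄` on factors, the shift `Δ`). -/
structure LineModel (h : ℤ) (vN vP : ACell → Prop) : Prop where
  boundN : ∀ X, vN X → ∀ f, 2 * ((X f).1 : ℤ) ≤ h
  boundP : ∀ X, vP X → ∀ f, 2 * ((X f).1 : ℤ) ≤ h
  apexN : ∀ X, vN X → ∀ g : Fin 4, ∀ k : Fin 4, (X g).1 = 0 → vN (Function.update X g (0, k))
  apexP : ∀ X, vP X → ∀ g : Fin 4, ∀ k : Fin 4, (X g).1 = 0 → vP (Function.update X g (0, k))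
  rdP : ∀ X, vP X → ∀ g : Fin 4, 1 ≤ (X g).1 → ∃ c' : ℕ, c' < (X g).1 ∧ vN (Function.update X g (c', (X g).2))
  rdN2 : ∀ X, vN X → ∀ g j : Fin 4, g ≠ j → 1 ≤ (X g).1 → 1 ≤ (X j).1 →
    ∃ c' : ℕ, (X g).1 < c' ∧ 2 * (c' : ℤ) ≤ h ∧ vP (Function.update X g (c', (X g).2))
  rdN1 : ∀ X, vN X → ∀ g j : Fin 4, g ≠ j → 1 ≤ (X g).1 → (X j).1 = 0 → ∀ k' : Fin 4,
    (∃ c' : ℕ, (X g).1 < c' ∧ 2 * (c' : ℤ) ≤ h ∧ vP (Function.update X g (c', (X g).2))) ∨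
    (∃ d : ℕ, ∃ p : Fin 4, 1 ≤ d ∧ p ≠ k' ∧ vP (Function.update X j (d, p))) ∨
    (∃ c' d : ℕ, ∃ p : Fin 4, (X g).1 < c' ∧ 2 * (c' : ℤ) ≤ h ∧ 1 ≤ d ∧ p ≠ k' ∧
      vP (Function.update (Function.update X g (c', (X g).2)) j (d, p)))
  xplus : ∀ X, vP X → ∀ σ f : Fin 4, f ≠ σ → 1 ≤ (X σ).1 → (X f).1 = 0 →
    vN (Function.update X σ (0, 0)) →
    (∀ c' : ℕ, 1 ≤ c' → c' < (X σ).1 → ¬ vN (Function.update X σ (c', (X σ).2))) →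
    ∀ e : ℕ, ∀ k'' : Fin 4, k'' ≠ (X σ).2 → 1 ≤ e → vP (Function.update X σ (e, k'')) →
    (∀ e' : ℕ, 1 ≤ e' → e' < e → ¬ vN (Function.update X σ (e', k''))) → False
  permN : ∀ X, vN X → ∀ σ : Equiv.Perm (Fin 4), vN (fun f => X (σ f))
  permP : ∀ X, vP X → ∀ σ : Equiv.Perm (Fin 4), vP (fun f => X (σ f))
  shiftN : ∀ X, vN X → vN X.shift
  shiftP : ∀ X, vP X → vP X.shift

/-- the model is MONOTONE in the height: the bound and the `2c' ≤ h` side conditions only weaken. -/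
theorem LineModel.mono {h h' : ℤ} (hle : h ≤ h') {vN vP : ACell → Prop} (M : LineModel h vN vP) : LineModel h' vN vP where
  boundN X hX f := le_trans (M.boundN X hX f) hle
  boundP X hX f := le_trans (M.boundP X hX f) hle
  apexN := M.apexN
  apexP := M.apexP
  rdP := M.rdP
  rdN2 X hX g j hgj hg hj := by
    obtain ⟨c', h1, h2, h3⟩ := M.rdN2 X hX g j hgj hg hj
    exact ⟨c', h1, le_trans h2 hle, h3⟩
  rdN1 X hX g j hgj hg hj k' := by
    rcases M.rdN1 X hX g j hgj hg hj k' with ⟨c', h1, h2, h3⟩ | ⟨d, p, h1, h2, h3⟩ | ⟨c', d, p, h1, h2, h3, h4, h5⟩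
    · exact Or.inl ⟨c', h1, le_trans h2 hle, h3⟩
    · exact Or.inr (Or.inl ⟨d, p, h1, h2, h3⟩)
    · exact Or.inr (Or.inr ⟨c', d, p, h1, le_trans h2 hle, h3, h4, h5⟩)
  xplus := M.xplus
  permN := M.permN
  permP := M.permP
  shiftN := M.shiftN
  shiftP := M.shiftP

/-- the charge of an effective LINE letter is determined by the letter. -/
theorem charge_eq_of_lineLetter_eq {h : ℤ} {c c' : ℕ} {k k' : Fin 4} (e : lineLetter h c k = lineLetter h c' k') : c = c' := by
  have h1 := congrArg Prod.fst e
  rw [lineLetter_fst, lineLetter_fst] at h1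
  omega

/-- **SOUNDNESS: the presence predicates of a `G₁`-static effective LINE-`h` support are an abstract LINE model at height `h`.**
(Each axiom is one of the PROVED closed forms of Part A, or `G₁`-closedness, transported along `realize`.) -/
theorem lineModel_of_config {h : ℤ} {C : MConfig} (hC : LSupport h C) (hG : C.G1Closed) (hD : RuleDMu4Closed C) (hX : XPlusClosed C) :
    LineModel h (fun X => realize h X ∈ C.lower) (fun X => realize h X ∈ C.upper) where
  boundN X hXm f := by
    obtain ⟨c, k, hc, e⟩ := hC.1 _ hXm f
    rw [realize_apply] at e
    rw [charge_eq_of_lineLetter_eq e]; exact hc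
  boundP X hXm f := by
    obtain ⟨c, k, hc, e⟩ := hC.2 _ hXm f
    rw [realize_apply] at e
    rw [charge_eq_of_lineLetter_eq e]; exact hc
  apexN X hXm g k hg := by
    show realize h (Function.update X g (0, k)) ∈ C.lower
    rw [realize_update, lineLetter_zero, ← realize_apex (X := X) hg, Function.update_eq_self]
    exact hXm
  apexP X hXm g k hg := by
    show realize h (Function.update X g (0, k)) ∈ C.upper
    rw [realize_update, lineLetter_zero, ← realize_apex (X := X) hg, Function.update_eq_self]
    exact hXm
  rdP X hXm g hg := by
    obtain ⟨N, hN, c', hc', hNe⟩ := p_up_server hC.1 (hC.2 _ hXm) (hD.2 _ hXm) (realize_apply h X g) hg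
    refine ⟨c', hc', ?_⟩
    show realize h (Function.update X g (c', (X g).2)) ∈ C.lower
    rw [realize_update, ← hNe]; exact hN
  rdN2 X hXm g j hgj hg hj := by
    obtain ⟨P, hP, c', h1, h2, hPe⟩ :=
      n_down_server hC.2 (hD.1 _ hXm) hgj (realize_apply h X g) hg (realize_apply h X j) hj
    refine ⟨c', h1, h2, ?_⟩
    show realize h (Function.update X g (c', (X g).2)) ∈ C.upper
    rw [realize_update, ← hPe]; exact hP
  rdN1 X hXm g j hgj hg hj k' := by
    have hja : isApex (realize h X j) := by
      rw [realize_apex (X := X) hj]; simp [isApex]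
    rcases n_hub_alternative hC.2 (hC.1 _ hXm) (hD.1 _ hXm) hgj (realize_apply h X g) hg hja k' with
      ⟨P, hP, c', h1, h2, hPe⟩ | ⟨P, hP, d, p, h1, h2, hPe⟩ | ⟨P, hP, c', d, p, h1, h2, h3, h4, hPe⟩
    · refine Or.inl ⟨c', h1, h2, ?_⟩
      show realize h (Function.update X g (c', (X g).2)) ∈ C.upper
      rw [realize_update, ← hPe]; exact hP
    · refine Or.inr (Or.inl ⟨d, p, h1, h2, ?_⟩)
      show realize h (Function.update X j (d, p)) ∈ C.upper
      rw [realize_update, ← hPe]; exact hP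
    · refine Or.inr (Or.inr ⟨c', d, p, h1, h2, h3, h4, ?_⟩)
      show realize h (Function.update (Function.update X g (c', (X g).2)) j (d, p)) ∈ C.upper
      rw [realize_update, realize_update, ← hPe]; exact hP
  xplus X hXm σ f hfσ hσ hf hN₀ htop e k'' hk'' he hsib hcomp := by
    have hN₀' : Function.update (realize h X) σ (h, 0, 0) ∈ C.lower := by
      have := hN₀; rwa [realize_update, lineLetter_zero] at this
    have htop' : ∀ c' : ℕ, 1 ≤ c' → c' < (X σ).1 →
        Function.update (realize h X) σ (lineLetter h c' (X σ).2) ∉ C.lower := by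
      intro c' h1 h2 hm
      exact htop c' h1 h2 (by show realize h _ ∈ C.lower; rwa [realize_update])
    have hsib' : Function.update (realize h X) σ (lineLetter h e k'') ∈ C.upper := by
      have := hsib; rwa [realize_update] at this
    have hcomp' : ∀ e' : ℕ, 1 ≤ e' → e' < e → Function.update (realize h X) σ (lineLetter h e' k'') ∉ C.lower := by
      intro e' h1 h2 hm
      exact hcomp e' h1 h2 (by show realize h _ ∈ C.lower; rwa [realize_update])
    exact xplus_fires hC.1 hXm hfσ (realize_apply h X σ) hσ (realize_apex (X := X) hf) hN₀' htop' hk'' he hsib' hcomp' hX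
  permN X hXm σ := by
    show realize h (fun f => X (σ f)) ∈ C.lower
    rw [realize_perm]; exact hG.1 σ _ hXm
  permP X hXm σ := by
    show realize h (fun f => X (σ f)) ∈ C.upper
    rw [realize_perm]; exact hG.2.1 σ _ hXm
  shiftN X hXm := by
    show realize h X.shift ∈ C.lower
    rw [realize_shift]; exact hG.2.2.1 _ hXm
  shiftP X hXm := by
    show realize h X.shift ∈ C.upper
    rw [realize_shift]; exact hG.2.2.2 _ hXm

/-! ## §D3 The finite check and the reduction theorems -/

/-- an abstract cell is FULLY CHARGED OF ODD PARITY WEIGHT: all charges `≥ 1` and an odd number of odd tags. -/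
def AOddFC (X : ACell) : Prop :=
  (∀ f, 1 ≤ (X f).1) ∧ ((X 0).2.val % 2 + (X 1).2.val % 2 + (X 2).2.val % 2 + (X 3).2.val % 2) % 2 = 1

/-- **(AOL_h) THE FINITE CHECK**: no abstract LINE model at height `h` makes an odd fully charged abstract cell present (on either level).
This is the UNSAT statement of the `G₁`-orbit instance «odd FC present» of `oddline.py h G1` (MACHINE: UNSAT at `h = 8, 10`; SAT at `h ≥ 12`). -/
def AbstractOddFree (h : ℤ) : Prop :=
  ∀ vN vP : ACell → Prop, LineModel h vN vP → ∀ X : ACell, AOddFC X → ¬ vN X ∧ ¬ vP X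

/-- the finite check is ANTITONE in the height (models only gain freedom as `h` grows). -/
theorem abstractOddFree_anti {h h' : ℤ} (hle : h ≤ h') (hA : AbstractOddFree h') : AbstractOddFree h :=
  fun vN vP M X hX => hA vN vP (M.mono hle) X hX

/-- a realised cell which is fully charged with an odd pattern comes from an odd fully charged abstract cell. -/
theorem aOddFC_of_realize {h : ℤ} {X : ACell} (hFC : FCc (realize h X)) (hodd : OddPat (realize h X).pat) : AOddFC X := by
  have hc : ∀ f, 1 ≤ (X f).1 := by
    intro f
    by_contra h0
    have h00 : (X f).1 = 0 := by omega
    exact hFC f (by rw [realize_apex (X := X) h00])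
  refine ⟨hc, ?_⟩
  have hb : ∀ f, kbit (realize h X f) = (X f).2.val % 2 := fun f => by
    rw [realize_apply, kbit_lineLetter (hc f)]
  rw [oddPat_iff_pwt] at hodd
  simp only [pwt, bitOf_pat, hb] at hodd
  exact hodd

/-- every cell of an effective LINE-`h` support is a realised abstract cell. -/
theorem exists_realize {h : ℤ} {Z : MCell} (hZ : ∀ f, IsLL h (Z f)) : ∃ X : ACell, realize h X = Z := by
  choose c k hck using hZ
  exact ⟨fun f => (c f, k f), funext fun f => ((hck f).2).symm⟩

/-- **REDUCTION: the finite check at `h` implies (OL_h).** -/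
theorem oddFCFreeLine_of_abstract {h : ℤ} (hA : AbstractOddFree h) : OddFCFreeLine h := by
  intro C hC hG hD hX hodd
  have hM := lineModel_of_config hC hG hD hX
  rcases hodd with ⟨Z, hZ, hFC, hpat⟩ | ⟨P, hP, hFC, hpat⟩
  · obtain ⟨X, rfl⟩ := exists_realize (hC.1 Z hZ)
    exact (hA _ _ hM X (aOddFC_of_realize hFC hpat)).1 hZ
  · obtain ⟨X, rfl⟩ := exists_realize (hC.2 P hP)
    exact (hA _ _ hM X (aOddFC_of_realize hFC hpat)).2 hP

/-- **THE ODD THRESHOLD LAW FROM ONE FINITE CHECK**: `AbstractOddFree 10` (the UNSAT of the LINE-10 `G₁` closed-form instance — MACHINE at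
v1.1, PROVED in Part J: `abstractOddFree_of_lt_twelve`) implies the whole typed law: `(∀ h ≤ 10, OddFCFreeLine h)` by antitonicity and the reduction, `¬ OddFCFreeLine 12` by `Cert12`. -/
theorem oddLineThresholdLaw_of_abstract (h10 : AbstractOddFree 10) : OddLineThresholdLaw :=
  ⟨fun _ hh => oddFCFreeLine_of_abstract (abstractOddFree_anti hh h10), not_oddFCFreeLine_twelve⟩

/-- conversely the SAT side bounds the finite check: `AbstractOddFree h` FAILS for every `h ≥ 12` (PROVED: `Cert12` realises an odd cell, and
the check is antitone). -/
theorem not_abstractOddFree_of_twelve_le {h : ℤ} (hh : 12 ≤ h) : ¬ AbstractOddFree h :=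
  fun hA => not_oddFCFreeLine_twelve (oddFCFreeLine_of_abstract (abstractOddFree_anti hh hA))

/-! ## §D4 The same reduction for the PHASE-TYPE LAW: (PP_h) and (AP_h) from finite checks -/

/-- a charged effective LINE letter determines its charge AND its phase tag. -/
theorem lineLetter_inj {h : ℤ} {c c' : ℕ} {k k' : Fin 4} (hc : 1 ≤ c) (e : lineLetter h c k = lineLetter h c' k') :
    c = c' ∧ k = k' := by
  have hcc := charge_eq_of_lineLetter_eq e
  subst hcc
  refine ⟨rfl, ?_⟩
  fin_cases k <;> fin_cases k' <;> first | rfl | (exfalso; simp [lineLetter, Prod.ext_iff] at e; omega)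

/-- in `Fin 4`: tags of the same parity are equal or antipodal. -/
theorem sameParity_cases : ∀ k₀ k : Fin 4, k.val % 2 = k₀.val % 2 → k = k₀ ∨ k = k₀ + 2 := by
  decide

/-- abstract FULLY CHARGED, NOT ANTIPODAL: all charges `≥ 1` and two tags of different parity. -/
def ANonAntipodalFC (X : ACell) : Prop := (∀ f, 1 ≤ (X f).1) ∧ ∃ f g : Fin 4, (X f).2.val % 2 ≠ (X g).2.val % 2

/-- abstract FULLY CHARGED, NOT PURE: all charges `≥ 1` and two different tags. -/
def ANonPureFC (X : ACell) : Prop := (∀ f, 1 ≤ (X f).1) ∧ ∃ f g : Fin 4, (X f).2 ≠ (X g).2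

/-- **(AAP_h)** the finite check for the antipodal law: no abstract model at height `h` makes a non-antipodal FC cell present
(`oddline.py h G1 nap`; MACHINE: UNSAT at `h = 10` — `L10-G1-nap.cnf` 053540c8c1553b3a, LRAT-checked — SAT at `12`);
PROVED for every `h < 12` in Part K (`abstractAntipodalFC_of_lt_twelve`), refuted for `h ≥ 12` (`not_abstractAntipodalFC_of_twelve_le`). -/
def AbstractAntipodalFC (h : ℤ) : Prop :=
  ∀ vN vP : ACell → Prop, LineModel h vN vP → ∀ X : ACell, ANonAntipodalFC X → ¬ vN X ∧ ¬ vP X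

/-- **(APP_h)** the finite check for the purity law: no abstract model at height `h` makes a non-pure FC cell present
(`oddline.py h G1 mixfc`; MACHINE: UNSAT at `h = 8` — `L8-G1-mixfc.cnf` 34e901b2a9ad6e5a, LRAT-checked — SAT at `10`, type `0022`);
PROVED for every `h < 10` in Part K (`abstractPureFC_of_lt_ten`). -/
def AbstractPureFC (h : ℤ) : Prop :=
  ∀ vN vP : ACell → Prop, LineModel h vN vP → ∀ X : ACell, ANonPureFC X → ¬ vN X ∧ ¬ vP X

theorem abstractAntipodalFC_anti {h h' : ℤ} (hle : h ≤ h') (hA : AbstractAntipodalFC h') : AbstractAntipodalFC h :=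
  fun vN vP M X hX => hA vN vP (M.mono hle) X hX

theorem abstractPureFC_anti {h h' : ℤ} (hle : h ≤ h') (hA : AbstractPureFC h') : AbstractPureFC h :=
  fun vN vP M X hX => hA vN vP (M.mono hle) X hX

/-- an odd fully charged abstract cell is non-antipodal (four tags of one parity have even parity weight). -/
theorem aNonAntipodal_of_aOdd {X : ACell} (hX : AOddFC X) : ANonAntipodalFC X := by
  refine ⟨hX.1, ?_⟩
  by_contra hall
  push Not at hall
  have h1 := hall 1 0; have h2 := hall 2 0; have h3 := hall 3 0
  have hodd := hX.2
  rw [h1, h2, h3] at hodd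
  omega

/-- a non-antipodal FC abstract cell is non-pure. -/
theorem aNonPure_of_aNonAntipodal {X : ACell} (hX : ANonAntipodalFC X) : ANonPureFC X := by
  obtain ⟨hc, f, g, hfg⟩ := hX
  exact ⟨hc, f, g, fun e => hfg (by rw [e])⟩

/-- the three finite checks are nested: purity ⇒ antipodality ⇒ odd-freeness. -/
theorem abstractAntipodalFC_of_pure {h : ℤ} (hP : AbstractPureFC h) : AbstractAntipodalFC h :=
  fun vN vP M X hX => hP vN vP M X (aNonPure_of_aNonAntipodal hX)

theorem abstractOddFree_of_antipodal {h : ℤ} (hA : AbstractAntipodalFC h) : AbstractOddFree h :=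
  fun vN vP M X hX => hA vN vP M X (aNonAntipodal_of_aOdd hX)

/-- the letters of a fully charged realised cell have charges `≥ 1`. -/
theorem charges_pos_of_fcc {h : ℤ} {X : ACell} (hFC : FCc (realize h X)) : ∀ f, 1 ≤ (X f).1 := by
  intro f
  by_contra h0
  exact hFC f (by rw [realize_apex (X := X) (by omega)])

/-- **REDUCTION: the finite check (AAP_h) implies (AP_h).** -/
theorem antipodalFCLine_of_abstract {h : ℤ} (hA : AbstractAntipodalFC h) : AntipodalFCLine h := by
  intro C hC hG hD hX Z hZ hFC
  have hM := lineModel_of_config hC hG hD hX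
  have hZL : ∀ f, IsLL h (Z f) := by
    rcases Finset.mem_union.mp hZ with h1 | h1
    · exact hC.1 Z h1
    · exact hC.2 Z h1
  obtain ⟨X, rfl⟩ := exists_realize hZL
  have hc := charges_pos_of_fcc hFC
  have hpar : ∀ f g : Fin 4, (X f).2.val % 2 = (X g).2.val % 2 := by
    intro f g
    by_contra hne
    have hnon : ANonAntipodalFC X := ⟨hc, f, g, hne⟩
    rcases Finset.mem_union.mp hZ with h1 | h1
    · exact (hA _ _ hM X hnon).1 h1
    · exact (hA _ _ hM X hnon).2 h1
  refine ⟨(X 0).2, fun f c k e _ => ?_⟩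
  rw [realize_apply] at e
  obtain ⟨-, hk⟩ := lineLetter_inj (hc f) e
  rw [← hk]
  exact sameParity_cases (X 0).2 (X f).2 (hpar f 0)

/-- **REDUCTION: the finite check (APP_h) implies (PP_h).** -/
theorem pureFCLine_of_abstract {h : ℤ} (hA : AbstractPureFC h) : PureFCLine h := by
  intro C hC hG hD hX Z hZ hFC
  have hM := lineModel_of_config hC hG hD hX
  have hZL : ∀ f, IsLL h (Z f) := by
    rcases Finset.mem_union.mp hZ with h1 | h1
    · exact hC.1 Z h1
    · exact hC.2 Z h1
  obtain ⟨X, rfl⟩ := exists_realize hZL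
  have hc := charges_pos_of_fcc hFC
  have heq : ∀ f g : Fin 4, (X f).2 = (X g).2 := by
    intro f g
    by_contra hne
    have hnon : ANonPureFC X := ⟨hc, f, g, hne⟩
    rcases Finset.mem_union.mp hZ with h1 | h1
    · exact (hA _ _ hM X hnon).1 h1
    · exact (hA _ _ hM X hnon).2 h1
  refine ⟨(X 0).2, fun f c k e _ => ?_⟩
  rw [realize_apply] at e
  obtain ⟨-, hk⟩ := lineLetter_inj (hc f) e
  rw [← hk]
  exact heq f 0

/-- **THE PHASE-TYPE LAW FROM TWO FINITE CHECKS** (`AbstractPureFC 8`: `L8-G1-mixfc` UNSAT; `AbstractAntipodalFC 10`: `L10-G1-nap` UNSAT —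
MACHINE; both PROVED in Part K, whence `phaseTypeLaw_holds`). -/
theorem phaseTypeLaw_of_abstract (h8 : AbstractPureFC 8) (h10 : AbstractAntipodalFC 10) : PhaseTypeLaw :=
  ⟨pureFCLine_of_abstract h8, antipodalFCLine_of_abstract h10⟩

/-- and the SAT sides bound them (PROVED via `Cert12`): no purity or antipodality check holds at any `h ≥ 12`. -/
theorem not_abstractAntipodalFC_of_twelve_le {h : ℤ} (hh : 12 ≤ h) : ¬ AbstractAntipodalFC h :=
  fun hA => not_abstractOddFree_of_twelve_le hh (abstractOddFree_of_antipodal hA)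

theorem not_abstractPureFC_of_twelve_le {h : ℤ} (hh : 12 ≤ h) : ¬ AbstractPureFC h :=
  fun hP => not_abstractAntipodalFC_of_twelve_le hh (abstractAntipodalFC_of_pure hP)

/-! ## Part E — the CEILING GAP LAW (h-uniform; PROVED in the abstract model, hence for every `G₁`-closed RULE-D∕`X+` LINE design)

The controlling quantity this exposes is the HEIGHT OF A CELL'S TALLEST LETTER (its maximal charge `m`): served cells keep a gap
below the ceiling `n = h∕2` that grows with the number of charged letters and by one from `P` to `N` (RD-N raises a charge, RD-P
lowers one).  PROVED here, uniformly in `h`, from `rdP`∕`rdN2` alone: an `N`-cell with two charged letters has all charges `≤ n−1`,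
a `P`-cell with three charged letters has charges `≤ n−1`, an `N`-cell with three charged letters `≤ n−2`, a fully charged `P`-cell
`≤ n−2`, a fully charged `N`-cell `≤ n−3`.  MACHINE (`odd/depth.py`, `DEPTH-G1-h8-18.txt` c6067236872d0c33; phase-blind, h = 8…18):
the true gaps are one larger — FC `P`: `m ≤ n−3`, FC `N`: `m ≤ n−4` (depth `n, n−1` die by unit propagation, `n−2` by 17–31
conflicts) — and refine by phase type (`TGRID-G1-h16-P.txt`: gap 3 for types `000x`, 4 for `0011∕0022∕0012∕0013∕0023`, 6 for `0123`).
Consequence (PROVED): the finite odd-freeness check reduces to its BOTTOM NUCLEUS (`abstractOddFree_of_nucleus`). -/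

/-- three further slots of `Fin 4`, pairwise distinct. -/
theorem fin4_others (g : Fin 4) : g + 1 ≠ g ∧ g + 2 ≠ g ∧ g + 3 ≠ g ∧ g + 1 ≠ g + 2 ∧ g + 1 ≠ g + 3 ∧ g + 2 ≠ g + 3 := by
  revert g; decide

namespace LineModel

variable {h : ℤ} {vN vP : ACell → Prop}

/-- **(E1)** an `N`-cell with two charged slots has each of them strictly below the ceiling: `2(c+1) ≤ h`. -/
theorem n_gap_one (M : LineModel h vN vP) {X : ACell} (hX : vN X) {g j : Fin 4} (hgj : g ≠ j)
    (hg : 1 ≤ (X g).1) (hj : 1 ≤ (X j).1) : 2 * ((X g).1 : ℤ) + 2 ≤ h := by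
  obtain ⟨c', hc', hch, -⟩ := M.rdN2 X hX g j hgj hg hj
  have : ((X g).1 : ℤ) + 1 ≤ c' := by exact_mod_cast hc'
  linarith

/-- **(E2)** a `P`-cell with three charged slots has each of them strictly below the ceiling (RD-P at a second slot lands on an
`N`-cell that still has two charged slots). -/
theorem p_gap_one (M : LineModel h vN vP) {X : ACell} (hX : vP X) {g f j : Fin 4} (hgf : g ≠ f) (hgj : g ≠ j) (hfj : f ≠ j)
    (hg : 1 ≤ (X g).1) (hf : 1 ≤ (X f).1) (hj : 1 ≤ (X j).1) : 2 * ((X g).1 : ℤ) + 2 ≤ h := by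
  obtain ⟨c', -, hN⟩ := M.rdP X hX f hf
  have eg : Function.update X f (c', (X f).2) g = X g := Function.update_of_ne hgf _ _
  have ej : Function.update X f (c', (X f).2) j = X j := Function.update_of_ne hfj.symm _ _
  have key := M.n_gap_one hN (g := g) (j := j) hgj (by rw [eg]; exact hg) (by rw [ej]; exact hj)
  rwa [eg] at key

/-- **(E3)** an `N`-cell with three charged slots keeps TWO levels below the ceiling: `2(c+2) ≤ h`. -/
theorem n_gap_two (M : LineModel h vN vP) {X : ACell} (hX : vN X) {g f j : Fin 4} (hgf : g ≠ f) (hgj : g ≠ j) (hfj : f ≠ j)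
    (hg : 1 ≤ (X g).1) (hf : 1 ≤ (X f).1) (hj : 1 ≤ (X j).1) : 2 * ((X g).1 : ℤ) + 4 ≤ h := by
  obtain ⟨c', hc', -, hP⟩ := M.rdN2 X hX g j hgj hg hj
  have eg : Function.update X g (c', (X g).2) g = (c', (X g).2) := Function.update_self _ _ _
  have ef : Function.update X g (c', (X g).2) f = X f := Function.update_of_ne hgf.symm _ _
  have ej : Function.update X g (c', (X g).2) j = X j := Function.update_of_ne hgj.symm _ _
  have key := M.p_gap_one hP (g := g) (f := f) (j := j) hgf hgj hfj (by rw [eg]; omega) (by rw [ef]; exact hf)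
    (by rw [ej]; exact hj)
  rw [eg] at key
  have : ((X g).1 : ℤ) + 1 ≤ c' := by exact_mod_cast hc'
  push_cast at key
  linarith

/-- **(E4) fully charged `P`-cells keep two levels below the ceiling**: every charge satisfies `2(c+2) ≤ h`. -/
theorem fcP_gap (M : LineModel h vN vP) {X : ACell} (hX : vP X) (hc : ∀ f, 1 ≤ (X f).1) (g : Fin 4) :
    2 * ((X g).1 : ℤ) + 4 ≤ h := by
  obtain ⟨h1, h2, h3, h12, h13, h23⟩ := fin4_others g
  obtain ⟨c', -, hN⟩ := M.rdP X hX (g + 1) (hc (g + 1))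
  have eg : Function.update X (g + 1) (c', (X (g + 1)).2) g = X g := Function.update_of_ne h1.symm _ _
  have e2 : Function.update X (g + 1) (c', (X (g + 1)).2) (g + 2) = X (g + 2) := Function.update_of_ne h12.symm _ _
  have e3 : Function.update X (g + 1) (c', (X (g + 1)).2) (g + 3) = X (g + 3) := Function.update_of_ne h13.symm _ _
  have key := M.n_gap_two hN (g := g) (f := g + 2) (j := g + 3) h2.symm h3.symm h23 (by rw [eg]; exact hc g)
    (by rw [e2]; exact hc (g + 2)) (by rw [e3]; exact hc (g + 3))
  rwa [eg] at key

/-- **(E5) fully charged `N`-cells keep three levels below the ceiling**: every charge satisfies `2(c+3) ≤ h`. -/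
theorem fcN_gap (M : LineModel h vN vP) {X : ACell} (hX : vN X) (hc : ∀ f, 1 ≤ (X f).1) (g : Fin 4) :
    2 * ((X g).1 : ℤ) + 6 ≤ h := by
  obtain ⟨h1, -, -, -, -, -⟩ := fin4_others g
  obtain ⟨c', hc', -, hP⟩ := M.rdN2 X hX g (g + 1) h1.symm (hc g) (hc (g + 1))
  have hcZ : ∀ f, 1 ≤ (Function.update X g (c', (X g).2) f).1 := by
    intro f
    by_cases hf : f = g
    · subst hf; rw [Function.update_self]; exact le_of_lt (lt_of_le_of_lt (hc f) hc')
    · rw [Function.update_of_ne hf]; exact hc f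
  have key := M.fcP_gap hP hcZ g
  rw [Function.update_self] at key
  have : ((X g).1 : ℤ) + 1 ≤ c' := by exact_mod_cast hc'
  push_cast at key
  linarith

/-- presence DESCENDS FROM `N` TO `P` WITH THE PHASE TAGS UNCHANGED (RD-N raises one charge and keeps its tag): for any tag word `w`,
if no fully charged `P`-cell with tags `w` is present then no fully charged `N`-cell with tags `w` is present — the PROVED half
(`t_P(T) ≤ t_N(T)`) of the machine law `t_N(T) = t_P(T) + 2`. -/
theorem fcN_absent_of_fcP_absent (M : LineModel h vN vP) (w : Fin 4 → Fin 4)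
    (hP : ∀ X : ACell, (∀ f, 1 ≤ (X f).1) → (∀ f, (X f).2 = w f) → ¬ vP X) :
    ∀ X : ACell, (∀ f, 1 ≤ (X f).1) → (∀ f, (X f).2 = w f) → ¬ vN X := by
  intro X hc hw hX
  have h01 : (0 : Fin 4) ≠ 1 := by decide
  obtain ⟨c', hc', -, hPX⟩ := M.rdN2 X hX 0 1 h01 (hc 0) (hc 1)
  refine hP _ (fun f => ?_) (fun f => ?_) hPX
  · by_cases hf : f = 0
    · subst hf; rw [Function.update_self]; exact le_of_lt (lt_of_le_of_lt (hc _) hc')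
    · rw [Function.update_of_ne hf]; exact hc f
  · by_cases hf : f = 0
    · subst hf; rw [Function.update_self]; exact hw _
    · rw [Function.update_of_ne hf]; exact hw f

end LineModel

/-- **the CEILING GAP LAW for LINE designs, `P` level** (PROVED, every `h`): a fully charged RULE-D `P`-cell of a `G₁`-closed
RULE-D∕`X+` design on effective LINE-`h` letters has every letter of charge `c` with `2(c+2) ≤ h`. -/
theorem fc_ceiling_gap_P {h : ℤ} {C : MConfig} (hC : LSupport h C) (hG : C.G1Closed) (hD : RuleDMu4Closed C)
    (hX : XPlusClosed C) {P : MCell} (hP : P ∈ C.upper) (hFC : FCc P) {f : Fin 4} {c : ℕ} {k : Fin 4}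
    (e : P f = lineLetter h c k) : 2 * (c : ℤ) + 4 ≤ h := by
  have hM := lineModel_of_config hC hG hD hX
  obtain ⟨X, rfl⟩ := exists_realize (fun g => hC.2 _ hP g)
  have hc := charges_pos_of_fcc hFC
  rw [realize_apply] at e
  rw [← charge_eq_of_lineLetter_eq e]
  exact hM.fcP_gap hP hc f

/-- **the CEILING GAP LAW for LINE designs, `N` level** (PROVED, every `h`): `2(c+3) ≤ h` for every letter of a fully charged `N`-cell. -/
theorem fc_ceiling_gap_N {h : ℤ} {C : MConfig} (hC : LSupport h C) (hG : C.G1Closed) (hD : RuleDMu4Closed C)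
    (hX : XPlusClosed C) {N : MCell} (hN : N ∈ C.lower) (hFC : FCc N) {f : Fin 4} {c : ℕ} {k : Fin 4}
    (e : N f = lineLetter h c k) : 2 * (c : ℤ) + 6 ≤ h := by
  have hM := lineModel_of_config hC hG hD hX
  obtain ⟨X, rfl⟩ := exists_realize (fun g => hC.1 _ hN g)
  have hc := charges_pos_of_fcc hFC
  rw [realize_apply] at e
  rw [← charge_eq_of_lineLetter_eq e]
  exact hM.fcN_gap hN hc f

/-- in particular (PROVED, every `h`): no fully charged `P`-cell below `h = 6`, no fully charged `N`-cell below `h = 8` —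
the FC thresholds of the census (`fc_threshold`: none at LINE-6 … ) from the `P`∕`N` gap alone, uniformly. -/
theorem no_fcP_below_six {h : ℤ} (hh : h < 6) {C : MConfig} (hC : LSupport h C) (hG : C.G1Closed) (hD : RuleDMu4Closed C)
    (hX : XPlusClosed C) {P : MCell} (hP : P ∈ C.upper) : ¬ FCc P := by
  intro hFC
  obtain ⟨X, rfl⟩ := exists_realize (fun g => hC.2 _ hP g)
  have hc := charges_pos_of_fcc hFC
  have key := (lineModel_of_config hC hG hD hX).fcP_gap hP hc 0
  have : (1 : ℤ) ≤ (X 0).1 := by exact_mod_cast hc 0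
  linarith

theorem no_fcN_below_eight {h : ℤ} (hh : h < 8) {C : MConfig} (hC : LSupport h C) (hG : C.G1Closed) (hD : RuleDMu4Closed C)
    (hX : XPlusClosed C) {N : MCell} (hN : N ∈ C.lower) : ¬ FCc N := by
  intro hFC
  obtain ⟨X, rfl⟩ := exists_realize (fun g => hC.1 _ hN g)
  have hc := charges_pos_of_fcc hFC
  have key := (lineModel_of_config hC hG hD hX).fcN_gap hN hc 0
  have : (1 : ℤ) ≤ (X 0).1 := by exact_mod_cast hc 0
  linarith

/-- **the BOTTOM NUCLEUS of the odd-freeness check**: only odd cells inside the proved gaps need checking. -/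
def AbstractOddNucleusFree (h : ℤ) : Prop :=
  ∀ vN vP : ACell → Prop, LineModel h vN vP → ∀ X : ACell, AOddFC X →
    ((∀ f, 2 * ((X f).1 : ℤ) + 6 ≤ h) → ¬ vN X) ∧ ((∀ f, 2 * ((X f).1 : ℤ) + 4 ≤ h) → ¬ vP X)

/-- REDUCTION (PROVED): the nucleus check implies the full check. -/
theorem abstractOddFree_of_nucleus {h : ℤ} (hN : AbstractOddNucleusFree h) : AbstractOddFree h := by
  intro vN vP M X hX
  refine ⟨fun hv => (hN vN vP M X hX).1 (fun f => M.fcN_gap hv hX.1 f) hv,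
    fun hv => (hN vN vP M X hX).2 (fun f => M.fcP_gap hv hX.1 f) hv⟩

/-- so (PROVED) odd-freeness of every LINE design of height `< 6` is unconditional, and `OddLineThresholdLaw` needs the machine
check only on the nucleus at `h = 10` (cells with all charges `≤ 3` on `P`, `≤ 2` on `N`). -/
theorem oddFCFreeLine_of_lt_six {h : ℤ} (hh : h < 6) : OddFCFreeLine h := by
  intro C hC hG hD hX hodd
  rcases hodd with ⟨Z, hZ, hFC, -⟩ | ⟨P, hP, hFC, -⟩
  · exact no_fcN_below_eight (by omega) hC hG hD hX hZ hFC
  · exact no_fcP_below_six hh hC hG hD hX hP hFC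

/-! ## Part F — the FULL CEILING GAP LAW (h-uniform, PROVED): `g_P = 3`, `g_N = 4` — kernel = machine for the phase-blind part

The missing unit of Part E comes from ONE new lemma that uses `X+`: **a lone ceiling letter cannot sit on the `N` level**
(`n_ceiling_absent`: RD-N1 serves such a cell by `P`-cells `(d,p)@j` avoiding ANY prescribed tag, hence by two of different
tags on the same slot; both share the hub and have no companions (two charged letters next to a ceiling letter violate (E1)),
so `X+` fires).  From it the chain of Part E restarts one level higher: `P` with a ceiling letter and another charged letter is
absent, `N` with two charged letters keeps two levels, `P` with three charged keeps two, `N` with three charged keeps three,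
FC `P` keeps THREE (`2(c+3) ≤ h`), FC `N` keeps FOUR (`2(c+4) ≤ h`) — exactly the machine gaps of `DEPTH-G1-h8-18.txt`.
Corollaries (PROVED, every h): no FC cell at all below `h = 8` (the census∕`LineInertia.fc_threshold` lower half, now for all
`h < 8` at once and from the four closed forms alone), no FC `N`-cell below `h = 10`, `OddFCFreeLine h` for every `h < 8`. -/

namespace LineModel

variable {h : ℤ} {vN vP : ACell → Prop}

/-- **(U) no `N`-cell carries a ceiling letter** (`2(c+1) > h`): with a second charged letter this is (E1); alone, RD-N1 + `X+`. -/
theorem n_ceiling_absent (M : LineModel h vN vP) {X : ACell} (hX : vN X) (g : Fin 4) (hg : 1 ≤ (X g).1)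
    (hc : h < 2 * ((X g).1 : ℤ) + 2) : False := by
  obtain ⟨h1, h2, -, h12, -, -⟩ := fin4_others g
  have hap : ∀ j, j ≠ g → (X j).1 = 0 := by
    intro j hj
    by_contra hne
    have key := M.n_gap_one hX (g := g) (j := j) (Ne.symm hj) hg (Nat.one_le_iff_ne_zero.mpr hne)
    linarith
  have hnoN : ∀ (c' : ℕ) (p : Fin 4), 1 ≤ c' → ¬ vN (Function.update X (g + 1) (c', p)) := by
    intro c' p hc' hv
    have e1 : Function.update X (g + 1) (c', p) g = X g := Function.update_of_ne h1.symm _ _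
    have e2 : Function.update X (g + 1) (c', p) (g + 1) = (c', p) := Function.update_self _ _ _
    have key := M.n_gap_one hv (g := g) (j := g + 1) h1.symm (by rw [e1]; exact hg) (by rw [e2]; exact hc')
    rw [e1] at key
    linarith
  have key : ∀ k' : Fin 4, ∃ d : ℕ, ∃ p : Fin 4, 1 ≤ d ∧ p ≠ k' ∧ vP (Function.update X (g + 1) (d, p)) := by
    intro k'
    rcases M.rdN1 X hX g (g + 1) h1.symm hg (hap _ h1) k' with
      ⟨c', hc', hch, -⟩ | ⟨d, p, hd, hp, hv⟩ | ⟨c', d, p, hc', hch, -, -, -⟩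
    · exfalso
      have : ((X g).1 : ℤ) + 1 ≤ c' := by exact_mod_cast hc'
      linarith
    · exact ⟨d, p, hd, hp, hv⟩
    · exfalso
      have : ((X g).1 : ℤ) + 1 ≤ c' := by exact_mod_cast hc'
      linarith
  obtain ⟨d₀, p₀, hd₀, -, hv₀⟩ := key 0
  obtain ⟨d₁, p₁, hd₁, hp₁, hv₁⟩ := key p₀
  have eσ : Function.update X (g + 1) (d₀, p₀) (g + 1) = (d₀, p₀) := Function.update_self _ _ _
  have ef : Function.update X (g + 1) (d₀, p₀) (g + 2) = X (g + 2) := Function.update_of_ne h12.symm _ _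
  refine M.xplus (Function.update X (g + 1) (d₀, p₀)) hv₀ (g + 1) (g + 2) h12.symm (by rw [eσ]; exact hd₀)
    (by rw [ef]; exact hap _ h2) ?_ ?_ d₁ p₁ (by rw [eσ]; exact hp₁) hd₁ ?_ ?_
  · rw [Function.update_idem]; exact M.apexN X hX (g + 1) 0 (hap _ h1)
  · intro c' hc' _
    rw [eσ, Function.update_idem]
    exact hnoN c' p₀ hc'
  · rw [Function.update_idem]; exact hv₁
  · intro e' he' _
    rw [Function.update_idem]
    exact hnoN e' p₁ he'

/-- **(PC) no `P`-cell carries a ceiling letter next to another charged letter** (RD-P at the other letter lands on (U)). -/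
theorem p_ceiling_absent (M : LineModel h vN vP) {X : ACell} (hX : vP X) {g b : Fin 4} (hgb : g ≠ b)
    (hg : 1 ≤ (X g).1) (hb : 1 ≤ (X b).1) (hc : h < 2 * ((X g).1 : ℤ) + 2) : False := by
  obtain ⟨c', -, hN⟩ := M.rdP X hX b hb
  have e : Function.update X b (c', (X b).2) g = X g := Function.update_of_ne hgb _ _
  exact M.n_ceiling_absent hN g (by rw [e]; exact hg) (by rw [e]; exact hc)

/-- (E1′) an `N`-cell with two charged slots keeps TWO levels below the ceiling. -/
theorem n2_gap_two (M : LineModel h vN vP) {X : ACell} (hX : vN X) {g j : Fin 4} (hgj : g ≠ j)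
    (hg : 1 ≤ (X g).1) (hj : 1 ≤ (X j).1) : 2 * ((X g).1 : ℤ) + 4 ≤ h := by
  by_contra hlt
  push Not at hlt
  obtain ⟨c', hc', -, hP⟩ := M.rdN2 X hX g j hgj hg hj
  have eg : Function.update X g (c', (X g).2) g = (c', (X g).2) := Function.update_self _ _ _
  have ej : Function.update X g (c', (X g).2) j = X j := Function.update_of_ne hgj.symm _ _
  have : ((X g).1 : ℤ) + 1 ≤ c' := by exact_mod_cast hc'
  exact M.p_ceiling_absent hP (g := g) (b := j) hgj (by rw [eg]; omega) (by rw [ej]; exact hj)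
    (by rw [eg]; push_cast; linarith)

/-- (E2′) a `P`-cell with three charged slots keeps two levels below the ceiling. -/
theorem p3_gap_two (M : LineModel h vN vP) {X : ACell} (hX : vP X) {g a b : Fin 4} (hga : g ≠ a) (hgb : g ≠ b)
    (hab : a ≠ b) (hg : 1 ≤ (X g).1) (ha : 1 ≤ (X a).1) (hb : 1 ≤ (X b).1) : 2 * ((X g).1 : ℤ) + 4 ≤ h := by
  obtain ⟨c', -, hN⟩ := M.rdP X hX a ha
  have eg : Function.update X a (c', (X a).2) g = X g := Function.update_of_ne hga _ _
  have eb : Function.update X a (c', (X a).2) b = X b := Function.update_of_ne hab.symm _ _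
  have key := M.n2_gap_two hN (g := g) (j := b) hgb (by rw [eg]; exact hg) (by rw [eb]; exact hb)
  rwa [eg] at key

/-- (E3′) an `N`-cell with three charged slots keeps THREE levels below the ceiling. -/
theorem n3_gap_three (M : LineModel h vN vP) {X : ACell} (hX : vN X) {g a b : Fin 4} (hga : g ≠ a) (hgb : g ≠ b)
    (hab : a ≠ b) (hg : 1 ≤ (X g).1) (ha : 1 ≤ (X a).1) (hb : 1 ≤ (X b).1) : 2 * ((X g).1 : ℤ) + 6 ≤ h := by
  obtain ⟨c', hc', -, hP⟩ := M.rdN2 X hX g a hga hg ha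
  have eg : Function.update X g (c', (X g).2) g = (c', (X g).2) := Function.update_self _ _ _
  have ea : Function.update X g (c', (X g).2) a = X a := Function.update_of_ne hga.symm _ _
  have eb : Function.update X g (c', (X g).2) b = X b := Function.update_of_ne hgb.symm _ _
  have key := M.p3_gap_two hP (g := g) (a := a) (b := b) hga hgb hab (by rw [eg]; omega) (by rw [ea]; exact ha)
    (by rw [eb]; exact hb)
  rw [eg] at key
  have : ((X g).1 : ℤ) + 1 ≤ c' := by exact_mod_cast hc'
  push_cast at key
  linarith

/-- **(E4′ = g_P ≥ 3) fully charged `P`-cells keep THREE levels below the ceiling**: `2(c+3) ≤ h` for every charge. -/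
theorem fcP_gap_three (M : LineModel h vN vP) {X : ACell} (hX : vP X) (hc : ∀ f, 1 ≤ (X f).1) (g : Fin 4) :
    2 * ((X g).1 : ℤ) + 6 ≤ h := by
  obtain ⟨h1, h2, h3, h12, h13, h23⟩ := fin4_others g
  obtain ⟨c', -, hN⟩ := M.rdP X hX (g + 1) (hc (g + 1))
  have eg : Function.update X (g + 1) (c', (X (g + 1)).2) g = X g := Function.update_of_ne h1.symm _ _
  have e2 : Function.update X (g + 1) (c', (X (g + 1)).2) (g + 2) = X (g + 2) := Function.update_of_ne h12.symm _ _
  have e3 : Function.update X (g + 1) (c', (X (g + 1)).2) (g + 3) = X (g + 3) := Function.update_of_ne h13.symm _ _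
  have key := M.n3_gap_three hN (g := g) (a := g + 2) (b := g + 3) h2.symm h3.symm h23 (by rw [eg]; exact hc g)
    (by rw [e2]; exact hc (g + 2)) (by rw [e3]; exact hc (g + 3))
  rwa [eg] at key

/-- **(E5′ = g_N ≥ 4) fully charged `N`-cells keep FOUR levels below the ceiling**: `2(c+4) ≤ h` for every charge. -/
theorem fcN_gap_four (M : LineModel h vN vP) {X : ACell} (hX : vN X) (hc : ∀ f, 1 ≤ (X f).1) (g : Fin 4) :
    2 * ((X g).1 : ℤ) + 8 ≤ h := by
  obtain ⟨h1, -, -, -, -, -⟩ := fin4_others g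
  obtain ⟨c', hc', -, hP⟩ := M.rdN2 X hX g (g + 1) h1.symm (hc g) (hc (g + 1))
  have hcZ : ∀ f, 1 ≤ (Function.update X g (c', (X g).2) f).1 := by
    intro f
    by_cases hf : f = g
    · subst hf; rw [Function.update_self]; exact le_of_lt (lt_of_le_of_lt (hc f) hc')
    · rw [Function.update_of_ne hf]; exact hc f
  have key := M.fcP_gap_three hP hcZ g
  rw [Function.update_self] at key
  have : ((X g).1 : ℤ) + 1 ≤ c' := by exact_mod_cast hc'
  push_cast at key
  linarith

end LineModel

/-- **THE CEILING GAP LAW, `P` level, sharp form** (PROVED, every `h`): every letter of a fully charged RULE-D `P`-cell of a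
`G₁`-closed RULE-D∕`X+` LINE design has charge `c` with `2(c+3) ≤ h` — the machine gap `g_P = 3` exactly. -/
theorem fc_ceiling_gap_P_three {h : ℤ} {C : MConfig} (hC : LSupport h C) (hG : C.G1Closed) (hD : RuleDMu4Closed C)
    (hX : XPlusClosed C) {P : MCell} (hP : P ∈ C.upper) (hFC : FCc P) {f : Fin 4} {c : ℕ} {k : Fin 4}
    (e : P f = lineLetter h c k) : 2 * (c : ℤ) + 6 ≤ h := by
  have hM := lineModel_of_config hC hG hD hX
  obtain ⟨X, rfl⟩ := exists_realize (fun g => hC.2 _ hP g)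
  have hc := charges_pos_of_fcc hFC
  rw [realize_apply] at e
  rw [← charge_eq_of_lineLetter_eq e]
  exact hM.fcP_gap_three hP hc f

/-- **THE CEILING GAP LAW, `N` level, sharp form** (PROVED, every `h`): `2(c+4) ≤ h` — the machine gap `g_N = 4` exactly. -/
theorem fc_ceiling_gap_N_four {h : ℤ} {C : MConfig} (hC : LSupport h C) (hG : C.G1Closed) (hD : RuleDMu4Closed C)
    (hX : XPlusClosed C) {N : MCell} (hN : N ∈ C.lower) (hFC : FCc N) {f : Fin 4} {c : ℕ} {k : Fin 4}
    (e : N f = lineLetter h c k) : 2 * (c : ℤ) + 8 ≤ h := by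
  have hM := lineModel_of_config hC hG hD hX
  obtain ⟨X, rfl⟩ := exists_realize (fun g => hC.1 _ hN g)
  have hc := charges_pos_of_fcc hFC
  rw [realize_apply] at e
  rw [← charge_eq_of_lineLetter_eq e]
  exact hM.fcN_gap_four hN hc f

/-- **no fully charged cell on any LINE design of height `< 8`** (PROVED, uniformly in `h`; `LineInertia.fc_threshold` had the
case `h = 6` by hand) and no fully charged `N`-cell below `h = 10`. -/
theorem no_fc_below_eight {h : ℤ} (hh : h < 8) {C : MConfig} (hC : LSupport h C) (hG : C.G1Closed) (hD : RuleDMu4Closed C)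
    (hX : XPlusClosed C) {Z : MCell} (hZ : Z ∈ C.lower ∪ C.upper) : ¬ FCc Z := by
  intro hFC
  have hM := lineModel_of_config hC hG hD hX
  rcases Finset.mem_union.mp hZ with h1 | h1
  · obtain ⟨X, rfl⟩ := exists_realize (fun g => hC.1 _ h1 g)
    have hc := charges_pos_of_fcc hFC
    have key := hM.fcN_gap_four h1 hc 0
    have : (1 : ℤ) ≤ (X 0).1 := by exact_mod_cast hc 0
    linarith
  · obtain ⟨X, rfl⟩ := exists_realize (fun g => hC.2 _ h1 g)
    have hc := charges_pos_of_fcc hFC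
    have key := hM.fcP_gap_three h1 hc 0
    have : (1 : ℤ) ≤ (X 0).1 := by exact_mod_cast hc 0
    linarith

theorem no_fcN_below_ten {h : ℤ} (hh : h < 10) {C : MConfig} (hC : LSupport h C) (hG : C.G1Closed) (hD : RuleDMu4Closed C)
    (hX : XPlusClosed C) {N : MCell} (hN : N ∈ C.lower) : ¬ FCc N := by
  intro hFC
  obtain ⟨X, rfl⟩ := exists_realize (fun g => hC.1 _ hN g)
  have hc := charges_pos_of_fcc hFC
  have key := (lineModel_of_config hC hG hD hX).fcN_gap_four hN hc 0
  have : (1 : ℤ) ≤ (X 0).1 := by exact_mod_cast hc 0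
  linarith

/-- hence (PROVED, no machine input) **`OddFCFreeLine h` for every `h < 8`**; the machine check is needed only at `h ∈ {8,…,11}`. -/
theorem oddFCFreeLine_of_lt_eight {h : ℤ} (hh : h < 8) : OddFCFreeLine h := by
  intro C hC hG hD hX hodd
  rcases hodd with ⟨Z, hZ, hFC, -⟩ | ⟨P, hP, hFC, -⟩
  · exact no_fc_below_eight hh hC hG hD hX (Finset.mem_union_left _ hZ) hFC
  · exact no_fc_below_eight hh hC hG hD hX (Finset.mem_union_right _ hP) hFC

/-- the sharp BOTTOM NUCLEUS of the odd-freeness check: odd cells with `2(c+4) ≤ h` on `N`, `2(c+3) ≤ h` on `P` (at `h = 10`: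
charges `= 1` on `N`, `≤ 2` on `P` — the 44 orbits `uplocal.py` found to need search). -/
def AbstractOddSharpNucleusFree (h : ℤ) : Prop :=
  ∀ vN vP : ACell → Prop, LineModel h vN vP → ∀ X : ACell, AOddFC X →
    ((∀ f, 2 * ((X f).1 : ℤ) + 8 ≤ h) → ¬ vN X) ∧ ((∀ f, 2 * ((X f).1 : ℤ) + 6 ≤ h) → ¬ vP X)

/-- REDUCTION (PROVED): the sharp nucleus check implies the full finite check. -/
theorem abstractOddFree_of_sharpNucleus {h : ℤ} (hN : AbstractOddSharpNucleusFree h) : AbstractOddFree h := by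
  intro vN vP M X hX
  refine ⟨fun hv => (hN vN vP M X hX).1 (fun f => M.fcN_gap_four hv hX.1 f) hv,
    fun hv => (hN vN vP M X hX).2 (fun f => M.fcP_gap_three hv hX.1 f) hv⟩

/-! ## Part G — the first PHASE-SENSITIVE ceiling law (h-uniform, PROVED): TAG UNIQUENESS at a rigid letter and the PAIR-TYPE gap `g_P ≥ 4`

A letter `(c,k)@g` of a `P`-cell is RIGID when `2(c+2) > h`: by (E1′) no `N`-cell contains it together with another charged letter, so the
`X+` rule sees a bare hub and no companions.  Consequence (`tag_unique`): all `P`-cells `X[b ≔ (d,p)]` completing a rigid frame at one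
slot `b` carry THE SAME tag `p`.  Feeding RD-P∕RD-N2 through it (with one slot swap) gives `p3_tags`: in a `P`-cell with three charged
slots whose top letter has `2(c+3) > h` the two lower letters have EQUAL tags; `n3_tags`: the same on `N` for a top letter with
`2(c+4) > h`; hence **`fcP_three_tags`: in a fully charged `P`-cell, next to a letter with `2(c+4) > h` the other three tags are equal**,
and `fcN_three_tags` (`2(c+5) > h`).  Contrapositive = the machine's pair-type refinement: an FC cell whose tag word is not of the form
`t t t ∗` around the tall letter keeps FOUR levels below the ceiling on `P` (`2(c+4) ≤ h`), FIVE on `N` — `g_P(T) ≥ 4`, `g_N(T) ≥ 5` for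
T ∈ {0011, 0022, 0012, 0013, 0023, 0123} (equality for the five pair types by `TGRID-G1-*.txt`; `0123` needs 6 — not proved here). -/

theorem fin4_cover {g a b f : Fin 4} (hga : g ≠ a) (hgb : g ≠ b) (hgf : g ≠ f) (hab : a ≠ b) (haf : a ≠ f) (hbf : b ≠ f)
    (i : Fin 4) : i = g ∨ i = a ∨ i = b ∨ i = f := by
  revert g a b f i; decide

theorem fin4_fourth {g a b : Fin 4} (hga : g ≠ a) (hgb : g ≠ b) (hab : a ≠ b) : ∃ f : Fin 4, g ≠ f ∧ a ≠ f ∧ b ≠ f := by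
  revert g a b; decide

namespace LineModel

variable {h : ℤ} {vN vP : ACell → Prop}

/-- **TAG UNIQUENESS at a rigid letter (PROVED).** If `(X g)` is charged with `2((X g).1 + 2) > h` and `f` is an apex slot, then two
`P`-cells `X[b ≔ (d,p)]`, `X[b ≔ (e,q)]` (`d, e ≥ 1`) have `p = q`: the hub `X[b ≔ apex]` is present (RD-P; a charged landing is (E1′)-dead),
no `N`-companion exists on either ray ((E1′) again), so `X+` forbids two tags. -/
theorem tag_unique (M : LineModel h vN vP) {X : ACell} {g b f : Fin 4} (hgb : g ≠ b) (hfb : f ≠ b)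
    (hg : 1 ≤ (X g).1) (hrig : h < 2 * ((X g).1 : ℤ) + 4) (hf : (X f).1 = 0) {d e : ℕ} {p q : Fin 4} (hd : 1 ≤ d) (he : 1 ≤ e)
    (hp : vP (Function.update X b (d, p))) (hq : vP (Function.update X b (e, q))) : p = q := by
  by_contra hpq
  have hnoN : ∀ (c' : ℕ) (r : Fin 4), 1 ≤ c' → ¬ vN (Function.update X b (c', r)) := by
    intro c' r hc' hv
    have e1 : Function.update X b (c', r) g = X g := Function.update_of_ne hgb _ _
    have e2 : Function.update X b (c', r) b = (c', r) := Function.update_self _ _ _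
    have key := M.n2_gap_two hv (g := g) (j := b) hgb (by rw [e1]; exact hg) (by rw [e2]; exact hc')
    rw [e1] at key
    linarith
  have eb : Function.update X b (d, p) b = (d, p) := Function.update_self _ _ _
  have ef : Function.update X b (d, p) f = X f := Function.update_of_ne hfb _ _
  -- the hub
  have hub : vN (Function.update X b (0, 0)) := by
    obtain ⟨c', hc', hN⟩ := M.rdP _ hp b (by rw [eb]; exact hd)
    rw [eb, Function.update_idem] at hN
    rcases Nat.eq_zero_or_pos c' with rfl | hpos
    · have := M.apexN _ hN b 0 (by rw [Function.update_self])
      rwa [Function.update_idem] at this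
    · exact absurd hN (hnoN c' p hpos)
  refine M.xplus (Function.update X b (d, p)) hp b f hfb (by rw [eb]; exact hd) (by rw [ef]; exact hf) ?_ ?_ e q
    (by rw [eb]; exact fun h' => hpq h'.symm) he ?_ ?_
  · rw [Function.update_idem]; exact hub
  · intro c' hc' _
    rw [eb, Function.update_idem]
    exact hnoN c' p hc'
  · rw [Function.update_idem]; exact hq
  · intro e' he' _
    rw [Function.update_idem]
    exact hnoN e' q he'

/-- **(P3T) in a `P`-cell with three charged slots `g, a, b` and apex `f`, if the `g`-letter has `2(c+3) > h` then the `a`- and `b`-letters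
carry EQUAL tags (PROVED).**  RD-P at `a` (resp. `b`) must land on the apex ((E3′)), RD-N2 then raises `g` by exactly one level (a ceiling
letter is (PC)-dead) — two `P`-cells with the rigid letter `(c+1,k)@g` and one charged slot; after swapping `a ↔ b` in the second they
complete the same rigid frame at `b` with tags `k_b` and `k_a`, so `tag_unique` gives `k_a = k_b`. -/
theorem p3_tags (M : LineModel h vN vP) {Z : ACell} {g a b f : Fin 4} (hga : g ≠ a) (hgb : g ≠ b) (hgf : g ≠ f) (hab : a ≠ b)
    (haf : a ≠ f) (hbf : b ≠ f) (hZ : vP Z) (hg : 1 ≤ (Z g).1) (htop : h < 2 * ((Z g).1 : ℤ) + 6) (ha : 1 ≤ (Z a).1)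
    (hb : 1 ≤ (Z b).1) (hf : (Z f).1 = 0) : (Z a).2 = (Z b).2 := by
  -- RD-P at a charged lower slot lands on the apex
  have drop : ∀ {x y : Fin 4}, g ≠ x → g ≠ y → x ≠ y → 1 ≤ (Z x).1 → 1 ≤ (Z y).1 → vN (Function.update Z x (0, 0)) := by
    intro x y hgx hgy hxy hx hy
    obtain ⟨c', hc', hN⟩ := M.rdP Z hZ x hx
    rcases Nat.eq_zero_or_pos c' with rfl | hpos
    · have := M.apexN _ hN x 0 (by rw [Function.update_self])
      rwa [Function.update_idem] at this
    · exfalso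
      have eg : Function.update Z x (c', (Z x).2) g = Z g := Function.update_of_ne hgx _ _
      have ex : Function.update Z x (c', (Z x).2) x = (c', (Z x).2) := Function.update_self _ _ _
      have ey : Function.update Z x (c', (Z x).2) y = Z y := Function.update_of_ne hxy.symm _ _
      have key := M.n3_gap_three hN (g := g) (a := x) (b := y) hgx hgy hxy (by rw [eg]; exact hg) (by rw [ex]; exact hpos)
        (by rw [ey]; exact hy)
      rw [eg] at key
      linarith
  -- RD-N2 then raises `g` by exactly one level
  have raise : ∀ {x y : Fin 4}, g ≠ x → g ≠ y → x ≠ y → 1 ≤ (Z y).1 → vN (Function.update Z x (0, 0)) →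
      vP (Function.update (Function.update Z x (0, 0)) g ((Z g).1 + 1, (Z g).2)) := by
    intro x y hgx hgy hxy hy hW
    have eg : Function.update Z x ((0 : ℕ), (0 : Fin 4)) g = Z g := Function.update_of_ne hgx _ _
    have ey : Function.update Z x ((0 : ℕ), (0 : Fin 4)) y = Z y := Function.update_of_ne hxy.symm _ _
    obtain ⟨c', hc', hch, hP⟩ := M.rdN2 _ hW g y hgy (by rw [eg]; exact hg) (by rw [ey]; exact hy)
    rw [eg] at hc' hP
    have hc'eq : c' = (Z g).1 + 1 := by
      by_contra hne
      have h2 : (Z g).1 + 2 ≤ c' := by omega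
      have e1 : Function.update (Function.update Z x ((0 : ℕ), (0 : Fin 4))) g (c', (Z g).2) g = (c', (Z g).2) :=
        Function.update_self _ _ _
      have e2 : Function.update (Function.update Z x ((0 : ℕ), (0 : Fin 4))) g (c', (Z g).2) y = Z y := by
        rw [Function.update_of_ne hgy.symm, ey]
      refine M.p_ceiling_absent hP (g := g) (b := y) hgy (by rw [e1]; omega) (by rw [e2]; exact hy) ?_
      rw [e1]
      have : ((Z g).1 : ℤ) + 2 ≤ c' := by exact_mod_cast h2
      push_cast
      linarith
    rw [hc'eq] at hP
    exact hP
  have hWa := drop hga hgb hab ha hb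
  have hWb := drop hgb hga hab.symm hb ha
  have hUb := raise hga hgb hab hb hWa      -- g raised, a apex, b charged
  have hUa := raise hgb hga hab.symm ha hWb -- g raised, b apex, a charged
  have hUa' := M.permP _ hUa (Equiv.swap a b)
  -- common rigid frame
  set B : ACell := Function.update (Function.update (Function.update Z a ((0 : ℕ), (0 : Fin 4))) b ((0 : ℕ), (0 : Fin 4))) g
    ((Z g).1 + 1, (Z g).2) with hB
  have cov := fin4_cover hga hgb hgf hab haf hbf
  have e1 : Function.update B b (Z b) = Function.update (Function.update Z a ((0 : ℕ), (0 : Fin 4))) g ((Z g).1 + 1, (Z g).2) := by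
    funext i
    rcases cov i with rfl | rfl | rfl | rfl <;>
      simp [hB, hgb, hab, hga.symm, hgb.symm, hab.symm, haf.symm, hbf.symm, hgf.symm]
  have e2 : Function.update B b (Z a) =
      fun i => Function.update (Function.update Z b ((0 : ℕ), (0 : Fin 4))) g ((Z g).1 + 1, (Z g).2) (Equiv.swap a b i) := by
    funext i
    rcases cov i with rfl | rfl | rfl | rfl <;>
      simp [hB, Equiv.swap_apply_def, hga, hgb, hab, hga.symm, hgb.symm, haf.symm, hbf.symm, hgf.symm]
  have hBg : B g = ((Z g).1 + 1, (Z g).2) := by simp [hB]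
  have hBf : (B f).1 = 0 := by
    simp [hB, hgf.symm, hbf.symm, haf.symm, hf]
  have key := M.tag_unique (X := B) (g := g) (b := b) (f := f) hgb hbf.symm (by rw [hBg]; omega)
    (by rw [hBg]; push_cast; linarith) hBf (d := (Z b).1) (e := (Z a).1) (p := (Z b).2) (q := (Z a).2) hb ha
    (by rw [show ((Z b).1, (Z b).2) = Z b from rfl, e1]; exact hUb)
    (by rw [show ((Z a).1, (Z a).2) = Z a from rfl, e2]; exact hUa')
  exact key.symm

/-- **(N3T)** the same on `N` one level lower: three charged slots, top letter with `2(c+4) > h` ⇒ the two lower tags are equal. -/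
theorem n3_tags (M : LineModel h vN vP) {Y : ACell} {g a b f : Fin 4} (hga : g ≠ a) (hgb : g ≠ b) (hgf : g ≠ f) (hab : a ≠ b)
    (haf : a ≠ f) (hbf : b ≠ f) (hY : vN Y) (hg : 1 ≤ (Y g).1) (htop : h < 2 * ((Y g).1 : ℤ) + 8) (ha : 1 ≤ (Y a).1)
    (hb : 1 ≤ (Y b).1) (hf : (Y f).1 = 0) : (Y a).2 = (Y b).2 := by
  obtain ⟨c', hc', -, hP⟩ := M.rdN2 Y hY g a hga hg ha
  have eg : Function.update Y g (c', (Y g).2) g = (c', (Y g).2) := Function.update_self _ _ _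
  have ea : Function.update Y g (c', (Y g).2) a = Y a := Function.update_of_ne hga.symm _ _
  have eb : Function.update Y g (c', (Y g).2) b = Y b := Function.update_of_ne hgb.symm _ _
  have ef : Function.update Y g (c', (Y g).2) f = Y f := Function.update_of_ne hgf.symm _ _
  have : ((Y g).1 : ℤ) + 1 ≤ c' := by exact_mod_cast hc'
  have key := M.p3_tags hga hgb hgf hab haf hbf hP (by rw [eg]; omega) (by rw [eg]; push_cast; linarith)
    (by rw [ea]; exact ha) (by rw [eb]; exact hb) (by rw [ef]; exact hf)
  rwa [ea, eb] at key

/-- **THREE-EQUAL-TAGS LAW on `P` (PROVED, h-uniform): in a fully charged `P`-cell, the three letters other than a letter with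
`2(c+4) > h` carry one and the same tag.** -/
theorem fcP_three_tags (M : LineModel h vN vP) {X : ACell} (hX : vP X) (hc : ∀ f, 1 ≤ (X f).1) {g a b : Fin 4} (hga : g ≠ a)
    (hgb : g ≠ b) (hab : a ≠ b) (htop : h < 2 * ((X g).1 : ℤ) + 8) : (X a).2 = (X b).2 := by
  obtain ⟨f, hgf, haf, hbf⟩ := fin4_fourth hga hgb hab
  obtain ⟨c', hc', hN⟩ := M.rdP X hX f (hc f)
  rcases Nat.eq_zero_or_pos c' with rfl | hpos
  · have eg : Function.update X f ((0 : ℕ), (X f).2) g = X g := Function.update_of_ne hgf _ _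
    have ea : Function.update X f ((0 : ℕ), (X f).2) a = X a := Function.update_of_ne haf _ _
    have eb : Function.update X f ((0 : ℕ), (X f).2) b = X b := Function.update_of_ne hbf _ _
    have key := M.n3_tags hga hgb hgf hab haf hbf hN (by rw [eg]; exact hc g) (by rw [eg]; exact htop) (by rw [ea]; exact hc a)
      (by rw [eb]; exact hc b) (by rw [Function.update_self])
    rwa [ea, eb] at key
  · exfalso
    have hcZ : ∀ i, 1 ≤ (Function.update X f (c', (X f).2) i).1 := by
      intro i
      by_cases hi : i = f
      · subst hi; rw [Function.update_self]; exact hpos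
      · rw [Function.update_of_ne hi]; exact hc i
    have key := M.fcN_gap_four hN hcZ g
    rw [Function.update_of_ne hgf] at key
    linarith

/-- **THREE-EQUAL-TAGS LAW on `N`** (PROVED): the same next to a letter with `2(c+5) > h`. -/
theorem fcN_three_tags (M : LineModel h vN vP) {X : ACell} (hX : vN X) (hc : ∀ f, 1 ≤ (X f).1) {g a b : Fin 4} (hga : g ≠ a)
    (hgb : g ≠ b) (hab : a ≠ b) (htop : h < 2 * ((X g).1 : ℤ) + 10) : (X a).2 = (X b).2 := by
  obtain ⟨c', hc', -, hP⟩ := M.rdN2 X hX g a hga (hc g) (hc a)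
  have hcZ : ∀ i, 1 ≤ (Function.update X g (c', (X g).2) i).1 := by
    intro i
    by_cases hi : i = g
    · subst hi; rw [Function.update_self]; exact le_of_lt (lt_of_le_of_lt (hc i) hc')
    · rw [Function.update_of_ne hi]; exact hc i
  have : ((X g).1 : ℤ) + 1 ≤ c' := by exact_mod_cast hc'
  have key := M.fcP_three_tags hP hcZ hga hgb hab (by rw [Function.update_self]; push_cast; linarith)
  rwa [Function.update_of_ne hga.symm, Function.update_of_ne hgb.symm] at key

end LineModel

/-- **THE PAIR-TYPE CEILING GAP on `P` (PROVED, every `h`)**: if a fully charged RULE-D `P`-cell of a `G₁`-closed RULE-D∕`X+` LINE design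
carries, besides the letter `lineLetter h c k` at `g`, two letters with DIFFERENT tags, then `2(c+4) ≤ h` — one level more than the
phase-blind `2(c+3) ≤ h` of Part F; this is the machine's `g_P(T) = 4` for the pair types `0011, 0022, 0012, 0013, 0023` (and a first
bound for `0123`). -/
theorem fc_pair_gap_P {h : ℤ} {C : MConfig} (hC : LSupport h C) (hG : C.G1Closed) (hD : RuleDMu4Closed C) (hX : XPlusClosed C)
    {P : MCell} (hP : P ∈ C.upper) (hFC : FCc P) {g a b : Fin 4} (hga : g ≠ a) (hgb : g ≠ b) (hab : a ≠ b) {c ca cb : ℕ}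
    {k ka kb : Fin 4} (eg : P g = lineLetter h c k) (ea : P a = lineLetter h ca ka) (eb : P b = lineLetter h cb kb)
    (hk : ka ≠ kb) : 2 * (c : ℤ) + 8 ≤ h := by
  have hM := lineModel_of_config hC hG hD hX
  obtain ⟨X, rfl⟩ := exists_realize (fun f => hC.2 _ hP f)
  have hc := charges_pos_of_fcc hFC
  rw [realize_apply] at eg ea eb
  obtain ⟨-, rfl⟩ := lineLetter_inj (hc a) ea
  obtain ⟨-, rfl⟩ := lineLetter_inj (hc b) eb
  rw [← charge_eq_of_lineLetter_eq eg]
  by_contra hlt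
  exact hk (hM.fcP_three_tags hP hc hga hgb hab (by push Not at hlt; exact hlt))

/-- **THE PAIR-TYPE CEILING GAP on `N`** (PROVED, every `h`): `2(c+5) ≤ h` — the machine's `g_N(T) = 5` for the pair types. -/
theorem fc_pair_gap_N {h : ℤ} {C : MConfig} (hC : LSupport h C) (hG : C.G1Closed) (hD : RuleDMu4Closed C) (hX : XPlusClosed C)
    {N : MCell} (hN : N ∈ C.lower) (hFC : FCc N) {g a b : Fin 4} (hga : g ≠ a) (hgb : g ≠ b) (hab : a ≠ b) {c ca cb : ℕ}
    {k ka kb : Fin 4} (eg : N g = lineLetter h c k) (ea : N a = lineLetter h ca ka) (eb : N b = lineLetter h cb kb)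
    (hk : ka ≠ kb) : 2 * (c : ℤ) + 10 ≤ h := by
  have hM := lineModel_of_config hC hG hD hX
  obtain ⟨X, rfl⟩ := exists_realize (fun f => hC.1 _ hN f)
  have hc := charges_pos_of_fcc hFC
  rw [realize_apply] at eg ea eb
  obtain ⟨-, rfl⟩ := lineLetter_inj (hc a) ea
  obtain ⟨-, rfl⟩ := lineLetter_inj (hc b) eb
  rw [← charge_eq_of_lineLetter_eq eg]
  by_contra hlt
  exact hk (hM.fcN_three_tags hN hc hga hgb hab (by push Not at hlt; exact hlt))

/-! ## Part H — TOP PAIRS HAVE THE SAME PARITY (h-uniform, PROVED; uses the shift symmetry `Δ`)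

`tag_unique` + one slot swap + a tag shift: two letters OF EQUAL CHARGE `c` sitting at the top admissible level of their census —
`2(c+2) > h` on `P` (sub-ceiling), `2(c+3) > h` on `N` — have tags that are EQUAL or ANTIPODAL (`p_top_pair_parity`,
`n_top_pair_parity`): the first phase-sensitive law among cells with only two charged letters, and the `PAIRPROBE-h12.txt` pattern
«`P(5,5)` ∕ `N(4,4)` adjacent absent, equal∕antipodal present» for every `h`.  It is the top-of-the-alphabet twin of the unit-level
antipodal law `unit_pair_antipodal` of Part B. -/

theorem fin4_third (g b : Fin 4) : ∃ f : Fin 4, f ≠ g ∧ f ≠ b := exists_third g b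

theorem fin4_two_mul_eq_zero : ∀ t : Fin 4, t + t = 0 → t = 0 ∨ t = 2 := by decide

namespace LineModel

variable {h : ℤ} {vN vP : ACell → Prop}

/-- `P`-presence only depends on the cell up to the tags of its apex letters. -/
theorem congrP (M : LineModel h vN vP) {X Y : ACell} (hX : vP X) (hXY : ∀ i, X i = Y i ∨ ((X i).1 = 0 ∧ (Y i).1 = 0)) : vP Y := by
  have step : ∀ (Z : ACell) (i : Fin 4), vP Z → (Z i = Y i ∨ ((Z i).1 = 0 ∧ (Y i).1 = 0)) → vP (Function.update Z i (Y i)) := by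
    intro Z i hZ hi
    rcases hi with e | ⟨hz, hy⟩
    · rw [← e, Function.update_eq_self]; exact hZ
    · have : Y i = (0, (Y i).2) := Prod.ext hy rfl
      rw [this]; exact M.apexP Z hZ i _ hz
  have h0 := step X 0 hX (hXY 0)
  have h1 := step _ 1 h0 (by rw [Function.update_of_ne (by decide)]; exact hXY 1)
  have h2 := step _ 2 h1 (by rw [Function.update_of_ne (by decide), Function.update_of_ne (by decide)]; exact hXY 2)
  have h3 := step _ 3 h2 (by
    rw [Function.update_of_ne (by decide), Function.update_of_ne (by decide), Function.update_of_ne (by decide)]; exact hXY 3)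
  have e : Function.update (Function.update (Function.update (Function.update X 0 (Y 0)) 1 (Y 1)) 2 (Y 2)) 3 (Y 3) = Y := by
    funext i; fin_cases i <;> simp
  rwa [e] at h3

/-- `N`-presence only depends on the cell up to the tags of its apex letters. -/
theorem congrN (M : LineModel h vN vP) {X Y : ACell} (hX : vN X) (hXY : ∀ i, X i = Y i ∨ ((X i).1 = 0 ∧ (Y i).1 = 0)) : vN Y := by
  have step : ∀ (Z : ACell) (i : Fin 4), vN Z → (Z i = Y i ∨ ((Z i).1 = 0 ∧ (Y i).1 = 0)) → vN (Function.update Z i (Y i)) := by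
    intro Z i hZ hi
    rcases hi with e | ⟨hz, hy⟩
    · rw [← e, Function.update_eq_self]; exact hZ
    · have : Y i = (0, (Y i).2) := Prod.ext hy rfl
      rw [this]; exact M.apexN Z hZ i _ hz
  have h0 := step X 0 hX (hXY 0)
  have h1 := step _ 1 h0 (by rw [Function.update_of_ne (by decide)]; exact hXY 1)
  have h2 := step _ 2 h1 (by rw [Function.update_of_ne (by decide), Function.update_of_ne (by decide)]; exact hXY 2)
  have h3 := step _ 3 h2 (by
    rw [Function.update_of_ne (by decide), Function.update_of_ne (by decide), Function.update_of_ne (by decide)]; exact hXY 3)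
  have e : Function.update (Function.update (Function.update (Function.update X 0 (Y 0)) 1 (Y 1)) 2 (Y 2)) 3 (Y 3) = Y := by
    funext i; fin_cases i <;> simp
  rwa [e] at h3

/-- the tag shift by any amount (`Δ` iterated). -/
theorem shiftP_by (M : LineModel h vN vP) {X : ACell} (hX : vP X) (s : Fin 4) : vP (fun i => ((X i).1, (X i).2 + s)) := by
  have h1 := M.shiftP _ hX
  have h2 := M.shiftP _ h1
  have h3 := M.shiftP _ h2
  have h4 := M.shiftP _ h3
  have e1 : X.shift = fun i => ((X i).1, (X i).2 + 3) := rfl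
  have e2 : X.shift.shift = fun i => ((X i).1, (X i).2 + 2) := by
    funext i; simp only [ACell.shift]; refine Prod.ext rfl ?_; show (X i).2 + 3 + 3 = (X i).2 + 2
    have : ∀ k : Fin 4, k + 3 + 3 = k + 2 := by decide
    exact this _
  have e3 : X.shift.shift.shift = fun i => ((X i).1, (X i).2 + 1) := by
    funext i; simp only [ACell.shift]; refine Prod.ext rfl ?_; show (X i).2 + 3 + 3 + 3 = (X i).2 + 1
    have : ∀ k : Fin 4, k + 3 + 3 + 3 = k + 1 := by decide
    exact this _
  have e4 : X.shift.shift.shift.shift = fun i => ((X i).1, (X i).2 + 0) := by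
    funext i; simp only [ACell.shift]; refine Prod.ext rfl ?_; show (X i).2 + 3 + 3 + 3 + 3 = (X i).2 + 0
    have : ∀ k : Fin 4, k + 3 + 3 + 3 + 3 = k + 0 := by decide
    exact this _
  fin_cases s
  · rw [e4] at h4; exact h4
  · rw [e3] at h3; exact h3
  · rw [e2] at h2; exact h2
  · rw [e1] at h1; exact h1

/-- **TOP PAIR PARITY on `P` (PROVED, h-uniform)**: two sub-ceiling letters (`2(c+2) > h`) of equal charge in one `P`-cell (the other two
slots apex) have equal or antipodal tags.  Swap the two slots and shift the tags by `t = k_b − k_g`: the new cell has the same `b`-letter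
and `g`-tag `k_g + 2t`, so `tag_unique` at the rigid `b`-letter forces `2t = 0`. -/
theorem p_top_pair_parity (M : LineModel h vN vP) {X : ACell} (hX : vP X) {g b : Fin 4} (hgb : g ≠ b) (hc : (X b).1 = (X g).1)
    (hg : 1 ≤ (X g).1) (hrig : h < 2 * ((X g).1 : ℤ) + 4) (hapex : ∀ i, i ≠ g → i ≠ b → (X i).1 = 0) :
    (X b).2 = (X g).2 ∨ (X b).2 = (X g).2 + 2 := by
  obtain ⟨f, hfg, hfb⟩ := fin4_third g b
  set t : Fin 4 := (X b).2 - (X g).2 with ht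
  have hk' : (X b).2 = (X g).2 + t := by rw [ht]; abel
  -- the swapped and shifted cell, normalised to the apex tags of `X`
  have hS := M.shiftP_by (M.permP X hX (Equiv.swap g b)) t
  have hq : vP (Function.update X g ((X g).1, (X b).2 + t)) := by
    refine M.congrP hS (fun i => ?_)
    by_cases hig : i = g
    · subst hig
      left
      rw [Function.update_self, Equiv.swap_apply_left, hc]
    · by_cases hib : i = b
      · subst hib
        left
        rw [Function.update_of_ne hig, Equiv.swap_apply_right]
        exact Prod.ext hc.symm hk'.symm
      · right
        simp only [Equiv.swap_apply_of_ne_of_ne hig hib, Function.update_of_ne hig]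
        exact ⟨hapex i hig hib, hapex i hig hib⟩
  have hp : vP (Function.update X g ((X g).1, (X g).2)) := by
    rw [show ((X g).1, (X g).2) = X g from rfl, Function.update_eq_self]; exact hX
  have key := M.tag_unique (X := X) (g := b) (b := g) (f := f) hgb.symm hfg (by rw [hc]; exact hg) (by rw [hc]; exact hrig)
    (hapex f hfg hfb) hg hg hp hq
  -- key : (X g).2 = (X b).2 + t = (X g).2 + t + t
  rw [hk', add_assoc] at key
  have htt : t + t = 0 := by
    have := congrArg (fun x => x - (X g).2) key
    simp at this
    exact this.symm
  rcases fin4_two_mul_eq_zero t htt with h0 | h2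
  · left; rw [hk', h0, add_zero]
  · right; rw [hk', h2]

/-- **TOP PAIR PARITY on `N` (PROVED, h-uniform)**: two letters of equal charge `c` with `2(c+3) > h` in one `N`-cell (other slots apex)
have equal or antipodal tags.  RD-N2 raises either letter by exactly one level (to a rigid letter); swapping and shifting the second
raised cell by `−t` reproduces the rigid letter of the first with `b`-tag `k_g − t` against `k_g + t`, and `tag_unique` gives `2t = 0`. -/
theorem n_top_pair_parity (M : LineModel h vN vP) {X : ACell} (hX : vN X) {g b : Fin 4} (hgb : g ≠ b) (hc : (X b).1 = (X g).1)
    (hg : 1 ≤ (X g).1) (htop : h < 2 * ((X g).1 : ℤ) + 6) (hapex : ∀ i, i ≠ g → i ≠ b → (X i).1 = 0) :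
    (X b).2 = (X g).2 ∨ (X b).2 = (X g).2 + 2 := by
  obtain ⟨f, hfg, hfb⟩ := fin4_third g b
  set t : Fin 4 := (X b).2 - (X g).2 with ht
  have hk' : (X b).2 = (X g).2 + t := by rw [ht]; abel
  have hb : 1 ≤ (X b).1 := by rw [hc]; exact hg
  -- RD-N2 raises a letter of the pair by exactly one level
  have raise : ∀ {x y : Fin 4}, x ≠ y → 1 ≤ (X x).1 → 1 ≤ (X y).1 → h < 2 * ((X x).1 : ℤ) + 6 →
      vP (Function.update X x ((X x).1 + 1, (X x).2)) := by
    intro x y hxy hx hy hxtop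
    obtain ⟨c', hc', hch, hP⟩ := M.rdN2 X hX x y hxy hx hy
    have hc'eq : c' = (X x).1 + 1 := by
      by_contra hne
      have h2 : (X x).1 + 2 ≤ c' := by omega
      have e1 : Function.update X x (c', (X x).2) x = (c', (X x).2) := Function.update_self _ _ _
      have e2 : Function.update X x (c', (X x).2) y = X y := Function.update_of_ne hxy.symm _ _
      refine M.p_ceiling_absent hP (g := x) (b := y) hxy (by rw [e1]; omega) (by rw [e2]; exact hy) ?_
      rw [e1]
      have : ((X x).1 : ℤ) + 2 ≤ c' := by exact_mod_cast h2
      push_cast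
      linarith
    rw [hc'eq] at hP
    exact hP
  have hY1 := raise hgb hg hb htop
  have hY2 := raise hgb.symm hb hg (by rw [hc]; exact htop)
  -- swap and shift the second raised cell by `−t`, normalise apex tags
  have hS := M.shiftP_by (M.permP _ hY2 (Equiv.swap g b)) (-t)
  set X₀ : ACell := Function.update X g ((X g).1 + 1, (X g).2) with hX₀
  have hq : vP (Function.update X₀ b ((X b).1, (X g).2 - t)) := by
    refine M.congrP hS (fun i => ?_)
    by_cases hig : i = g
    · subst hig
      left
      rw [Function.update_of_ne hgb, hX₀, Function.update_self, Equiv.swap_apply_left, Function.update_self, hc]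
      refine Prod.ext rfl ?_
      show (X b).2 + -t = (X i).2
      rw [hk']; abel
    · by_cases hib : i = b
      · subst hib
        left
        rw [Function.update_self, Equiv.swap_apply_right, Function.update_of_ne hgb]
        refine Prod.ext hc.symm ?_
        show (X g).2 + -t = (X g).2 - t
        abel
      · right
        simp only [Equiv.swap_apply_of_ne_of_ne hig hib, Function.update_of_ne hib, Function.update_of_ne hig, hX₀]
        exact ⟨hapex i hig hib, hapex i hig hib⟩
  have hp : vP (Function.update X₀ b ((X b).1, (X g).2 + t)) := by
    have : ((X b).1, (X g).2 + t) = X₀ b := by rw [hX₀, Function.update_of_ne hgb.symm, ← hk']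
    rw [this, Function.update_eq_self]; exact hY1
  have e0g : X₀ g = ((X g).1 + 1, (X g).2) := by rw [hX₀, Function.update_self]
  have e0f : (X₀ f).1 = 0 := by rw [hX₀, Function.update_of_ne hfg]; exact hapex f hfg hfb
  have key := M.tag_unique (X := X₀) (g := g) (b := b) (f := f) hgb hfb (by rw [e0g]; omega)
    (by rw [e0g]; push_cast; linarith) e0f hb hb hp hq
  -- key : (X g).2 + t = (X g).2 - t
  have htt : t + t = 0 := by
    have := congrArg (fun x => x - (X g).2 + t) key
    simp at this
    exact this
  rcases fin4_two_mul_eq_zero t htt with h0 | h2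
  · left; rw [hk', h0, add_zero]
  · right; rw [hk', h2]

end LineModel

/-- design form of `p_top_pair_parity`: two sub-ceiling line letters of one charge `c` (`2(c+2) > h`) in a RULE-D `P`-cell of a
`G₁`-closed RULE-D∕`X+` LINE design, the other two slots at the apex, have tags of the same parity. -/
theorem top_pair_parity_P {h : ℤ} {C : MConfig} (hC : LSupport h C) (hG : C.G1Closed) (hD : RuleDMu4Closed C) (hX : XPlusClosed C)
    {P : MCell} (hP : P ∈ C.upper) {g b : Fin 4} (hgb : g ≠ b) {c : ℕ} {k k' : Fin 4} (hc : 1 ≤ c) (hrig : h < 2 * (c : ℤ) + 4)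
    (eg : P g = lineLetter h c k) (eb : P b = lineLetter h c k') (hapex : ∀ i, i ≠ g → i ≠ b → P i = (h, 0, 0)) :
    k' = k ∨ k' = k + 2 := by
  have hM := lineModel_of_config hC hG hD hX
  obtain ⟨X, rfl⟩ := exists_realize (fun f => hC.2 _ hP f)
  rw [realize_apply] at eg eb
  have hcg := charge_eq_of_lineLetter_eq eg
  have hcb := charge_eq_of_lineLetter_eq eb
  obtain ⟨-, rfl⟩ := lineLetter_inj (by rw [hcg]; exact hc) eg
  obtain ⟨-, rfl⟩ := lineLetter_inj (by rw [hcb]; exact hc) eb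
  have hap : ∀ i, i ≠ g → i ≠ b → (X i).1 = 0 := by
    intro i hig hib
    have e := congrArg Prod.fst (hapex i hig hib)
    rw [realize_apply, lineLetter_fst] at e
    simp at e
    exact e
  exact hM.p_top_pair_parity hP hgb (by rw [hcb, hcg]) (by rw [hcg]; exact hc) (by rw [hcg]; exact hrig) hap

/-! ## Part I — NO ODD FC BELOW TEN (PROVED h-uniformly) and the UNIT NUCLEUS that is left at `h = 10`

Corollaries of the three-equal-tags laws of Part G.  On `N`: for `h < 12` EVERY letter of a fully charged `N`-cell has `2(c+5) > h`,
so all four tags coincide (`fcN_tags_const`) and the cell is not odd — **no odd FC `N`-cell below twelve** (`no_oddN_below_twelve`).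
On `P`: for `h < 10` a fully charged `P`-cell is a unit cell (`fcP_gap_three`), RD-P lands on the apex, and `n3_tags` (`2(1+4) > h`)
makes every three of its tags equal — **no odd FC `P`-cell below ten**; hence `AbstractOddFree h` and **`OddFCFreeLine h` for every
`h < 10` (`oddFCFreeLine_of_lt_ten`)**: the `(OL₈)`∕`(OL₉)` rows of the census are now KERNEL theorems, uniformly in `h`.  For
`h < 12` an odd FC `P`-cell is either a UNIT cell or has exactly one charge-2 letter with the other three (unit) letters equally tagged
(`oddP_shape_below_twelve`); so the one remaining machine fact `AbstractOddFree 10` is equivalent to the absence of this UNIT NUCLEUS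
(`AbstractOddUnitNucleusFree 10`, `oddLineThresholdLaw_of_unitNucleus`). -/

namespace LineModel

variable {h : ℤ} {vN vP : ACell → Prop}

/-- below twelve all four tags of a fully charged `N`-cell coincide. -/
theorem fcN_tags_const (M : LineModel h vN vP) {X : ACell} (hX : vN X) (hc : ∀ f, 1 ≤ (X f).1) (hh : h < 12) (a b : Fin 4) :
    (X a).2 = (X b).2 := by
  by_cases hab : a = b
  · rw [hab]
  obtain ⟨g, hga, hgb⟩ := exists_third a b
  have := hc g
  exact M.fcN_three_tags hX hc hga hgb hab (by omega)

/-- **no odd fully charged `N`-cell below twelve** (PROVED, h-uniform). -/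
theorem no_oddN_below_twelve (M : LineModel h vN vP) (hh : h < 12) {X : ACell} (hodd : AOddFC X) : ¬ vN X := by
  intro hX
  obtain ⟨hc, hpar⟩ := hodd
  have e1 := M.fcN_tags_const hX hc hh 1 0
  have e2 := M.fcN_tags_const hX hc hh 2 0
  have e3 := M.fcN_tags_const hX hc hh 3 0
  rw [e1, e2, e3] at hpar
  omega

/-- below ten a fully charged `P`-cell is a unit cell. -/
theorem fcP_unit_below_ten (M : LineModel h vN vP) (hh : h < 10) {X : ACell} (hX : vP X) (hc : ∀ f, 1 ≤ (X f).1) (f : Fin 4) :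
    (X f).1 = 1 := by
  have := M.fcP_gap_three hX hc f
  have := hc f
  omega

/-- below ten all four tags of a fully charged `P`-cell coincide. -/
theorem fcP_tags_const_below_ten (M : LineModel h vN vP) (hh : h < 10) {X : ACell} (hX : vP X) (hc : ∀ f, 1 ≤ (X f).1)
    (a b : Fin 4) : (X a).2 = (X b).2 := by
  by_cases hab : a = b
  · rw [hab]
  obtain ⟨g, hga, hgb⟩ := exists_third a b
  obtain ⟨f, hgf, haf, hbf⟩ := fin4_fourth hga hgb hab
  obtain ⟨c', hc', hN⟩ := M.rdP X hX f (hc f)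
  have hc0 : c' = 0 := by have := M.fcP_unit_below_ten hh hX hc f; omega
  subst hc0
  have eg : Function.update X f ((0 : ℕ), (X f).2) g = X g := Function.update_of_ne hgf _ _
  have ea : Function.update X f ((0 : ℕ), (X f).2) a = X a := Function.update_of_ne haf _ _
  have eb : Function.update X f ((0 : ℕ), (X f).2) b = X b := Function.update_of_ne hbf _ _
  have hg1 := hc g
  have key := M.n3_tags hga hgb hgf hab haf hbf hN (by rw [eg]; exact hc g) (by rw [eg]; omega) (by rw [ea]; exact hc a)
    (by rw [eb]; exact hc b) (by rw [Function.update_self])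
  rwa [ea, eb] at key

/-- **no odd fully charged `P`-cell below ten** (PROVED, h-uniform). -/
theorem no_oddP_below_ten (M : LineModel h vN vP) (hh : h < 10) {X : ACell} (hodd : AOddFC X) : ¬ vP X := by
  intro hX
  obtain ⟨hc, hpar⟩ := hodd
  have e1 := M.fcP_tags_const_below_ten hh hX hc 1 0
  have e2 := M.fcP_tags_const_below_ten hh hX hc 2 0
  have e3 := M.fcP_tags_const_below_ten hh hX hc 3 0
  rw [e1, e2, e3] at hpar
  omega

/-- below twelve the letters of a fully charged `P`-cell have charge `≤ 2` … -/
theorem fcP_charge_le_two (M : LineModel h vN vP) (hh : h < 12) {X : ACell} (hX : vP X) (hc : ∀ f, 1 ≤ (X f).1) (f : Fin 4) :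
    (X f).1 ≤ 2 := by
  have := M.fcP_gap_three hX hc f
  omega

/-- … and the tags away from a charge-2 letter coincide. -/
theorem fcP_tags_around_two (M : LineModel h vN vP) (hh : h < 12) {X : ACell} (hX : vP X) (hc : ∀ f, 1 ≤ (X f).1) {g : Fin 4}
    (hg : 2 ≤ (X g).1) {a b : Fin 4} (hga : g ≠ a) (hgb : g ≠ b) : (X a).2 = (X b).2 := by
  by_cases hab : a = b
  · rw [hab]
  exact M.fcP_three_tags hX hc hga hgb hab (by omega)

/-- **THE SHAPE OF AN ODD FC `P`-CELL BELOW TWELVE** (PROVED): a unit cell, or exactly one charge-2 letter next to three equally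
tagged unit letters. -/
theorem oddP_shape_below_twelve (M : LineModel h vN vP) (hh : h < 12) {X : ACell} (hodd : AOddFC X) (hX : vP X) :
    (∀ f, (X f).1 = 1) ∨
      (∃ g, (X g).1 = 2 ∧ (∀ i, i ≠ g → (X i).1 = 1) ∧ (∀ i j, i ≠ g → j ≠ g → (X i).2 = (X j).2)) := by
  obtain ⟨hc, hpar⟩ := hodd
  by_cases hall : ∀ f, (X f).1 = 1
  · exact Or.inl hall
  right
  push Not at hall
  obtain ⟨g, hg⟩ := hall
  have hg2 : (X g).1 = 2 := by
    have := M.fcP_charge_le_two hh hX hc g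
    have := hc g
    omega
  refine ⟨g, hg2, fun i hig => ?_, fun i j hig hjg => M.fcP_tags_around_two hh hX hc (le_of_eq hg2.symm) (Ne.symm hig) (Ne.symm hjg)⟩
  by_contra hne
  have hi2 : 2 ≤ (X i).1 := by
    have := hc i
    omega
  have tg : ∀ a b, g ≠ a → g ≠ b → (X a).2 = (X b).2 := fun a b ha hb => M.fcP_tags_around_two hh hX hc (le_of_eq hg2.symm) ha hb
  have ti : ∀ a b, i ≠ a → i ≠ b → (X a).2 = (X b).2 := fun a b ha hb => M.fcP_tags_around_two hh hX hc hi2 ha hb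
  have allg : ∀ a, (X a).2 = (X g).2 := by
    intro a
    by_cases hai : a = i
    · rw [hai]
      obtain ⟨b, hbg, hbi⟩ := exists_third g i
      rw [tg i b (Ne.symm hig) hbg.symm]
      exact ti b g hbi.symm hig
    · exact ti a g (fun e => hai e.symm) hig
  rw [allg 0, allg 1, allg 2, allg 3] at hpar
  omega

end LineModel

/-- **NO ODD FC BELOW TEN, abstractly** (PROVED, h-uniform). -/
theorem abstractOddFree_of_lt_ten {h : ℤ} (hh : h < 10) : AbstractOddFree h :=
  fun _ _ M _ hodd => ⟨M.no_oddN_below_twelve (by omega) hodd, M.no_oddP_below_ten hh hodd⟩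

/-- **`(OL_h)` FOR EVERY `h < 10` (PROVED, sorry-free, uniformly in `h`)**: no `G₁`-closed RULE-D∕`X+` design supported on two adjacent
LINE alphabets of height `< 10` has an odd fully charged cell.  This puts the `(OL₈)`, `(OL₉)` rows of the census (formerly MACHINE:
`oddline.py 8 G1` UNSAT, LRAT-checked) into the kernel; `h = 10, 11` follow in Part J (`oddFCFreeLine_of_lt_twelve`). -/
theorem oddFCFreeLine_of_lt_ten {h : ℤ} (hh : h < 10) : OddFCFreeLine h :=
  oddFCFreeLine_of_abstract (abstractOddFree_of_lt_ten hh)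

/-- **no odd fully charged `N`-cell below twelve**, design form (PROVED). -/
theorem no_odd_fcN_below_twelve {h : ℤ} (hh : h < 12) {C : MConfig} (hC : LSupport h C) (hG : C.G1Closed) (hD : RuleDMu4Closed C)
    (hX : XPlusClosed C) {Z : MCell} (hZ : Z ∈ C.lower) (hFC : FCc Z) : ¬ OddPat Z.pat := by
  have hM := lineModel_of_config hC hG hD hX
  obtain ⟨X, rfl⟩ := exists_realize (fun f => hC.1 _ hZ f)
  intro hodd
  exact hM.no_oddN_below_twelve hh (aOddFC_of_realize hFC hodd) hZ

/-- **THE UNIT NUCLEUS**: no abstract LINE model at height `h` makes present an odd FC `P`-cell which is a unit cell or has exactly one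
charge-2 letter next to three equally tagged unit letters.  At `h = 10` this is ALL that is left of the odd-freeness check
(`abstractOddFree_of_unitNucleus`); PROVED for every `h < 12` in Part J (`abstractOddUnitNucleusFree_of_lt_twelve`); fails at `h = 12`. -/
def AbstractOddUnitNucleusFree (h : ℤ) : Prop :=
  ∀ vN vP : ACell → Prop, LineModel h vN vP → ∀ X : ACell, AOddFC X →
    ((∀ f, (X f).1 = 1) ∨
      (∃ g, (X g).1 = 2 ∧ (∀ i, i ≠ g → (X i).1 = 1) ∧ (∀ i j, i ≠ g → j ≠ g → (X i).2 = (X j).2))) → ¬ vP X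

/-- below twelve, odd-freeness ⇐ unit-nucleus-freeness (PROVED). -/
theorem abstractOddFree_of_unitNucleus {h : ℤ} (hh : h < 12) (hU : AbstractOddUnitNucleusFree h) : AbstractOddFree h :=
  fun vN vP M X hodd => ⟨M.no_oddN_below_twelve hh hodd, fun hX => hU vN vP M X hodd (M.oddP_shape_below_twelve hh hodd hX) hX⟩

/-- **`OddLineThresholdLaw ⇐` the unit nucleus at ten** (PROVED reduction; the hypothesis is discharged in Part J: `oddLineThresholdLaw_holds`). -/
theorem oddLineThresholdLaw_of_unitNucleus (hU : AbstractOddUnitNucleusFree 10) : OddLineThresholdLaw :=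
  oddLineThresholdLaw_of_abstract (abstractOddFree_of_unitNucleus (by norm_num) hU)


/-! ## Part J — THE UNIT NUCLEUS BELOW TWELVE (PROVED): `AbstractOddFree h` for every `h < 12`, hence `OddLineThresholdLaw` in the kernel

Part I left, below twelve, only the unit nucleus on the `P` level: odd unit cells and the `(2;1,1,1)` cells.  Up to the slot and tag
symmetries of the model these are three families — `P[1_k,1_k,1_k,1_{k+t}]` (`t` odd), `P[1_k,1_m,1_{k+2},1_*]` (`m ∉ {k,k+2}`) and
`P[1_k,1_k,1_k,2_{k+t}]` (`t ≠ 0`) — and each is refuted below by an explicit chain of RD-P ∕ RD-N2 ∕ `X+` steps whose every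
alternative landing is dead by the PROVED laws of Parts E–I (`p3_gap_two`, `p_ceiling_absent`, `p3_tags`, `n3_tags`, `fcN_tags_const`)
— the chains were read off the unit-propagation refutation of the kernel-augmented clause set at `h = 10` (`kern10.py`, `upchain.py`:
all six nucleus orbits are UNSAT at conflict limit 0 once the proved laws are added as clauses) and then proved uniformly for `h < 12`.
Consequently `(OL_h)` holds for EVERY `h < 12` in the kernel and the typed threshold law `OddLineThresholdLaw` is a theorem outright. -/

theorem one_le_of_eq_one {n : ℕ} (e : n = 1) : 1 ≤ n := by omega
theorem one_le_of_eq_two {n : ℕ} (e : n = 2) : 1 ≤ n := by omega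
theorem fin4_add_two_two : ∀ k : Fin 4, k + 2 + 2 = k := by decide
theorem fin4_add_two_ne : ∀ k : Fin 4, k + 2 ≠ k := by decide
theorem fin4_add_ne_of_ne_zero : ∀ k t : Fin 4, t ≠ 0 → k + t ≠ k := by decide
theorem fin4_add_neg_ne_of_ne_zero : ∀ k t : Fin 4, t ≠ 0 → k + -t ≠ k := by decide
theorem fin4_add_neg_ne_add : ∀ k t : Fin 4, t + t ≠ 0 → k + -t ≠ k + t := by decide
theorem fin4_add_add_neg : ∀ k t : Fin 4, k + t + -t = k := by decide

namespace LineModel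

variable {h : ℤ} {vN vP : ACell → Prop}

/-- the tag shift by any amount on the `N` level. -/
theorem shiftN_by (M : LineModel h vN vP) {X : ACell} (hX : vN X) (s : Fin 4) : vN (fun i => ((X i).1, (X i).2 + s)) := by
  have h1 := M.shiftN _ hX
  have h2 := M.shiftN _ h1
  have h3 := M.shiftN _ h2
  have h4 := M.shiftN _ h3
  have e1 : X.shift = fun i => ((X i).1, (X i).2 + 3) := rfl
  have e2 : X.shift.shift = fun i => ((X i).1, (X i).2 + 2) := by
    funext i; simp only [ACell.shift]; refine Prod.ext rfl ?_; show (X i).2 + 3 + 3 = (X i).2 + 2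
    have : ∀ k : Fin 4, k + 3 + 3 = k + 2 := by decide
    exact this _
  have e3 : X.shift.shift.shift = fun i => ((X i).1, (X i).2 + 1) := by
    funext i; simp only [ACell.shift]; refine Prod.ext rfl ?_; show (X i).2 + 3 + 3 + 3 = (X i).2 + 1
    have : ∀ k : Fin 4, k + 3 + 3 + 3 = k + 1 := by decide
    exact this _
  have e4 : X.shift.shift.shift.shift = fun i => ((X i).1, (X i).2 + 0) := by
    funext i; simp only [ACell.shift]; refine Prod.ext rfl ?_; show (X i).2 + 3 + 3 + 3 + 3 = (X i).2 + 0
    have : ∀ k : Fin 4, k + 3 + 3 + 3 + 3 = k + 0 := by decide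
    exact this _
  fin_cases s
  · rw [e4] at h4; exact h4
  · rw [e3] at h3; exact h3
  · rw [e2] at h2; exact h2
  · rw [e1] at h1; exact h1

/-- the hub of a unit letter: lowering a unit letter (RD-P) lands on the apex, so `X[s ≔ apex]` is present on the `N` level. -/
theorem unit_hub (M : LineModel h vN vP) {X : ACell} (hX : vP X) {s : Fin 4} (hs : (X s).1 = 1) (k : Fin 4) :
    vN (Function.update X s (0, k)) := by
  obtain ⟨c', hc', hN⟩ := M.rdP X hX s (by rw [hs])
  rw [hs] at hc'
  have h0 : c' = 0 := by omega
  subst h0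
  have := M.apexN _ hN s k (by rw [Function.update_self])
  rwa [Function.update_idem] at this

/-- **UNIT SIBLING EXCLUSION (abstract form of Part B, PROVED)**: a `P`-cell with an apex and a unit letter `(1,k)` at `s` excludes every
unit sibling `X[s ≔ (1,k'')]`, `k'' ≠ k` (`X+` with the unit hub; no shallower letter, no companion). -/
theorem unit_sibling (M : LineModel h vN vP) {X : ACell} (hX : vP X) {s f : Fin 4} (hfs : f ≠ s) (hf : (X f).1 = 0)
    (hs : (X s).1 = 1) {k'' : Fin 4} (hk : k'' ≠ (X s).2) : ¬ vP (Function.update X s (1, k'')) := by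
  intro hS
  exact M.xplus X hX s f hfs (by rw [hs]) hf (M.unit_hub hX hs 0)
    (fun c' h1 h2 => absurd h2 (by rw [hs]; omega)) 1 k'' hk le_rfl hS (fun e' h1 h2 => absurd h2 (by omega))

/-- **CHARGE-2 SIBLING EXCLUSION (PROVED)**: a `P`-cell with an apex and a charge-2 letter `(2,k)` at `s` whose unit shadow `X[s ≔ (1,k)]`
is absent on `N` excludes every unit sibling `X[s ≔ (1,k'')]`, `k'' ≠ k` (the hub is then the RD-P landing; `X+`). -/
theorem two_sibling (M : LineModel h vN vP) {X : ACell} (hX : vP X) {s f : Fin 4} (hfs : f ≠ s) (hf : (X f).1 = 0)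
    (hs : (X s).1 = 2) (hsh : ¬ vN (Function.update X s (1, (X s).2))) {k'' : Fin 4} (hk : k'' ≠ (X s).2) :
    ¬ vP (Function.update X s (1, k'')) := by
  intro hS
  obtain ⟨c', hc', hN⟩ := M.rdP X hX s (by rw [hs]; omega)
  rw [hs] at hc'
  have h0 : c' = 0 := by
    rcases (by omega : c' = 0 ∨ c' = 1) with h0 | h1
    · exact h0
    · exact absurd (h1 ▸ hN) hsh
  subst h0
  have hub := M.apexN _ hN s 0 (by rw [Function.update_self])
  rw [Function.update_idem] at hub
  exact M.xplus X hX s f hfs (by rw [hs]; omega) hf hub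
    (fun c' h1 h2 => by
      have : c' = 1 := by rw [hs] at h2; omega
      subst this; exact hsh) 1 k'' hk le_rfl hS (fun e' h1 h2 => absurd h2 (by omega))

/-- RD-N2 on a `3`-charged `N`-cell below twelve: the raised letter lands at charge `≤ 3` (`p3_gap_two`), and at charge `3` only if the two
other charged tags are equal (`p3_tags`). -/
theorem raise3 (M : LineModel h vN vP) (hh : h < 12) {Y : ACell} (hY : vN Y) {g a b f : Fin 4} (hga : g ≠ a) (hgb : g ≠ b)
    (hgf : g ≠ f) (hab : a ≠ b) (haf : a ≠ f) (hbf : b ≠ f) (hg : 1 ≤ (Y g).1) (ha : 1 ≤ (Y a).1) (hb : 1 ≤ (Y b).1)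
    (hf : (Y f).1 = 0) :
    ∃ c' : ℕ, (Y g).1 < c' ∧ c' ≤ 3 ∧ vP (Function.update Y g (c', (Y g).2)) ∧ (c' = 3 → (Y a).2 = (Y b).2) := by
  obtain ⟨c', hlt, -, hP⟩ := M.rdN2 Y hY g a hga hg ha
  have ha' : 1 ≤ (Function.update Y g (c', (Y g).2) a).1 := by rw [Function.update_of_ne hga.symm]; exact ha
  have hb' : 1 ≤ (Function.update Y g (c', (Y g).2) b).1 := by rw [Function.update_of_ne hgb.symm]; exact hb
  have hf' : (Function.update Y g (c', (Y g).2) f).1 = 0 := by rw [Function.update_of_ne hgf.symm]; exact hf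
  have hgc : (Function.update Y g (c', (Y g).2) g).1 = c' := by rw [Function.update_self]
  have hg' : 1 ≤ (Function.update Y g (c', (Y g).2) g).1 := by rw [hgc]; omega
  have gap := M.p3_gap_two hP hga hgb hab hg' ha' hb'
  rw [hgc] at gap
  refine ⟨c', hlt, by omega, hP, fun h3 => ?_⟩
  have := M.p3_tags hga hgb hgf hab haf hbf hP hg' (by rw [hgc]; omega) ha' hb' hf'
  rwa [Function.update_of_ne hga.symm, Function.update_of_ne hgb.symm] at this

/-- RD-N2 on an `N`-cell with a second charged letter, below twelve: the raised letter lands at charge `≤ 4` (`p_ceiling_absent`). -/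
theorem raise2 (M : LineModel h vN vP) (hh : h < 12) {Y : ACell} (hY : vN Y) {g b : Fin 4} (hgb : g ≠ b)
    (hg : 1 ≤ (Y g).1) (hb : 1 ≤ (Y b).1) :
    ∃ c' : ℕ, (Y g).1 < c' ∧ c' ≤ 4 ∧ vP (Function.update Y g (c', (Y g).2)) := by
  obtain ⟨c', hlt, -, hP⟩ := M.rdN2 Y hY g b hgb hg hb
  refine ⟨c', hlt, ?_, hP⟩
  by_contra hc
  have hgc : (Function.update Y g (c', (Y g).2) g).1 = c' := by rw [Function.update_self]
  exact M.p_ceiling_absent hP hgb (by rw [hgc]; omega) (by rw [Function.update_of_ne hgb.symm]; exact hb) (by rw [hgc]; omega)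

/-- **THREE UNIT TAGS WITH AN ANTIPODAL PAIR ARE ABSENT ON `N` below twelve (PROVED).** `N[1_k, 1_m, 1_{k+2}, apex]` with
`m ∉ {k, k+2}`: both antipodal letters are raised to charge exactly `2` (charge `3` is `p3_tags`-dead since the two remaining tags differ);
the second raised cell, slots swapped and tags shifted by `2`, is the unit sibling `m+2 ≠ m` of the first — excluded by `unit_sibling`. -/
theorem n_three_units_antipodal (M : LineModel h vN vP) (hh : h < 12) {Y : ACell} (hY : vN Y) {a b c f : Fin 4}
    (hab : a ≠ b) (hac : a ≠ c) (haf : a ≠ f) (hbc : b ≠ c) (hbf : b ≠ f) (hcf : c ≠ f) {k m : Fin 4}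
    (ha : Y a = (1, k)) (hb : Y b = (1, m)) (hc : Y c = (1, k + 2)) (hf : (Y f).1 = 0) (hmk : m ≠ k) (hmk2 : m ≠ k + 2) :
    False := by
  have ha1 : (Y a).1 = 1 := by rw [ha]
  have hb1 : (Y b).1 = 1 := by rw [hb]
  have hc1 : (Y c).1 = 1 := by rw [hc]
  -- raise `a` to exactly `2`
  obtain ⟨c₁, h1lt, h1le, hV0, h1t⟩ := M.raise3 hh hY hab hac haf hbc hbf hcf (one_le_of_eq_one ha1) (one_le_of_eq_one hb1)
    (one_le_of_eq_one hc1) hf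
  rw [ha1] at h1lt
  have hc₁ : c₁ = 2 := by
    rcases (by omega : c₁ = 2 ∨ c₁ = 3) with e | e
    · exact e
    · exfalso; have := h1t e; rw [hb, hc] at this; exact hmk2 this
  subst hc₁
  rw [show (Y a).2 = k by rw [ha]] at hV0
  -- raise `c` to exactly `2`
  obtain ⟨c₂, h2lt, h2le, hV2, h2t⟩ := M.raise3 hh hY hac.symm hbc.symm hcf hab haf hbf (one_le_of_eq_one hc1)
    (one_le_of_eq_one ha1) (one_le_of_eq_one hb1) hf
  rw [hc1] at h2lt
  have hc₂ : c₂ = 2 := by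
    rcases (by omega : c₂ = 2 ∨ c₂ = 3) with e | e
    · exact e
    · exfalso; have := h2t e; rw [ha, hb] at this; exact hmk this.symm
  subst hc₂
  rw [show (Y c).2 = k + 2 by rw [hc]] at hV2
  -- the second raised cell, swapped `a ↔ c` and shifted by `2`, is the `b`-sibling `(1, m+2)` of the first
  have hS := M.shiftP_by (M.permP _ hV2 (Equiv.swap a c)) 2
  have hT : vP (Function.update (Function.update Y a (2, k)) b (1, m + 2)) := by
    refine M.congrP hS (fun i => ?_)
    dsimp only
    rcases fin4_cover hab hac haf hbc hbf hcf i with hi | hi | hi | hi <;> rw [hi]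
    · left
      rw [Equiv.swap_apply_left, Function.update_self, Function.update_of_ne hab, Function.update_self]
      exact Prod.ext rfl (fin4_add_two_two k)
    · left
      rw [Equiv.swap_apply_of_ne_of_ne hab.symm hbc, Function.update_of_ne hbc, hb, Function.update_self]
    · left
      rw [Equiv.swap_apply_right, Function.update_of_ne hac, ha, Function.update_of_ne hbc.symm,
        Function.update_of_ne hac.symm, hc]
    · right
      rw [Equiv.swap_apply_of_ne_of_ne haf.symm hcf.symm, Function.update_of_ne hcf.symm, Function.update_of_ne hbf.symm,
        Function.update_of_ne haf.symm]
      exact ⟨hf, hf⟩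
  refine M.unit_sibling hV0 (s := b) (f := f) hbf.symm ?_ ?_ ?_ hT
  · rw [Function.update_of_ne haf.symm]; exact hf
  · rw [Function.update_of_ne hab.symm, hb]
  · rw [Function.update_of_ne hab.symm, hb]; exact fin4_add_two_ne m

/-- **THE ANTIPODAL-TYPE UNIT CELLS ARE ABSENT below twelve (PROVED)**: `P[1_k, 1_m, 1_{k+2}, 1_*]`, `m ∉ {k, k+2}` (lower the fourth
letter; `n_three_units_antipodal`).  Covers the odd unit types `0012`, `0023` (and the even `0123`, `0112`). -/
theorem unitP_antipodal_absent (M : LineModel h vN vP) (hh : h < 12) {X : ACell} (hX : vP X) {a b c d : Fin 4}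
    (hab : a ≠ b) (hac : a ≠ c) (had : a ≠ d) (hbc : b ≠ c) (hbd : b ≠ d) (hcd : c ≠ d)
    (ha1 : (X a).1 = 1) (hb1 : (X b).1 = 1) (hc1 : (X c).1 = 1) (hd1 : (X d).1 = 1)
    (hc2 : (X c).2 = (X a).2 + 2) (hb2 : (X b).2 ≠ (X a).2) (hb2' : (X b).2 ≠ (X a).2 + 2) : False := by
  have hN := M.unit_hub hX hd1 0
  exact M.n_three_units_antipodal hh hN hab hac had hbc hbd hcd (k := (X a).2) (m := (X b).2)
    (by rw [Function.update_of_ne had]; exact Prod.ext ha1 rfl) (by rw [Function.update_of_ne hbd]; exact Prod.ext hb1 rfl)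
    (by rw [Function.update_of_ne hcd]; exact Prod.ext hc1 hc2) (by rw [Function.update_self]) hb2 hb2'

/-- **TOP-THREE PACKAGE, step 1 (PROVED)**: from `W = P[3_k@g, unit@b, 1_k@c, *]`: `N30 = W[b ≔ apex]` is present (unit hub), its
RD-N2 raise of `g` is `Y = N30[g ≔ (4,k)]` (charge `5` is `p_ceiling_absent`-dead), and the unit siblings `Y[c ≔ (1,j)]`, `j ≠ k`, are
excluded. -/
theorem top3_sibling4 (M : LineModel h vN vP) (hh : h < 12) {W : ACell} (hW : vP W) {g b c : Fin 4} (hgb : g ≠ b) (hgc : g ≠ c)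
    (hbc : b ≠ c) {k : Fin 4} (hg : W g = (3, k)) (hb1 : (W b).1 = 1) (hc : W c = (1, k)) {j : Fin 4} (hj : j ≠ k) :
    ¬ vP (Function.update (Function.update (Function.update W b (0, 0)) g (4, k)) c (1, j)) := by
  have hN30 := M.unit_hub hW hb1 0
  have e_g : Function.update W b (0, 0) g = (3, k) := by rw [Function.update_of_ne hgb, hg]
  have e_c : Function.update W b (0, 0) c = (1, k) := by rw [Function.update_of_ne hbc.symm, hc]
  obtain ⟨c₁, h1lt, h1le, hY⟩ := M.raise2 hh hN30 (g := g) (b := c) hgc (by rw [e_g]; omega) (one_le_of_eq_one (by rw [e_c]))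
  rw [show (Function.update W b (0, 0) g).1 = 3 by rw [e_g]] at h1lt
  have hc₁ : c₁ = 4 := by omega
  subst hc₁
  rw [show (Function.update W b (0, 0) g).2 = k by rw [e_g]] at hY
  refine M.unit_sibling hY (s := c) (f := b) hbc ?_ ?_ ?_
  · rw [Function.update_of_ne hgb.symm, Function.update_self]
  · rw [Function.update_of_ne hgc.symm, e_c]
  · rw [Function.update_of_ne hgc.symm, e_c]; exact hj

/-- **TOP-THREE PACKAGE, step 2 (PROVED)**: with `W` as above, `N[3_k@g, apex@b, 1_j@c, *]` (`j ≠ k`) is absent — its RD-N2 raise of `g`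
would be an excluded sibling of step 1 (charge `5` being dead). -/
theorem top3_N3 (M : LineModel h vN vP) (hh : h < 12) {W : ACell} (hW : vP W) {g b c : Fin 4} (hgb : g ≠ b) (hgc : g ≠ c)
    (hbc : b ≠ c) {k : Fin 4} (hg : W g = (3, k)) (hb1 : (W b).1 = 1) (hc : W c = (1, k)) {j : Fin 4} (hj : j ≠ k) :
    ¬ vN (Function.update (Function.update W b (0, 0)) c (1, j)) := by
  intro hN
  have e_g : Function.update (Function.update W b (0, 0)) c (1, j) g = (3, k) := by
    rw [Function.update_of_ne hgc, Function.update_of_ne hgb, hg]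
  obtain ⟨c₂, h2lt, h2le, hP⟩ := M.raise2 hh hN (g := g) (b := c) hgc (by rw [e_g]; omega)
    (one_le_of_eq_one (by rw [Function.update_self]))
  rw [show (Function.update (Function.update W b (0, 0)) c (1, j) g).1 = 3 by rw [e_g]] at h2lt
  have hc₂ : c₂ = 4 := by omega
  subst hc₂
  rw [show (Function.update (Function.update W b (0, 0)) c (1, j) g).2 = k by rw [e_g], Function.update_comm hgc.symm] at hP
  exact M.top3_sibling4 hh hW hgb hgc hbc hg hb1 hc hj hP

/-- **TOP-THREE PACKAGE, step 3 (PROVED)**: with `W` as above, every `P[3_k@g, unit@b, 1_j@c, *]` with `j ≠ k` is absent — its RD-P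
service at the unit `b` would be the absent `N`-cell of step 2. -/
theorem top3_package (M : LineModel h vN vP) (hh : h < 12) {W : ACell} (hW : vP W) {g b c : Fin 4} (hgb : g ≠ b) (hgc : g ≠ c)
    (hbc : b ≠ c) {k : Fin 4} (hg : W g = (3, k)) (hb1 : (W b).1 = 1) (hc : W c = (1, k)) {j : Fin 4} (hj : j ≠ k) (m : Fin 4) :
    ¬ vP (Function.update (Function.update W c (1, j)) b (1, m)) := by
  intro hZ
  have hub := M.unit_hub hZ (s := b) (by rw [Function.update_self]) 0
  rw [Function.update_idem, Function.update_comm hbc.symm] at hub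
  exact M.top3_N3 hh hW hgb hgc hbc hg hb1 hc hj hub

/-- **THE `W`-STEP (PROVED)**: if `N000 = N[1_k@a,1_k@b,1_k@c, apex@d]` is present and the cell `P[apex@a, 2_k@b, 1_k@c, 1_k@d]` is absent,
then RD-N2 raises `a` to charge exactly `3`: `W = N000[a ≔ (3,k)]` is present (the charge-2 landing is that absent cell, slots permuted). -/
theorem w_of (M : LineModel h vN vP) (hh : h < 12) {N0 : ACell} (hN0 : vN N0) {a b c d : Fin 4} (hab : a ≠ b) (hac : a ≠ c)
    (had : a ≠ d) (hbc : b ≠ c) (hbd : b ≠ d) (hcd : c ≠ d) {k : Fin 4} (ha : N0 a = (1, k)) (hb : N0 b = (1, k))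
    (hc : N0 c = (1, k)) (hd : (N0 d).1 = 0) {V : ACell} (hVa : (V a).1 = 0) (hVb : V b = (2, k)) (hVc : V c = (1, k))
    (hVd : V d = (1, k)) (hV : ¬ vP V) : vP (Function.update N0 a (3, k)) := by
  have ha1 : (N0 a).1 = 1 := by rw [ha]
  obtain ⟨c₁, h1lt, h1le, hP, -⟩ := M.raise3 hh hN0 hab hac had hbc hbd hcd (one_le_of_eq_one ha1)
    (one_le_of_eq_one (by rw [hb])) (one_le_of_eq_one (by rw [hc])) hd
  rw [ha1] at h1lt
  rw [show (N0 a).2 = k by rw [ha]] at hP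
  rcases (by omega : c₁ = 2 ∨ c₁ = 3) with e | e
  · subst e
    exfalso
    apply hV
    have hS := M.permP _ (M.permP _ hP (Equiv.swap a b)) (Equiv.swap a d)
    refine M.congrP hS (fun i => ?_)
    rcases fin4_cover hab hac had hbc hbd hcd i with hi | hi | hi | hi <;> rw [hi]
    · right
      rw [Equiv.swap_apply_left, Equiv.swap_apply_of_ne_of_ne had.symm hbd.symm, Function.update_of_ne had.symm]
      exact ⟨hd, hVa⟩
    · left
      rw [Equiv.swap_apply_of_ne_of_ne hab.symm hbd, Equiv.swap_apply_right, Function.update_self, hVb]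
    · left
      rw [Equiv.swap_apply_of_ne_of_ne hac.symm hcd, Equiv.swap_apply_of_ne_of_ne hac.symm hbc.symm,
        Function.update_of_ne hac.symm, hc, hVc]
    · left
      rw [Equiv.swap_apply_right, Equiv.swap_apply_left, Function.update_of_ne hab.symm, hb, hVd]
  · subst e; exact hP

/-- **THE `Z`-STEP (PROVED)**: with `W = P[3_k@a,1_k@b,1_k@c,apex@d]` present, every `Z = P[apex@a,1_k@b,1_k@c,3_{k+t}@d]` with `t ≠ 0` is
absent: swapped `a ↔ d` and shifted by `−t` it is `P[3_k, 1_{k−t}, 1_{k−t}, apex]`, excluded by the top-three package (`k − t ≠ k`). -/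
theorem z_absent (M : LineModel h vN vP) (hh : h < 12) {W : ACell} (hW : vP W) {a b c d : Fin 4} (hab : a ≠ b) (hac : a ≠ c)
    (had : a ≠ d) (hbc : b ≠ c) (hbd : b ≠ d) (hcd : c ≠ d) {k : Fin 4} (hWa : W a = (3, k)) (hWb : W b = (1, k))
    (hWc : W c = (1, k)) (hWd : (W d).1 = 0) {t : Fin 4} (ht : t ≠ 0) {Z : ACell} (hZa : (Z a).1 = 0) (hZb : Z b = (1, k))
    (hZc : Z c = (1, k)) (hZd : Z d = (3, k + t)) : ¬ vP Z := by
  intro hZ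
  have hS := M.shiftP_by (M.permP _ hZ (Equiv.swap a d)) (-t)
  have hT : vP (Function.update (Function.update W c (1, k + -t)) b (1, k + -t)) := by
    refine M.congrP hS (fun i => ?_)
    dsimp only
    rcases fin4_cover hab hac had hbc hbd hcd i with hi | hi | hi | hi <;> rw [hi]
    · left
      rw [Equiv.swap_apply_left, hZd, Function.update_of_ne hab, Function.update_of_ne hac, hWa]
      exact Prod.ext rfl (fin4_add_add_neg k t)
    · left
      rw [Equiv.swap_apply_of_ne_of_ne hab.symm hbd, hZb, Function.update_self]
    · left
      rw [Equiv.swap_apply_of_ne_of_ne hac.symm hcd, hZc, Function.update_of_ne hbc.symm, Function.update_self]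
    · right
      rw [Equiv.swap_apply_right, Function.update_of_ne hbd.symm, Function.update_of_ne hcd.symm]
      exact ⟨hZa, hWd⟩
  exact M.top3_package hh hW (g := a) (b := b) (c := c) hab hac hbc hWa (by rw [hWb]) hWc
    (fin4_add_neg_ne_of_ne_zero k t ht) (k + -t) hT

/-- **THE `(2;1,1,1)` CELLS ARE ABSENT below twelve (PROVED)**: `P[1_k,1_k,1_k,2_{k'}]` with `k' ≠ k`.  Chain: the FC shadow
`N[1,1,1,1_{k'}]` is `fcN_tags_const`-dead, so RD-P at the `2`-letter lands on the apex (`N000`); RD-P at a unit gives `N'`; raising a unit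
of `N'` lands at charge `2` (`V'`); the unit shadow of `V'` at the `2_{k'}`-letter is `n3_tags`-dead, so `two_sibling` kills `V'[d ≔ 1_k]`,
whence `w_of` gives `W`; but raising the `2_{k'}`-letter of `N'` gives `Z`, which `z_absent` forbids. -/
theorem two_units3_absent (M : LineModel h vN vP) (hh : h < 12) {T : ACell} (hT : vP T) {a b c d : Fin 4} (hab : a ≠ b)
    (hac : a ≠ c) (had : a ≠ d) (hbc : b ≠ c) (hbd : b ≠ d) (hcd : c ≠ d) (ha1 : (T a).1 = 1) (hb1 : (T b).1 = 1)
    (hc1 : (T c).1 = 1) (hd2 : (T d).1 = 2) (hb2 : (T b).2 = (T a).2) (hc2 : (T c).2 = (T a).2) (hne : (T d).2 ≠ (T a).2) :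
    False := by
  set k : Fin 4 := (T a).2 with hk
  set t : Fin 4 := (T d).2 - k with htk
  have ht : t ≠ 0 := fun e => hne (sub_eq_zero.mp e)
  have hkt : k + t ≠ k := fin4_add_ne_of_ne_zero k t ht
  have ha : T a = (1, k) := Prod.ext ha1 rfl
  have hb : T b = (1, k) := Prod.ext hb1 hb2
  have hc : T c = (1, k) := Prod.ext hc1 hc2
  have hd : T d = (2, k + t) := Prod.ext hd2 (by rw [htk]; abel)
  -- C1: the FC shadow is absent
  have C1 : ¬ vN (Function.update T d (1, k + t)) := by
    intro hN
    have := M.fcN_tags_const hN (fun f => ?_) hh d a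
    · rw [Function.update_self, Function.update_of_ne had, ha] at this
      exact hkt this
    · rcases fin4_cover hab hac had hbc hbd hcd f with hf | hf | hf | hf <;> rw [hf]
      · rw [Function.update_of_ne had, ha]
      · rw [Function.update_of_ne hbd, hb]
      · rw [Function.update_of_ne hcd, hc]
      · rw [Function.update_self]
  -- C2: `N000 = T[d ≔ apex]`
  obtain ⟨c₀, h0lt, hN000⟩ := M.rdP T hT d (one_le_of_eq_two hd2)
  rw [hd2] at h0lt
  rw [show (T d).2 = k + t by rw [hd]] at hN000
  have hc₀ : c₀ = 0 := by
    rcases (by omega : c₀ = 0 ∨ c₀ = 1) with e | e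
    · exact e
    · exfalso; subst e; exact C1 hN000
  subst hc₀
  -- C3: `N' = T[a ≔ apex]`
  have hN' := M.unit_hub hT ha1 k
  have e_b : Function.update T a (0, k) b = (1, k) := by rw [Function.update_of_ne hab.symm, hb]
  have e_c : Function.update T a (0, k) c = (1, k) := by rw [Function.update_of_ne hac.symm, hc]
  have e_d : Function.update T a (0, k) d = (2, k + t) := by rw [Function.update_of_ne had.symm, hd]
  have e_a : (Function.update T a (0, k) a).1 = 0 := by rw [Function.update_self]
  -- C4: raise `b` in `N'` to exactly `2`
  obtain ⟨c₁, h1lt, h1le, hV', h1t⟩ := M.raise3 hh hN' (g := b) (a := c) (b := d) (f := a) hbc hbd hab.symm hcd hac.symm had.symm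
    (one_le_of_eq_one (by rw [e_b])) (one_le_of_eq_one (by rw [e_c])) (one_le_of_eq_two (by rw [e_d])) e_a
  rw [show (Function.update T a (0, k) b).1 = 1 by rw [e_b]] at h1lt
  have hc₁ : c₁ = 2 := by
    rcases (by omega : c₁ = 2 ∨ c₁ = 3) with e | e
    · exact e
    · exfalso; have := h1t e; rw [e_c, e_d] at this; exact hkt this.symm
  subst hc₁
  rw [show (Function.update T a (0, k) b).2 = k by rw [e_b]] at hV'
  have eVa : (Function.update (Function.update T a (0, k)) b (2, k) a).1 = 0 := by
    rw [Function.update_of_ne hab, Function.update_self]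
  have eVb : Function.update (Function.update T a (0, k)) b (2, k) b = (2, k) := by rw [Function.update_self]
  have eVc : Function.update (Function.update T a (0, k)) b (2, k) c = (1, k) := by rw [Function.update_of_ne hbc.symm, e_c]
  have eVd : Function.update (Function.update T a (0, k)) b (2, k) d = (2, k + t) := by rw [Function.update_of_ne hbd.symm, e_d]
  -- C5: the unit shadow of `V'` at `d` is absent (`n3_tags` at the charge-2 letter `b`)
  have C5 : ¬ vN (Function.update (Function.update (Function.update T a (0, k)) b (2, k)) d
      (1, (Function.update (Function.update T a (0, k)) b (2, k) d).2)) := by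
    rw [eVd]
    intro hN
    have := M.n3_tags (g := b) (a := c) (b := d) (f := a) hbc hbd hab.symm hcd hac.symm had.symm hN
      (by rw [Function.update_of_ne hbd, eVb]; omega) (by rw [Function.update_of_ne hbd, eVb]; push_cast; omega)
      (one_le_of_eq_one (by rw [Function.update_of_ne hcd, eVc])) (one_le_of_eq_one (by rw [Function.update_self]))
      (by rw [Function.update_of_ne had, eVa])
    rw [Function.update_of_ne hcd, eVc, Function.update_self] at this
    exact hkt this.symm
  -- C7: `two_sibling` kills `V'[d ≔ (1,k)]`
  have C7 : ¬ vP (Function.update (Function.update (Function.update T a (0, k)) b (2, k)) d (1, k)) :=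
    M.two_sibling hV' (s := d) (f := a) had eVa (by rw [eVd]) C5 (by rw [eVd]; exact fun e => hkt e.symm)
  -- C8: `W`
  have hW := M.w_of hh hN000 hab hac had hbc hbd hcd (k := k)
    (by rw [Function.update_of_ne had, ha]) (by rw [Function.update_of_ne hbd, hb]) (by rw [Function.update_of_ne hcd, hc])
    (by rw [Function.update_self]) (V := Function.update (Function.update (Function.update T a (0, k)) b (2, k)) d (1, k))
    (by rw [Function.update_of_ne had, eVa]) (by rw [Function.update_of_ne hbd, eVb]) (by rw [Function.update_of_ne hcd, eVc])
    (by rw [Function.update_self]) C7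
  -- C9: raise `d` in `N'`: charge exactly `3` gives `Z`
  obtain ⟨c₂, h2lt, h2le, hZ, -⟩ := M.raise3 hh hN' (g := d) (a := b) (b := c) (f := a) hbd.symm hcd.symm had.symm hbc hab.symm
    hac.symm (one_le_of_eq_two (by rw [e_d])) (one_le_of_eq_one (by rw [e_b])) (one_le_of_eq_one (by rw [e_c])) e_a
  rw [show (Function.update T a (0, k) d).1 = 2 by rw [e_d]] at h2lt
  have hc₂ : c₂ = 3 := by omega
  subst hc₂
  rw [show (Function.update T a (0, k) d).2 = k + t by rw [e_d]] at hZ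
  -- C10
  exact M.z_absent hh hW hab hac had hbc hbd hcd (k := k) (t := t) (by rw [Function.update_self])
    (by rw [Function.update_of_ne hab.symm, Function.update_of_ne hbd, hb])
    (by rw [Function.update_of_ne hac.symm, Function.update_of_ne hcd, hc])
    (by rw [Function.update_of_ne had.symm, Function.update_self]) ht
    (by rw [Function.update_of_ne had, Function.update_self]) (by rw [Function.update_of_ne hbd, e_b])
    (by rw [Function.update_of_ne hcd, e_c]) (by rw [Function.update_self]) hZ

/-- **THE `000t` ODD UNIT CELLS ARE ABSENT below twelve (PROVED)**: `U = P[1_k,1_k,1_k,1_{k+t}]` with `t` odd (`t ≠ 0`, `2t ≠ 0`).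
Chain (15 rule steps): `N001 = U[a ≔ apex]`, `N000 = U[d ≔ apex]` (unit hubs); raising `b` in `N001` lands at charge `2` (`V`);
`unit_sibling` kills `V[d ≔ 1_k]`, so `w_of` gives `W = N000[a ≔ 3_k]` and `z_absent` kills `Z = N001[d ≔ 3_{k+t}]`; hence raising `d` in
`N001` lands at charge `2` (`Q`).  On the other side `N21 = V[c ≔ apex]` raises `b` to charge `3` (`R`; charge `4` is a `top3_sibling4`
sibling), `unit_sibling` on `R` kills `R[d ≔ 1_{k−t}]` (here `2t ≠ 0` is used), so `N21[d ≔ 1_{k−t}]` is absent (both its raises are dead) —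
but that cell is `Q[b ≔ apex]` swapped and shifted by `−t`, which RD-P at the unit `b` of `Q` makes present. -/
theorem units4_odd_absent (M : LineModel h vN vP) (hh : h < 12) {U : ACell} (hU : vP U) {a b c d : Fin 4} (hab : a ≠ b)
    (hac : a ≠ c) (had : a ≠ d) (hbc : b ≠ c) (hbd : b ≠ d) (hcd : c ≠ d) (ha1 : (U a).1 = 1) (hb1 : (U b).1 = 1)
    (hc1 : (U c).1 = 1) (hd1 : (U d).1 = 1) (hb2 : (U b).2 = (U a).2) (hc2 : (U c).2 = (U a).2) (hne : (U d).2 ≠ (U a).2)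
    (hodd : (U d).2 - (U a).2 + ((U d).2 - (U a).2) ≠ 0) : False := by
  set k : Fin 4 := (U a).2 with hk
  set t : Fin 4 := (U d).2 - k with htk
  have ht : t ≠ 0 := fun e => hne (sub_eq_zero.mp e)
  have hkt : k + t ≠ k := fin4_add_ne_of_ne_zero k t ht
  have hkmt : k + -t ≠ k + t := fin4_add_neg_ne_add k t hodd
  have hkm : k + -t ≠ k := fin4_add_neg_ne_of_ne_zero k t ht
  have ha : U a = (1, k) := Prod.ext ha1 rfl
  have hb : U b = (1, k) := Prod.ext hb1 hb2
  have hc : U c = (1, k) := Prod.ext hc1 hc2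
  have hd : U d = (1, k + t) := Prod.ext hd1 (by rw [htk]; abel)
  -- S1: the two unit hubs
  have hN001 := M.unit_hub hU ha1 k
  have hN000 := M.unit_hub hU hd1 0
  have e1b : Function.update U a (0, k) b = (1, k) := by rw [Function.update_of_ne hab.symm, hb]
  have e1c : Function.update U a (0, k) c = (1, k) := by rw [Function.update_of_ne hac.symm, hc]
  have e1d : Function.update U a (0, k) d = (1, k + t) := by rw [Function.update_of_ne had.symm, hd]
  have e1a : (Function.update U a (0, k) a).1 = 0 := by rw [Function.update_self]
  -- S2: raise `b` in `N001` to exactly `2`: `V`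
  obtain ⟨c₁, h1lt, h1le, hV, h1t⟩ := M.raise3 hh hN001 (g := b) (a := c) (b := d) (f := a) hbc hbd hab.symm hcd hac.symm had.symm
    (one_le_of_eq_one (by rw [e1b])) (one_le_of_eq_one (by rw [e1c])) (one_le_of_eq_one (by rw [e1d])) e1a
  rw [show (Function.update U a (0, k) b).1 = 1 by rw [e1b]] at h1lt
  have hc₁ : c₁ = 2 := by
    rcases (by omega : c₁ = 2 ∨ c₁ = 3) with e | e
    · exact e
    · exfalso; have := h1t e; rw [e1c, e1d] at this; exact hkt this.symm
  subst hc₁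
  rw [show (Function.update U a (0, k) b).2 = k by rw [e1b]] at hV
  have eVa : (Function.update (Function.update U a (0, k)) b (2, k) a).1 = 0 := by
    rw [Function.update_of_ne hab, Function.update_self]
  have eVb : Function.update (Function.update U a (0, k)) b (2, k) b = (2, k) := by rw [Function.update_self]
  have eVc : Function.update (Function.update U a (0, k)) b (2, k) c = (1, k) := by rw [Function.update_of_ne hbc.symm, e1c]
  have eVd : Function.update (Function.update U a (0, k)) b (2, k) d = (1, k + t) := by rw [Function.update_of_ne hbd.symm, e1d]
  -- S3: `unit_sibling` kills `V[d ≔ (1,k)]`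
  have S3 : ¬ vP (Function.update (Function.update (Function.update U a (0, k)) b (2, k)) d (1, k)) :=
    M.unit_sibling hV (s := d) (f := a) had eVa (by rw [eVd]) (by rw [eVd]; exact fun e => hkt e.symm)
  -- S4: `W`
  have hW := M.w_of hh hN000 hab hac had hbc hbd hcd (k := k)
    (by rw [Function.update_of_ne had, ha]) (by rw [Function.update_of_ne hbd, hb]) (by rw [Function.update_of_ne hcd, hc])
    (by rw [Function.update_self]) (V := Function.update (Function.update (Function.update U a (0, k)) b (2, k)) d (1, k))
    (by rw [Function.update_of_ne had, eVa]) (by rw [Function.update_of_ne hbd, eVb]) (by rw [Function.update_of_ne hcd, eVc])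
    (by rw [Function.update_self]) S3
  -- S9/S10: raise `d` in `N001`: charge `3` is `Z` (absent by `z_absent`), so it lands at charge `2`: `Q`
  obtain ⟨c₂, h2lt, h2le, hQ, -⟩ := M.raise3 hh hN001 (g := d) (a := b) (b := c) (f := a) hbd.symm hcd.symm had.symm hbc hab.symm
    hac.symm (one_le_of_eq_one (by rw [e1d])) (one_le_of_eq_one (by rw [e1b])) (one_le_of_eq_one (by rw [e1c])) e1a
  rw [show (Function.update U a (0, k) d).1 = 1 by rw [e1d]] at h2lt
  rw [show (Function.update U a (0, k) d).2 = k + t by rw [e1d]] at hQ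
  have hc₂ : c₂ = 2 := by
    rcases (by omega : c₂ = 2 ∨ c₂ = 3) with e | e
    · exact e
    · exfalso; subst e
      exact M.z_absent hh hW hab hac had hbc hbd hcd (k := k) (t := t) (by rw [Function.update_self])
        (by rw [Function.update_of_ne hab.symm, Function.update_of_ne hbd, hb])
        (by rw [Function.update_of_ne hac.symm, Function.update_of_ne hcd, hc])
        (by rw [Function.update_of_ne had.symm, Function.update_self]) ht
        (by rw [Function.update_of_ne had, Function.update_self]) (by rw [Function.update_of_ne hbd, e1b])
        (by rw [Function.update_of_ne hcd, e1c]) (by rw [Function.update_self]) hQ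
  subst hc₂
  -- S11: `N21 = V[c ≔ apex]`
  have hN21 := M.unit_hub hV (s := c) (by rw [eVc]) 0
  have e2a : (Function.update (Function.update (Function.update U a (0, k)) b (2, k)) c (0, 0) a).1 = 0 := by
    rw [Function.update_of_ne hac, eVa]
  have e2b : Function.update (Function.update (Function.update U a (0, k)) b (2, k)) c (0, 0) b = (2, k) := by
    rw [Function.update_of_ne hbc, eVb]
  have e2c : (Function.update (Function.update (Function.update U a (0, k)) b (2, k)) c (0, 0) c).1 = 0 := by
    rw [Function.update_self]
  have e2d : Function.update (Function.update (Function.update U a (0, k)) b (2, k)) c (0, 0) d = (1, k + t) := by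
    rw [Function.update_of_ne hcd.symm, eVd]
  -- the charge-4 siblings `[apex@a, 4_k@b, apex@c, 1_j@d]` (`j ≠ k`) are dead: slots permuted they are `top3_sibling4` siblings of `W`
  have S7 : ∀ (Y : ACell) (j : Fin 4), j ≠ k → (Y a).1 = 0 → Y b = (4, k) → (Y c).1 = 0 → Y d = (1, j) → ¬ vP Y := by
    intro Y j hj hYa hYb hYc hYd hY
    have hS := M.permP _ (M.permP _ hY (Equiv.swap a b)) (Equiv.swap c d)
    refine M.top3_sibling4 hh hW (g := a) (b := b) (c := c) hab hac hbc (by rw [Function.update_self])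
      (by rw [Function.update_of_ne hab.symm, Function.update_of_ne hbd, hb]) (by rw [Function.update_of_ne hac.symm,
        Function.update_of_ne hcd, hc]) hj (M.congrP hS (fun i => ?_))
    rcases fin4_cover hab hac had hbc hbd hcd i with hi | hi | hi | hi <;> rw [hi]
    · left
      rw [Equiv.swap_apply_of_ne_of_ne hac had, Equiv.swap_apply_left, hYb, Function.update_of_ne hac, Function.update_self]
    · right
      rw [Equiv.swap_apply_of_ne_of_ne hbc hbd, Equiv.swap_apply_right, Function.update_of_ne hbc,
        Function.update_of_ne (Ne.symm hab), Function.update_self]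
      exact ⟨hYa, rfl⟩
    · left
      rw [Equiv.swap_apply_left, Equiv.swap_apply_of_ne_of_ne had.symm hbd.symm, hYd, Function.update_self]
    · right
      rw [Equiv.swap_apply_right, Equiv.swap_apply_of_ne_of_ne hac.symm hbc.symm, Function.update_of_ne hcd.symm,
        Function.update_of_ne had.symm, Function.update_of_ne hbd.symm, Function.update_of_ne had.symm, Function.update_self]
      exact ⟨hYc, rfl⟩
  -- S12: raise `b` in `N21` to exactly `3`: `R`
  obtain ⟨c₃, h3lt, h3le, hR⟩ := M.raise2 hh hN21 (g := b) (b := d) hbd (one_le_of_eq_two (by rw [e2b]))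
    (one_le_of_eq_one (by rw [e2d]))
  rw [show (Function.update (Function.update (Function.update U a (0, k)) b (2, k)) c (0, 0) b).1 = 2 by rw [e2b]] at h3lt
  rw [show (Function.update (Function.update (Function.update U a (0, k)) b (2, k)) c (0, 0) b).2 = k by rw [e2b]] at hR
  have hc₃ : c₃ = 3 := by
    rcases (by omega : c₃ = 3 ∨ c₃ = 4) with e | e
    · exact e
    · exfalso; subst e
      exact S7 _ (k + t) (fun e => hkt e) (by rw [Function.update_of_ne hab, e2a]) (by rw [Function.update_self])
        (by rw [Function.update_of_ne (Ne.symm hbc), e2c]) (by rw [Function.update_of_ne hbd.symm, e2d]) hR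
  subst hc₃
  -- S13: `unit_sibling` on `R` kills `R[d ≔ (1, k−t)]`
  have S13 : ¬ vP (Function.update (Function.update (Function.update (Function.update (Function.update U a (0, k)) b (2, k))
      c (0, 0)) b (3, k)) d (1, k + -t)) :=
    M.unit_sibling hR (s := d) (f := a) had (by rw [Function.update_of_ne hab, e2a]) (by rw [Function.update_of_ne hbd.symm, e2d])
      (by rw [Function.update_of_ne hbd.symm, e2d]; exact hkmt)
  -- S14: `Nx = N21[d ≔ (1, k−t)]` is absent: its raises of `b` are `R[d ≔ 1_{k−t}]` (S13) and a charge-4 sibling (S7)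
  have S14 : ¬ vN (Function.update (Function.update (Function.update (Function.update U a (0, k)) b (2, k)) c (0, 0)) d
      (1, k + -t)) := by
    intro hNx
    obtain ⟨c₄, h4lt, h4le, hP⟩ := M.raise2 hh hNx (g := b) (b := d) hbd
      (one_le_of_eq_two (by rw [Function.update_of_ne hbd, e2b])) (one_le_of_eq_one (by rw [Function.update_self]))
    have e4b : Function.update (Function.update (Function.update (Function.update U a (0, k)) b (2, k)) c (0, 0)) d
        (1, k + -t) b = (2, k) := by rw [Function.update_of_ne hbd, e2b]
    rw [show (Function.update (Function.update (Function.update (Function.update U a (0, k)) b (2, k)) c (0, 0)) d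
        (1, k + -t) b).1 = 2 by rw [e4b]] at h4lt
    rw [show (Function.update (Function.update (Function.update (Function.update U a (0, k)) b (2, k)) c (0, 0)) d
        (1, k + -t) b).2 = k by rw [e4b]] at hP
    rcases (by omega : c₄ = 3 ∨ c₄ = 4) with e | e
    · subst e
      rw [Function.update_comm hbd.symm] at hP
      exact S13 hP
    · subst e
      exact S7 _ (k + -t) hkm (by rw [Function.update_of_ne hab, Function.update_of_ne had, e2a]) (by rw [Function.update_self])
        (by rw [Function.update_of_ne (Ne.symm hbc), Function.update_of_ne hcd, e2c])
        (by rw [Function.update_of_ne hbd.symm, Function.update_self]) hP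
  -- S15: RD-P at the unit `b` of `Q`, swapped and shifted by `−t`, is `Nx`
  have hN'' := M.unit_hub hQ (s := b) (by rw [Function.update_of_ne hbd, e1b]) 0
  have hS := M.shiftN_by (M.permN _ (M.permN _ hN'' (Equiv.swap b d)) (Equiv.swap c d)) (-t)
  refine S14 (M.congrN hS (fun i => ?_))
  dsimp only
  rcases fin4_cover hab hac had hbc hbd hcd i with hi | hi | hi | hi <;> rw [hi]
  · right
    rw [Equiv.swap_apply_of_ne_of_ne hac had, Equiv.swap_apply_of_ne_of_ne hab had, Function.update_of_ne hab,
      Function.update_of_ne had, e1a, Function.update_of_ne had, e2a]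
    exact ⟨rfl, rfl⟩
  · left
    rw [Equiv.swap_apply_of_ne_of_ne hbc hbd, Equiv.swap_apply_left, Function.update_of_ne (Ne.symm hbd), Function.update_self,
      Function.update_of_ne hbd, e2b]
    exact Prod.ext rfl (fin4_add_add_neg k t)
  · right
    rw [Equiv.swap_apply_left, Equiv.swap_apply_right, Function.update_self, Function.update_of_ne hcd, e2c]
    exact ⟨rfl, rfl⟩
  · left
    rw [Equiv.swap_apply_right, Equiv.swap_apply_of_ne_of_ne (Ne.symm hbc) hcd, Function.update_of_ne (Ne.symm hbc),
      Function.update_of_ne hcd, e1c, Function.update_self]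

end LineModel

/-- the shape of an odd tag word (finite check): there is a slot `s` such that the other three tags are all equal and `x s` differs from
them by an odd amount (type `000t`), or two of the other three are antipodal and `x s` lies outside that antipodal class (types
`0012 ∕ 0023`, up to shift). -/
theorem odd_unit_tags_aux : ∀ x0 x1 x2 x3 : Fin 4, (x0.val % 2 + x1.val % 2 + x2.val % 2 + x3.val % 2) % 2 = 1 →
    ∃ s : Fin 4,
      (![x0, x1, x2, x3] (s + 2) = ![x0, x1, x2, x3] (s + 1) ∧ ![x0, x1, x2, x3] (s + 3) = ![x0, x1, x2, x3] (s + 1) ∧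
          ![x0, x1, x2, x3] s ≠ ![x0, x1, x2, x3] (s + 1) ∧
          ![x0, x1, x2, x3] s - ![x0, x1, x2, x3] (s + 1) + (![x0, x1, x2, x3] s - ![x0, x1, x2, x3] (s + 1)) ≠ 0) ∨
      (![x0, x1, x2, x3] (s + 3) = ![x0, x1, x2, x3] (s + 1) + 2 ∧ ![x0, x1, x2, x3] s ≠ ![x0, x1, x2, x3] (s + 1) ∧
          ![x0, x1, x2, x3] s ≠ ![x0, x1, x2, x3] (s + 1) + 2) ∨
      (![x0, x1, x2, x3] (s + 3) = ![x0, x1, x2, x3] (s + 2) + 2 ∧ ![x0, x1, x2, x3] s ≠ ![x0, x1, x2, x3] (s + 2) ∧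
          ![x0, x1, x2, x3] s ≠ ![x0, x1, x2, x3] (s + 2) + 2) ∨
      (![x0, x1, x2, x3] (s + 2) = ![x0, x1, x2, x3] (s + 1) + 2 ∧ ![x0, x1, x2, x3] s ≠ ![x0, x1, x2, x3] (s + 1) ∧
          ![x0, x1, x2, x3] s ≠ ![x0, x1, x2, x3] (s + 1) + 2) := by
  decide

theorem odd_unit_tags (x : Fin 4 → Fin 4) (hx : ((x 0).val % 2 + (x 1).val % 2 + (x 2).val % 2 + (x 3).val % 2) % 2 = 1) :
    ∃ s : Fin 4,
      (x (s + 2) = x (s + 1) ∧ x (s + 3) = x (s + 1) ∧ x s ≠ x (s + 1) ∧ x s - x (s + 1) + (x s - x (s + 1)) ≠ 0) ∨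
      (x (s + 3) = x (s + 1) + 2 ∧ x s ≠ x (s + 1) ∧ x s ≠ x (s + 1) + 2) ∨
      (x (s + 3) = x (s + 2) + 2 ∧ x s ≠ x (s + 2) ∧ x s ≠ x (s + 2) + 2) ∨
      (x (s + 2) = x (s + 1) + 2 ∧ x s ≠ x (s + 1) ∧ x s ≠ x (s + 1) + 2) := by
  have e : ![x 0, x 1, x 2, x 3] = x := by funext i; fin_cases i <;> rfl
  have := odd_unit_tags_aux (x 0) (x 1) (x 2) (x 3) hx
  rw [e] at this
  exact this

/-- **THE UNIT NUCLEUS IS EMPTY BELOW TWELVE (PROVED, h-uniform)** — formerly the one MACHINE input of the odd threshold law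
(`UNITPROBE-h10.txt`; `L10-G1` LRAT ×2 + the critic's replay): every odd unit cell is of type `000t` (`units4_odd_absent`) or of antipodal type
(`unitP_antipodal_absent`), and every `(2;1,1,1)` odd cell is `two_units3_absent`. -/
theorem abstractOddUnitNucleusFree_of_lt_twelve {h : ℤ} (hh : h < 12) : AbstractOddUnitNucleusFree h := by
  intro vN vP M X hodd hshape hX
  obtain ⟨hc, hpar⟩ := hodd
  rcases hshape with hunit | ⟨g, hg2, hg1, hgt⟩
  · obtain ⟨s, hs⟩ := odd_unit_tags (fun i => (X i).2) hpar
    obtain ⟨h1, h2, h3, h12, h13, h23⟩ := fin4_others s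
    rcases hs with ⟨e2, e3, hne, hodd2⟩ | ⟨e3, hne, hne2⟩ | ⟨e3, hne, hne2⟩ | ⟨e2, hne, hne2⟩
    · exact M.units4_odd_absent hh hX h12 h13 h1 h23 h2 h3 (hunit _) (hunit _) (hunit _) (hunit _) e2 e3 hne hodd2
    · exact M.unitP_antipodal_absent hh hX (a := s + 1) (b := s) (c := s + 3) (d := s + 2) h1 h13 h12 h3.symm h2.symm h23.symm
        (hunit _) (hunit _) (hunit _) (hunit _) e3 hne hne2
    · exact M.unitP_antipodal_absent hh hX (a := s + 2) (b := s) (c := s + 3) (d := s + 1) h2 h23 h12.symm h3.symm h1.symm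
        h13.symm (hunit _) (hunit _) (hunit _) (hunit _) e3 hne hne2
    · exact M.unitP_antipodal_absent hh hX (a := s + 1) (b := s) (c := s + 2) (d := s + 3) h1 h12 h13 h2.symm h3.symm h23
        (hunit _) (hunit _) (hunit _) (hunit _) e2 hne hne2
  · obtain ⟨h1, h2, h3, h12, h13, h23⟩ := fin4_others g
    have hne : (X g).2 ≠ (X (g + 1)).2 := by
      intro e
      have all : ∀ i, (X i).2 = (X (g + 1)).2 := by
        intro i
        by_cases hi : i = g
        · rw [hi]; exact e
        · exact hgt i (g + 1) hi h1
      rw [all 0, all 1, all 2, all 3] at hpar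
      omega
    exact M.two_units3_absent hh hX (a := g + 1) (b := g + 2) (c := g + 3) (d := g) h12 h13 h1 h23 h2 h3 (hg1 _ h1) (hg1 _ h2)
      (hg1 _ h3) hg2 (hgt _ _ h2 h1) (hgt _ _ h3 h1) hne

/-- **NO ODD FC BELOW TWELVE, abstractly (PROVED, h-uniform)** — `AbstractOddFree h` for every `h < 12`; sharp (`not_abstractOddFree_of_twelve_le`). -/
theorem abstractOddFree_of_lt_twelve {h : ℤ} (hh : h < 12) : AbstractOddFree h :=
  abstractOddFree_of_unitNucleus hh (abstractOddUnitNucleusFree_of_lt_twelve hh)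

/-- **`(OL_h)` FOR EVERY `h < 12` (PROVED, sorry-free, uniformly in `h`)**: no `G₁`-closed RULE-D∕`X+` design supported on two adjacent LINE
alphabets of height `< 12` has an odd fully charged cell.  All four W-LINE «odd FC» rows of the census below twelve (LINE-8, LINE-10 UNSAT:
j326579 ∕ j326707; and the odd heights) are now KERNEL consequences of the four closed forms; LINE-12 SAT is `not_oddFCFreeLine_twelve`. -/
theorem oddFCFreeLine_of_lt_twelve {h : ℤ} (hh : h < 12) : OddFCFreeLine h :=
  oddFCFreeLine_of_abstract (abstractOddFree_of_lt_twelve hh)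

/-- **THE ODD THRESHOLD LAW ON THE LINE IS A THEOREM** (PROVED outright, sorry-free): `(∀ h ≤ 10, OddFCFreeLine h) ∧ ¬ OddFCFreeLine 12`. -/
theorem oddLineThresholdLaw_holds : OddLineThresholdLaw :=
  oddLineThresholdLaw_of_unitNucleus (abstractOddUnitNucleusFree_of_lt_twelve (by norm_num))

/-! ## Part K — THE PHASE-TYPE LAW IS A THEOREM: `PureFCLine h` for `h < 10`, `AntipodalFCLine h` for `h < 12`, `PhaseTypeLaw`

The two remaining LRAT-certified finite checks of Part D (`AbstractPureFC 8` = UNSAT of `L8-G1-mixfc`, `AbstractAntipodalFC 10` = UNSAT of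
`L10-G1-nap`) fall to the same levers.  Purity below ten is Part I (`fcP_tags_const_below_ten`, no FC `N`-cell below ten).  Antipodality
below twelve: FC `N`-cells have four equal tags (`fcN_tags_const`); an FC `P`-cell with a charge-2 letter has four equal tags
(`fcP_tags_around_two` + `two_units3_absent`); a unit FC `P`-cell with two tags of different parity is of type `000t` (`t` odd), contains an
antipodal pair with a tag outside its class, or is of type `0011` — the first two are Part J, the third is `units_0011_absent` below
(UP chain of 12 literals at ten: `upchain.py 10 'P:1_0,1_0,1_1,1_1'`). -/

theorem fin4_add_one_one : ∀ k : Fin 4, k + 1 + 1 = k + 2 := by decide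

namespace LineModel

variable {h : ℤ} {vN vP : ACell → Prop}

/-- **THE `0011`-TYPE UNIT CELLS ARE ABSENT below twelve (PROVED)**: `U = P[1_k@a, 1_k@b, 1_{k+1}@c, 1_{k+1}@d]`.  Chain: the hubs
`N1 = U[a ≔ apex]` and `N2 = U[c ≔ apex]` raise (RD-N2; charge 3 would force the two remaining tags `k`, `k+1` to agree, `raise3`) to
`V1 = P[·, 1_k, 2_{k+1}, 1_{k+1}]` and `V2 = P[2_k, 1_k, ·, 1_{k+1}]`; and `V2` with slots `a ↔ c`, `b ↔ d` swapped and tags shifted by `1`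
is `P[·, 1_{k+2}, 2_{k+1}, 1_{k+1}]`, the unit sibling of `V1` at `b` — excluded by `unit_sibling`.  (Type `0033` is the same cell.) -/
theorem units_0011_absent (M : LineModel h vN vP) (hh : h < 12) {U : ACell} (hU : vP U) {a b c d : Fin 4} (hab : a ≠ b)
    (hac : a ≠ c) (had : a ≠ d) (hbc : b ≠ c) (hbd : b ≠ d) (hcd : c ≠ d) (ha1 : (U a).1 = 1) (hb1 : (U b).1 = 1)
    (hc1 : (U c).1 = 1) (hd1 : (U d).1 = 1) (hb2 : (U b).2 = (U a).2) (hc2 : (U c).2 = (U a).2 + 1)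
    (hd2 : (U d).2 = (U a).2 + 1) : False := by
  have hb : U b = (1, (U a).2) := Prod.ext hb1 hb2
  have hc : U c = (1, (U a).2 + 1) := Prod.ext hc1 hc2
  have hd : U d = (1, (U a).2 + 1) := Prod.ext hd1 hd2
  -- the hub `N1 = U[a ≔ apex]`, raised at `c` to exactly `2`
  have hN1 := M.unit_hub hU ha1 0
  have e1a : Function.update U a ((0 : ℕ), (0 : Fin 4)) a = (0, 0) := Function.update_self _ _ _
  have e1b : Function.update U a ((0 : ℕ), (0 : Fin 4)) b = (1, (U a).2) := by rw [Function.update_of_ne hab.symm, hb]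
  have e1c : Function.update U a ((0 : ℕ), (0 : Fin 4)) c = (1, (U a).2 + 1) := by rw [Function.update_of_ne hac.symm, hc]
  have e1d : Function.update U a ((0 : ℕ), (0 : Fin 4)) d = (1, (U a).2 + 1) := by rw [Function.update_of_ne had.symm, hd]
  have h1c1 : (Function.update U a ((0 : ℕ), (0 : Fin 4)) c).1 = 1 := by rw [e1c]
  have h1b1 : (Function.update U a ((0 : ℕ), (0 : Fin 4)) b).1 = 1 := by rw [e1b]
  have h1d1 : (Function.update U a ((0 : ℕ), (0 : Fin 4)) d).1 = 1 := by rw [e1d]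
  have h1a0 : (Function.update U a ((0 : ℕ), (0 : Fin 4)) a).1 = 0 := by rw [e1a]
  obtain ⟨c₁, h1lt, h1le, hV1, h1t⟩ := M.raise3 hh hN1 hbc.symm hcd hac.symm hbd hab.symm had.symm (one_le_of_eq_one h1c1)
    (one_le_of_eq_one h1b1) (one_le_of_eq_one h1d1) h1a0
  rw [h1c1] at h1lt
  have hc₁ : c₁ = 2 := by
    rcases (by omega : c₁ = 2 ∨ c₁ = 3) with e | e
    · exact e
    · exfalso
      have := h1t e
      rw [e1b, e1d] at this
      exact fin4_add_ne_of_ne_zero (U a).2 1 (by decide) this.symm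
  subst hc₁
  rw [show (Function.update U a ((0 : ℕ), (0 : Fin 4)) c).2 = (U a).2 + 1 by rw [e1c]] at hV1
  -- the hub `N2 = U[c ≔ apex]`, raised at `a` to exactly `2`
  have hN2 := M.unit_hub hU hc1 0
  have e2a : Function.update U c ((0 : ℕ), (0 : Fin 4)) a = (1, (U a).2) := by
    rw [Function.update_of_ne hac]; exact Prod.ext ha1 rfl
  have e2b : Function.update U c ((0 : ℕ), (0 : Fin 4)) b = (1, (U a).2) := by rw [Function.update_of_ne hbc, hb]
  have e2c : Function.update U c ((0 : ℕ), (0 : Fin 4)) c = (0, 0) := Function.update_self _ _ _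
  have e2d : Function.update U c ((0 : ℕ), (0 : Fin 4)) d = (1, (U a).2 + 1) := by rw [Function.update_of_ne hcd.symm, hd]
  have h2a1 : (Function.update U c ((0 : ℕ), (0 : Fin 4)) a).1 = 1 := by rw [e2a]
  have h2b1 : (Function.update U c ((0 : ℕ), (0 : Fin 4)) b).1 = 1 := by rw [e2b]
  have h2d1 : (Function.update U c ((0 : ℕ), (0 : Fin 4)) d).1 = 1 := by rw [e2d]
  have h2c0 : (Function.update U c ((0 : ℕ), (0 : Fin 4)) c).1 = 0 := by rw [e2c]
  obtain ⟨c₂, h2lt, h2le, hV2, h2t⟩ := M.raise3 hh hN2 hab had hac hbd hbc hcd.symm (one_le_of_eq_one h2a1)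
    (one_le_of_eq_one h2b1) (one_le_of_eq_one h2d1) h2c0
  rw [h2a1] at h2lt
  have hc₂ : c₂ = 2 := by
    rcases (by omega : c₂ = 2 ∨ c₂ = 3) with e | e
    · exact e
    · exfalso
      have := h2t e
      rw [e2b, e2d] at this
      exact fin4_add_ne_of_ne_zero (U a).2 1 (by decide) this.symm
  subst hc₂
  rw [show (Function.update U c ((0 : ℕ), (0 : Fin 4)) a).2 = (U a).2 by rw [e2a]] at hV2
  -- `V2`, slots `a ↔ c`, `b ↔ d` swapped and shifted by `1`, is the `b`-sibling `(1, k+2)` of `V1`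
  have hS := M.shiftP_by (M.permP _ (M.permP _ hV2 (Equiv.swap a c)) (Equiv.swap b d)) 1
  have hT : vP (Function.update (Function.update (Function.update U a ((0 : ℕ), (0 : Fin 4))) c (2, (U a).2 + 1)) b
      (1, (U a).2 + 2)) := by
    refine M.congrP hS (fun i => ?_)
    dsimp only
    rcases fin4_cover hab hac had hbc hbd hcd i with hi | hi | hi | hi <;> rw [hi]
    · right
      rw [Equiv.swap_apply_of_ne_of_ne hab had, Equiv.swap_apply_left, Function.update_of_ne hac.symm, e2c,
        Function.update_of_ne hab, Function.update_of_ne hac, e1a]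
      exact ⟨rfl, rfl⟩
    · left
      rw [Equiv.swap_apply_left, Equiv.swap_apply_of_ne_of_ne had.symm hcd.symm, Function.update_of_ne had.symm, e2d,
        Function.update_self]
      exact Prod.ext rfl (fin4_add_one_one _)
    · left
      rw [Equiv.swap_apply_of_ne_of_ne hbc.symm hcd, Equiv.swap_apply_right, Function.update_self,
        Function.update_of_ne hbc.symm, Function.update_self]
    · left
      rw [Equiv.swap_apply_right, Equiv.swap_apply_of_ne_of_ne hab.symm hbc, Function.update_of_ne hab.symm, e2b,
        Function.update_of_ne hbd.symm, Function.update_of_ne hcd.symm, e1d]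
  refine M.unit_sibling hV1 (s := b) (f := a) hab ?_ ?_ ?_ hT
  · rw [Function.update_of_ne hac, e1a]
  · rw [Function.update_of_ne hbc, e1b]
  · rw [Function.update_of_ne hbc, e1b]; exact fin4_add_two_ne _


/-- below twelve an FC `P`-cell with a charge-2 letter at `g0` has four equal tags (PROVED: `fcP_tags_around_two` for the other three; for
the tag at `g0` a second charge-2 letter gives it by the same lemma, else the cell is `P[1_k,1_k,1_k,2_{k'}]` and `two_units3_absent`). -/
theorem fcP_tags_const_of_two (M : LineModel h vN vP) (hh : h < 12) {X : ACell} (hP : vP X) (hc : ∀ f, 1 ≤ (X f).1)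
    {g0 : Fin 4} (hg0 : 2 ≤ (X g0).1) (i : Fin 4) : (X i).2 = (X (g0 + 1)).2 := by
  have hle : ∀ i, (X i).1 ≤ 2 := fun i => M.fcP_charge_le_two hh hP hc i
  obtain ⟨h1, h2, h3, h12, h13, h23⟩ := fin4_others g0
  have hb2 : (X (g0 + 2)).2 = (X (g0 + 1)).2 := M.fcP_tags_around_two hh hP hc hg0 h2.symm h1.symm
  have hc2 : (X (g0 + 3)).2 = (X (g0 + 1)).2 := M.fcP_tags_around_two hh hP hc hg0 h3.symm h1.symm
  have hg0t : (X g0).2 = (X (g0 + 1)).2 := by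
    by_cases e1 : (X (g0 + 1)).1 = 1
    · by_cases e2 : (X (g0 + 2)).1 = 1
      · by_cases e3 : (X (g0 + 3)).1 = 1
        · by_contra hne
          have hd2 : (X g0).1 = 2 := by have := hle g0; omega
          exact M.two_units3_absent hh hP h12 h13 h1 h23 h2 h3 e1 e2 e3 hd2 hb2 hc2 hne
        · have hg3 : 2 ≤ (X (g0 + 3)).1 := by have := hc (g0 + 3); omega
          exact M.fcP_tags_around_two hh hP hc hg3 h3 h13.symm
      · have hg2 : 2 ≤ (X (g0 + 2)).1 := by have := hc (g0 + 2); omega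
        exact M.fcP_tags_around_two hh hP hc hg2 h2 h12.symm
    · have hg1 : 2 ≤ (X (g0 + 1)).1 := by have := hc (g0 + 1); omega
      exact (M.fcP_tags_around_two hh hP hc hg1 h1 h12).trans hb2
  rcases fin4_cover h1.symm h2.symm h3.symm h12 h13 h23 i with hi | hi | hi | hi <;> rw [hi]
  · exact hg0t
  · exact hb2
  · exact hc2

end LineModel

/-- the shape of a unit tag word with two tags of different parity (finite check): a slot `s` such that the other three tags are
equal and `x s` is at odd distance (type `000t`), or two of the other three are antipodal and `x s` lies outside their class, or the
word is of type `0011` ∕ `0033` read from `s`. -/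
theorem nonanti_unit_tags_aux : ∀ x0 x1 x2 x3 : Fin 4,
    (∃ f g : Fin 4, (![x0, x1, x2, x3] f).val % 2 ≠ (![x0, x1, x2, x3] g).val % 2) →
    ∃ s : Fin 4,
      (![x0, x1, x2, x3] (s + 2) = ![x0, x1, x2, x3] (s + 1) ∧ ![x0, x1, x2, x3] (s + 3) = ![x0, x1, x2, x3] (s + 1) ∧
          ![x0, x1, x2, x3] s ≠ ![x0, x1, x2, x3] (s + 1) ∧
          ![x0, x1, x2, x3] s - ![x0, x1, x2, x3] (s + 1) + (![x0, x1, x2, x3] s - ![x0, x1, x2, x3] (s + 1)) ≠ 0) ∨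
      (![x0, x1, x2, x3] (s + 3) = ![x0, x1, x2, x3] (s + 1) + 2 ∧ ![x0, x1, x2, x3] s ≠ ![x0, x1, x2, x3] (s + 1) ∧
          ![x0, x1, x2, x3] s ≠ ![x0, x1, x2, x3] (s + 1) + 2) ∨
      (![x0, x1, x2, x3] (s + 3) = ![x0, x1, x2, x3] (s + 2) + 2 ∧ ![x0, x1, x2, x3] s ≠ ![x0, x1, x2, x3] (s + 2) ∧
          ![x0, x1, x2, x3] s ≠ ![x0, x1, x2, x3] (s + 2) + 2) ∨
      (![x0, x1, x2, x3] (s + 2) = ![x0, x1, x2, x3] (s + 1) + 2 ∧ ![x0, x1, x2, x3] s ≠ ![x0, x1, x2, x3] (s + 1) ∧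
          ![x0, x1, x2, x3] s ≠ ![x0, x1, x2, x3] (s + 1) + 2) ∨
      (![x0, x1, x2, x3] (s + 1) = ![x0, x1, x2, x3] s ∧ ![x0, x1, x2, x3] (s + 2) = ![x0, x1, x2, x3] s + 1 ∧
          ![x0, x1, x2, x3] (s + 3) = ![x0, x1, x2, x3] s + 1) ∨
      (![x0, x1, x2, x3] (s + 2) = ![x0, x1, x2, x3] s ∧ ![x0, x1, x2, x3] (s + 1) = ![x0, x1, x2, x3] s + 1 ∧
          ![x0, x1, x2, x3] (s + 3) = ![x0, x1, x2, x3] s + 1) ∨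
      (![x0, x1, x2, x3] (s + 3) = ![x0, x1, x2, x3] s ∧ ![x0, x1, x2, x3] (s + 1) = ![x0, x1, x2, x3] s + 1 ∧
          ![x0, x1, x2, x3] (s + 2) = ![x0, x1, x2, x3] s + 1) := by
  decide

theorem nonanti_unit_tags (x : Fin 4 → Fin 4) (hx : ∃ f g : Fin 4, (x f).val % 2 ≠ (x g).val % 2) :
    ∃ s : Fin 4,
      (x (s + 2) = x (s + 1) ∧ x (s + 3) = x (s + 1) ∧ x s ≠ x (s + 1) ∧ x s - x (s + 1) + (x s - x (s + 1)) ≠ 0) ∨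
      (x (s + 3) = x (s + 1) + 2 ∧ x s ≠ x (s + 1) ∧ x s ≠ x (s + 1) + 2) ∨
      (x (s + 3) = x (s + 2) + 2 ∧ x s ≠ x (s + 2) ∧ x s ≠ x (s + 2) + 2) ∨
      (x (s + 2) = x (s + 1) + 2 ∧ x s ≠ x (s + 1) ∧ x s ≠ x (s + 1) + 2) ∨
      (x (s + 1) = x s ∧ x (s + 2) = x s + 1 ∧ x (s + 3) = x s + 1) ∨
      (x (s + 2) = x s ∧ x (s + 1) = x s + 1 ∧ x (s + 3) = x s + 1) ∨
      (x (s + 3) = x s ∧ x (s + 1) = x s + 1 ∧ x (s + 2) = x s + 1) := by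
  have e : ![x 0, x 1, x 2, x 3] = x := by funext i; fin_cases i <;> rfl
  have := nonanti_unit_tags_aux (x 0) (x 1) (x 2) (x 3) (by rw [e]; exact hx)
  rw [e] at this
  exact this

/-- **`(APP_h)` FOR EVERY `h < 10` (PROVED)**: below ten no abstract model makes a non-pure FC cell present — FC `N`-cells need
`2(c+4) ≤ h` (`fcN_gap_four`), FC `P`-cells have four equal tags (`fcP_tags_const_below_ten`).  Formerly MACHINE (`L8-G1-mixfc` LRAT). -/
theorem abstractPureFC_of_lt_ten {h : ℤ} (hh : h < 10) : AbstractPureFC h := by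
  intro vN vP M X hX
  obtain ⟨hc, f, g, hfg⟩ := hX
  refine ⟨fun hN => ?_, fun hP => hfg (M.fcP_tags_const_below_ten hh hP hc f g)⟩
  have h8 := M.fcN_gap_four hN hc f
  have h1 := hc f
  omega

/-- **`(AAP_h)` FOR EVERY `h < 12` (PROVED)**: below twelve no abstract model makes a non-antipodal FC cell present.  FC `N`-cells have
four equal tags (`fcN_tags_const`); an FC `P`-cell with a charge-2 letter has four equal tags (`fcP_tags_around_two`, and
`two_units3_absent` for the tag of the charge-2 letter itself); a unit FC `P`-cell with two tags of different parity is refuted by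
`units4_odd_absent` ∕ `unitP_antipodal_absent` ∕ `units_0011_absent` according to `nonanti_unit_tags`.  Formerly MACHINE (`L10-G1-nap`). -/
theorem abstractAntipodalFC_of_lt_twelve {h : ℤ} (hh : h < 12) : AbstractAntipodalFC h := by
  intro vN vP M X hX
  obtain ⟨hc, f, g, hfg⟩ := hX
  refine ⟨fun hN => hfg (by rw [M.fcN_tags_const hN hc hh f g]), fun hP => ?_⟩
  by_cases h2 : ∃ g0, 2 ≤ (X g0).1
  · -- a charge-2 letter at `g0`: all four tags coincide (`fcP_tags_const_of_two`, Part L)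
    obtain ⟨g0, hg0⟩ := h2
    exact hfg (by rw [M.fcP_tags_const_of_two hh hP hc hg0 f, M.fcP_tags_const_of_two hh hP hc hg0 g])
  · -- a unit cell
    push Not at h2
    have hunit : ∀ i, (X i).1 = 1 := fun i => by have := hc i; have := h2 i; omega
    obtain ⟨s, hs⟩ := nonanti_unit_tags (fun i => (X i).2) ⟨f, g, hfg⟩
    obtain ⟨h1, h2, h3, h12, h13, h23⟩ := fin4_others s
    rcases hs with ⟨e2, e3, hne, hodd2⟩ | ⟨e3, hne, hne2⟩ | ⟨e3, hne, hne2⟩ | ⟨e2, hne, hne2⟩ | ⟨e1, e2, e3⟩ |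
        ⟨e2, e1, e3⟩ | ⟨e3, e1, e2⟩
    · exact M.units4_odd_absent hh hP h12 h13 h1 h23 h2 h3 (hunit _) (hunit _) (hunit _) (hunit _) e2 e3 hne hodd2
    · exact M.unitP_antipodal_absent hh hP (a := s + 1) (b := s) (c := s + 3) (d := s + 2) h1 h13 h12 h3.symm h2.symm h23.symm
        (hunit _) (hunit _) (hunit _) (hunit _) e3 hne hne2
    · exact M.unitP_antipodal_absent hh hP (a := s + 2) (b := s) (c := s + 3) (d := s + 1) h2 h23 h12.symm h3.symm h1.symm
        h13.symm (hunit _) (hunit _) (hunit _) (hunit _) e3 hne hne2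
    · exact M.unitP_antipodal_absent hh hP (a := s + 1) (b := s) (c := s + 2) (d := s + 3) h1 h12 h13 h2.symm h3.symm h23
        (hunit _) (hunit _) (hunit _) (hunit _) e2 hne hne2
    · exact M.units_0011_absent hh hP (a := s) (b := s + 1) (c := s + 2) (d := s + 3) h1.symm h2.symm h3.symm h12 h13 h23
        (hunit _) (hunit _) (hunit _) (hunit _) e1 e2 e3
    · exact M.units_0011_absent hh hP (a := s) (b := s + 2) (c := s + 1) (d := s + 3) h2.symm h1.symm h3.symm h12.symm h23 h13
        (hunit _) (hunit _) (hunit _) (hunit _) e2 e1 e3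
    · exact M.units_0011_absent hh hP (a := s) (b := s + 3) (c := s + 1) (d := s + 2) h3.symm h1.symm h2.symm h13.symm h23.symm
        h12 (hunit _) (hunit _) (hunit _) (hunit _) e3 e1 e2

/-- **`(PP_h)` FOR EVERY `h < 10` (PROVED, sorry-free, h-uniform)**: every fully charged cell of a `G₁`-static RULE-D∕`X+` LINE design of
height `< 10` is phase-pure. -/
theorem pureFCLine_of_lt_ten {h : ℤ} (hh : h < 10) : PureFCLine h :=
  pureFCLine_of_abstract (abstractPureFC_of_lt_ten hh)

/-- **`(AP_h)` FOR EVERY `h < 12` (PROVED, sorry-free, h-uniform)**: every fully charged cell of a `G₁`-static RULE-D∕`X+` LINE design of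
height `< 12` is antipodal (its charged phases lie in one class `{k₀, k₀+2}`); sharp (`not_antipodalFCLine_twelve`). -/
theorem antipodalFCLine_of_lt_twelve {h : ℤ} (hh : h < 12) : AntipodalFCLine h :=
  antipodalFCLine_of_abstract (abstractAntipodalFC_of_lt_twelve hh)

/-- **THE PHASE-TYPE LAW IS A THEOREM** (PROVED outright, sorry-free): `PureFCLine 8 ∧ AntipodalFCLine 10`. -/
theorem phaseTypeLaw_holds : PhaseTypeLaw :=
  phaseTypeLaw_of_abstract (abstractPureFC_of_lt_ten (by norm_num)) (abstractAntipodalFC_of_lt_twelve (by norm_num))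

/-! ## Part L — THE FC SHAPE LAW BELOW TWELVE (h-uniform, PROVED): FC `N`-cells are pure; FC `P`-cells are pure or `P[1_k,1_k,1_{k+2},1_{k+2}]`

The last non-pure antipodal shape below twelve, the unit cell of type `0002` (charge-2 letters force four equal tags, `fcP_tags_const_of_two`),
dies by the 22-literal UP chain `upchain.py 10 'P:1_0,1_0,1_0,1_2'` (`UPCHAIN-h10-0002.txt`) read h-uniformly (`units_0002_absent`); so the FC
census of the LINE below twelve is: pure cells, plus the unit `0022` cell (MACHINE: SAT from ten) — `fcP_shape_below_twelve`, `fcShapeLine_of_lt_twelve`. -/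

namespace LineModel

variable {h : ℤ} {vN vP : ACell → Prop}

/-- **THE `0002`-TYPE UNIT CELL IS ABSENT below twelve (PROVED)**: `U = P[1_k@a, 1_k@b, 1_k@c, 1_{k+2}@d]`.  Chain: in the hub
`N1 = U[a ≔ apex]` the unit `b` raises to exactly `2` (`raise3`), `Vr = P[·, 2_k, 1_k, 1_{k+2}]`; its unit siblings `Vr[d ≔ 1_k]`, `Vr[c ≔ 1_{k+2}]`
are absent; the second (swap `b ↔ d`, shift `2`) is the charge-2 raise of `d` in `N1`, so `d` raises to `3`: `W1 = P[·, 1_k, 1_k, 3_{k+2}]`, whose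
hub `W1[b ≔ apex]` raises `d` to `4`: `Q1 = P[·, ·, 1_k, 4_{k+2}]`; the first feeds `w_of` at `N2 = U[d ≔ apex]`: `W2 = P[3_k, 1_k, 1_k, ·]`, and `Q1`
(swap `a ↔ d`, shift `2`) is `P[4_k, ·, 1_{k+2}, ·]`, the sibling excluded by `top3_sibling4` at `W2`. -/
theorem units_0002_absent (M : LineModel h vN vP) (hh : h < 12) {U : ACell} (hU : vP U) {a b c d : Fin 4} (hab : a ≠ b)
    (hac : a ≠ c) (had : a ≠ d) (hbc : b ≠ c) (hbd : b ≠ d) (hcd : c ≠ d) (ha1 : (U a).1 = 1) (hb1 : (U b).1 = 1)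
    (hc1 : (U c).1 = 1) (hd1 : (U d).1 = 1) (hb2 : (U b).2 = (U a).2) (hc2 : (U c).2 = (U a).2)
    (hd2 : (U d).2 = (U a).2 + 2) : False := by
  have ha : U a = (1, (U a).2) := Prod.ext ha1 rfl
  have hb : U b = (1, (U a).2) := Prod.ext hb1 hb2
  have hc : U c = (1, (U a).2) := Prod.ext hc1 hc2
  have hd : U d = (1, (U a).2 + 2) := Prod.ext hd1 hd2
  -- the hub `N1 = U[a ≔ apex]`; the unit `b` raises to exactly `2`
  have hN1 := M.unit_hub hU ha1 0
  have e1a : Function.update U a ((0 : ℕ), (0 : Fin 4)) a = (0, 0) := Function.update_self _ _ _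
  have e1b : Function.update U a ((0 : ℕ), (0 : Fin 4)) b = (1, (U a).2) := by rw [Function.update_of_ne hab.symm, hb]
  have e1c : Function.update U a ((0 : ℕ), (0 : Fin 4)) c = (1, (U a).2) := by rw [Function.update_of_ne hac.symm, hc]
  have e1d : Function.update U a ((0 : ℕ), (0 : Fin 4)) d = (1, (U a).2 + 2) := by rw [Function.update_of_ne had.symm, hd]
  have h1a0 : (Function.update U a ((0 : ℕ), (0 : Fin 4)) a).1 = 0 := by rw [e1a]
  have h1b1 : (Function.update U a ((0 : ℕ), (0 : Fin 4)) b).1 = 1 := by rw [e1b]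
  have h1c1 : (Function.update U a ((0 : ℕ), (0 : Fin 4)) c).1 = 1 := by rw [e1c]
  have h1d1 : (Function.update U a ((0 : ℕ), (0 : Fin 4)) d).1 = 1 := by rw [e1d]
  obtain ⟨c₁, h1lt, h1le, hVr, h1t⟩ := M.raise3 hh hN1 hbc hbd hab.symm hcd hac.symm had.symm (one_le_of_eq_one h1b1)
    (one_le_of_eq_one h1c1) (one_le_of_eq_one h1d1) h1a0
  rw [h1b1] at h1lt
  have hc₁ : c₁ = 2 := by
    rcases (by omega : c₁ = 2 ∨ c₁ = 3) with e | e
    · exact e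
    · exfalso
      have := h1t e
      rw [e1c, e1d] at this
      exact fin4_add_two_ne (U a).2 this.symm
  subst hc₁
  rw [show (Function.update U a ((0 : ℕ), (0 : Fin 4)) b).2 = (U a).2 by rw [e1b]] at hVr
  have eVa : Function.update (Function.update U a ((0 : ℕ), (0 : Fin 4))) b (2, (U a).2) a = (0, 0) := by
    rw [Function.update_of_ne hab, e1a]
  have eVb : Function.update (Function.update U a ((0 : ℕ), (0 : Fin 4))) b (2, (U a).2) b = (2, (U a).2) :=
    Function.update_self _ _ _
  have eVc : Function.update (Function.update U a ((0 : ℕ), (0 : Fin 4))) b (2, (U a).2) c = (1, (U a).2) := by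
    rw [Function.update_of_ne hbc.symm, e1c]
  have eVd : Function.update (Function.update U a ((0 : ℕ), (0 : Fin 4))) b (2, (U a).2) d = (1, (U a).2 + 2) := by
    rw [Function.update_of_ne hbd.symm, e1d]
  -- the two unit siblings of `Vr` are absent
  have hSd := M.unit_sibling hVr (s := d) (f := a) had (by rw [eVa]) (by rw [eVd]) (k'' := (U a).2)
    (by rw [eVd]; exact (fin4_add_two_ne _).symm)
  have hSc := M.unit_sibling hVr (s := c) (f := a) hac (by rw [eVa]) (by rw [eVc]) (k'' := (U a).2 + 2)
    (by rw [eVc]; exact fin4_add_two_ne _)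
  -- the unit `d` of `N1` raises to exactly `3`: `W1`
  obtain ⟨c₂, h2lt, h2le, hW1, -⟩ := M.raise3 hh hN1 hbd.symm hcd.symm had.symm hbc hab.symm hac.symm (one_le_of_eq_one h1d1)
    (one_le_of_eq_one h1b1) (one_le_of_eq_one h1c1) h1a0
  rw [h1d1] at h2lt
  rw [show (Function.update U a ((0 : ℕ), (0 : Fin 4)) d).2 = (U a).2 + 2 by rw [e1d]] at hW1
  have hc₂ : c₂ = 3 := by
    rcases (by omega : c₂ = 2 ∨ c₂ = 3) with e | e
    · exfalso
      subst e
      apply hSc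
      have hS := M.shiftP_by (M.permP _ hW1 (Equiv.swap b d)) 2
      refine M.congrP hS (fun i => ?_)
      dsimp only
      rcases fin4_cover hab hac had hbc hbd hcd i with hi | hi | hi | hi <;> rw [hi]
      · right
        rw [Equiv.swap_apply_of_ne_of_ne hab had, Function.update_of_ne had, e1a, Function.update_of_ne hac, eVa]
        exact ⟨rfl, rfl⟩
      · left
        rw [Equiv.swap_apply_left, Function.update_self, Function.update_of_ne hbc, eVb]
        exact Prod.ext rfl (fin4_add_two_two _)
      · left
        rw [Equiv.swap_apply_of_ne_of_ne hbc.symm hcd, Function.update_of_ne hcd, e1c, Function.update_self]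
      · left
        rw [Equiv.swap_apply_right, Function.update_of_ne hbd, e1b, Function.update_of_ne hcd.symm,
          Function.update_of_ne hbd.symm, e1d]
    · exact e
  subst hc₂
  -- the hub `W1[b ≔ apex]` raises `d` to `4`: `Q1 = P[·, ·, 1_k, 4_{k+2}]`
  have eW1b : Function.update (Function.update U a ((0 : ℕ), (0 : Fin 4))) d (3, (U a).2 + 2) b = (1, (U a).2) := by
    rw [Function.update_of_ne hbd, e1b]
  have hH1 := M.unit_hub hW1 (s := b) (by rw [eW1b]) 0
  have eH1d : Function.update (Function.update (Function.update U a ((0 : ℕ), (0 : Fin 4))) d (3, (U a).2 + 2)) b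
      ((0 : ℕ), (0 : Fin 4)) d = (3, (U a).2 + 2) := by
    rw [Function.update_of_ne hbd.symm, Function.update_self]
  have eH1c : Function.update (Function.update (Function.update U a ((0 : ℕ), (0 : Fin 4))) d (3, (U a).2 + 2)) b
      ((0 : ℕ), (0 : Fin 4)) c = (1, (U a).2) := by
    rw [Function.update_of_ne hbc.symm, Function.update_of_ne hcd, e1c]
  obtain ⟨c₃, h3lt, h3le, hQ1⟩ := M.raise2 hh hH1 (g := d) (b := c) hcd.symm (by rw [eH1d]; omega)
    (one_le_of_eq_one (by rw [eH1c]))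
  rw [show (Function.update (Function.update (Function.update U a ((0 : ℕ), (0 : Fin 4))) d (3, (U a).2 + 2)) b
      ((0 : ℕ), (0 : Fin 4)) d).1 = 3 by rw [eH1d]] at h3lt
  have hc₃ : c₃ = 4 := by omega
  subst hc₃
  rw [show (Function.update (Function.update (Function.update U a ((0 : ℕ), (0 : Fin 4))) d (3, (U a).2 + 2)) b
      ((0 : ℕ), (0 : Fin 4)) d).2 = (U a).2 + 2 by rw [eH1d]] at hQ1
  -- the other hub `N2 = U[d ≔ apex]`: `w_of` (fed by the absent sibling `Vr[d ≔ 1_k]`) gives `W2 = N2[a ≔ 3_k]`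
  have hN2 := M.unit_hub hU hd1 0
  have e2a : Function.update U d ((0 : ℕ), (0 : Fin 4)) a = (1, (U a).2) := by rw [Function.update_of_ne had, ha]
  have e2b : Function.update U d ((0 : ℕ), (0 : Fin 4)) b = (1, (U a).2) := by rw [Function.update_of_ne hbd, hb]
  have e2c : Function.update U d ((0 : ℕ), (0 : Fin 4)) c = (1, (U a).2) := by rw [Function.update_of_ne hcd, hc]
  have e2d : Function.update U d ((0 : ℕ), (0 : Fin 4)) d = (0, 0) := Function.update_self _ _ _
  have hW2 := M.w_of hh hN2 hab hac had hbc hbd hcd e2a e2b e2c (by rw [e2d])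
    (V := Function.update (Function.update (Function.update U a ((0 : ℕ), (0 : Fin 4))) b (2, (U a).2)) d (1, (U a).2))
    (by rw [Function.update_of_ne had, eVa]) (by rw [Function.update_of_ne hbd, eVb]) (by rw [Function.update_of_ne hcd, eVc])
    (Function.update_self _ _ _) hSd
  -- `Q1` swapped `a ↔ d` and shifted by `2` is the sibling `P[4_k, ·, 1_{k+2}, ·]` excluded by `top3_sibling4` at `W2`
  refine M.top3_sibling4 hh hW2 (g := a) (b := b) (c := c) hab hac hbc (Function.update_self _ _ _)
    (by rw [Function.update_of_ne hab.symm, e2b]) (by rw [Function.update_of_ne hac.symm, e2c]) (j := (U a).2 + 2)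
    (fin4_add_two_ne _) ?_
  have hS := M.shiftP_by (M.permP _ hQ1 (Equiv.swap a d)) 2
  refine M.congrP hS (fun i => ?_)
  dsimp only
  rcases fin4_cover hab hac had hbc hbd hcd i with hi | hi | hi | hi <;> rw [hi]
  · left
    rw [Equiv.swap_apply_left, Function.update_self, Function.update_of_ne hac, Function.update_self]
    exact Prod.ext rfl (fin4_add_two_two _)
  · right
    rw [Equiv.swap_apply_of_ne_of_ne hab.symm hbd, Function.update_of_ne hbd, Function.update_self,
      Function.update_of_ne hbc, Function.update_of_ne hab.symm, Function.update_self]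
    exact ⟨rfl, rfl⟩
  · left
    rw [Equiv.swap_apply_of_ne_of_ne hac.symm hcd, Function.update_of_ne hcd, Function.update_of_ne hbc.symm,
      Function.update_of_ne hcd, e1c, Function.update_self]
  · right
    rw [Equiv.swap_apply_right, Function.update_of_ne had, Function.update_of_ne hab, Function.update_of_ne had, e1a,
      Function.update_of_ne hcd.symm, Function.update_of_ne had.symm, Function.update_of_ne hbd.symm,
      Function.update_of_ne had.symm, e2d]
    exact ⟨rfl, rfl⟩

end LineModel

/-- unit tag words of one parity class with two different tags: type `0002` or `0022` read from a slot `s` (finite check). -/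
theorem anti_unit_tags_aux : ∀ x0 x1 x2 x3 : Fin 4,
    (∀ f g : Fin 4, (![x0, x1, x2, x3] f).val % 2 = (![x0, x1, x2, x3] g).val % 2) →
    (∃ f g : Fin 4, ![x0, x1, x2, x3] f ≠ ![x0, x1, x2, x3] g) →
    ∃ s : Fin 4,
      (![x0, x1, x2, x3] (s + 2) = ![x0, x1, x2, x3] (s + 1) ∧ ![x0, x1, x2, x3] (s + 3) = ![x0, x1, x2, x3] (s + 1) ∧
          ![x0, x1, x2, x3] s = ![x0, x1, x2, x3] (s + 1) + 2) ∨
      (![x0, x1, x2, x3] (s + 1) = ![x0, x1, x2, x3] s ∧ ![x0, x1, x2, x3] (s + 2) = ![x0, x1, x2, x3] s + 2 ∧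
          ![x0, x1, x2, x3] (s + 3) = ![x0, x1, x2, x3] s + 2) ∨
      (![x0, x1, x2, x3] (s + 2) = ![x0, x1, x2, x3] s ∧ ![x0, x1, x2, x3] (s + 1) = ![x0, x1, x2, x3] s + 2 ∧
          ![x0, x1, x2, x3] (s + 3) = ![x0, x1, x2, x3] s + 2) ∨
      (![x0, x1, x2, x3] (s + 3) = ![x0, x1, x2, x3] s ∧ ![x0, x1, x2, x3] (s + 1) = ![x0, x1, x2, x3] s + 2 ∧
          ![x0, x1, x2, x3] (s + 2) = ![x0, x1, x2, x3] s + 2) := by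
  decide

namespace LineModel

variable {h : ℤ} {vN vP : ACell → Prop}

/-- **FC SHAPE BELOW TWELVE on `P` (PROVED, h-uniform)**: a fully charged `P`-cell of an abstract model of height `< 12` has four
equal tags, or is the unit cell `P[1_k@a, 1_k@b, 1_{k+2}@c, 1_{k+2}@d]`. -/
theorem fcP_shape_below_twelve (M : LineModel h vN vP) (hh : h < 12) {X : ACell} (hP : vP X) (hc : ∀ f, 1 ≤ (X f).1) :
    (∀ f g : Fin 4, (X f).2 = (X g).2) ∨
      ((∀ f, (X f).1 = 1) ∧ ∃ a b c d : Fin 4, a ≠ b ∧ a ≠ c ∧ a ≠ d ∧ b ≠ c ∧ b ≠ d ∧ c ≠ d ∧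
        (X b).2 = (X a).2 ∧ (X c).2 = (X a).2 + 2 ∧ (X d).2 = (X a).2 + 2) := by
  by_cases hpure : ∀ f g : Fin 4, (X f).2 = (X g).2
  · exact Or.inl hpure
  right
  push Not at hpure
  obtain ⟨f, g, hfg⟩ := hpure
  have hpar : ∀ a b : Fin 4, (X a).2.val % 2 = (X b).2.val % 2 := by
    intro a b
    by_contra hne
    exact ((abstractAntipodalFC_of_lt_twelve hh) vN vP M X ⟨hc, a, b, hne⟩).2 hP
  have hunit : ∀ i, (X i).1 = 1 := by
    intro i
    by_contra hi
    have hi2 : 2 ≤ (X i).1 := by have := hc i; omega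
    exact hfg (by rw [M.fcP_tags_const_of_two hh hP hc hi2 f, M.fcP_tags_const_of_two hh hP hc hi2 g])
  refine ⟨hunit, ?_⟩
  have e : ![(X 0).2, (X 1).2, (X 2).2, (X 3).2] = fun i => (X i).2 := by funext i; fin_cases i <;> rfl
  have hs' := anti_unit_tags_aux (X 0).2 (X 1).2 (X 2).2 (X 3).2 (by rw [e]; exact hpar) (by rw [e]; exact ⟨f, g, hfg⟩)
  rw [e] at hs'
  obtain ⟨s, hs⟩ := hs'
  obtain ⟨h1, h2, h3, h12, h13, h23⟩ := fin4_others s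
  rcases hs with ⟨e2, e3, e0⟩ | ⟨e1, e2, e3⟩ | ⟨e2, e1, e3⟩ | ⟨e3, e1, e2⟩
  · exact (M.units_0002_absent hh hP (a := s + 1) (b := s + 2) (c := s + 3) (d := s) h12 h13 h1 h23 h2 h3
      (hunit _) (hunit _) (hunit _) (hunit _) e2 e3 e0).elim
  · exact ⟨s, s + 1, s + 2, s + 3, h1.symm, h2.symm, h3.symm, h12, h13, h23, e1, e2, e3⟩
  · exact ⟨s, s + 2, s + 1, s + 3, h2.symm, h1.symm, h3.symm, h12.symm, h23, h13, e2, e1, e3⟩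
  · exact ⟨s, s + 3, s + 1, s + 2, h3.symm, h1.symm, h2.symm, h13.symm, h23.symm, h12, e3, e1, e2⟩

end LineModel

/-- **THE FC SHAPE LAW BELOW TWELVE (PROVED, h-uniform)**: in a `G₁`-static RULE-D∕`X+` effective LINE design of height `h < 12` every
fully charged `N`-cell is phase-pure, and every fully charged `P`-cell is phase-pure or the unit cell `P((1,k),(1,k),(1,k+2),(1,k+2))`
(which IS present at ten — MACHINE, falsifier (a)).  With Part K: below ten every FC cell is pure; heights `10, 11` add this one shape. -/
theorem fcShapeLine_of_lt_twelve {h : ℤ} (hh : h < 12) {C : MConfig} (hC : LSupport h C) (hG : C.G1Closed)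
    (hD : RuleDMu4Closed C) (hXp : XPlusClosed C) :
    (∀ Z ∈ C.lower, FCc Z → PureCell h Z) ∧
    (∀ Z ∈ C.upper, FCc Z → PureCell h Z ∨ ∃ k : Fin 4, ∃ a b c d : Fin 4, a ≠ b ∧ a ≠ c ∧ a ≠ d ∧ b ≠ c ∧ b ≠ d ∧ c ≠ d ∧
      Z a = lineLetter h 1 k ∧ Z b = lineLetter h 1 k ∧ Z c = lineLetter h 1 (k + 2) ∧ Z d = lineLetter h 1 (k + 2)) := by
  have hM := lineModel_of_config hC hG hD hXp
  refine ⟨fun Z hZ hFC => ?_, fun Z hZ hFC => ?_⟩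
  · obtain ⟨X, rfl⟩ := exists_realize (hC.1 Z hZ)
    have hc := charges_pos_of_fcc hFC
    refine ⟨(X 0).2, fun f c k e _ => ?_⟩
    rw [realize_apply] at e
    obtain ⟨-, hk⟩ := lineLetter_inj (hc f) e
    rw [← hk]
    exact hM.fcN_tags_const hZ hc hh f 0
  · obtain ⟨X, rfl⟩ := exists_realize (hC.2 Z hZ)
    have hc := charges_pos_of_fcc hFC
    rcases hM.fcP_shape_below_twelve hh hZ hc with heq | ⟨hunit, a, b, c, d, hab, hac, had, hbc, hbd, hcd, eb, ec, ed⟩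
    · left
      refine ⟨(X 0).2, fun f c k e _ => ?_⟩
      rw [realize_apply] at e
      obtain ⟨-, hk⟩ := lineLetter_inj (hc f) e
      rw [← hk]
      exact heq f 0
    · right
      refine ⟨(X a).2, a, b, c, d, hab, hac, had, hbc, hbd, hcd, ?_, ?_, ?_, ?_⟩
      · rw [realize_apply, hunit a]
      · rw [realize_apply, hunit b, eb]
      · rw [realize_apply, hunit c, ec]
      · rw [realize_apply, hunit d, ed]

end Summit.HodgeConjecture.HodgeConjecture.Cruxes.BlochSeedDiscOne.LinePhaseRigidity
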